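import Summits.PneNP.PneNP.Theses.OneSlice
import Literature.Computability.Complexity.Rossman2008
import Literature.Computability.Complexity.Rossman2008CliqueProofs
import Literature.Computability.Complexity.CliqueTestGraphs
import Literature.Computability.Complexity.RossmanMonotoneCliqueProofs
import Literature.Computability.Complexity.CliqueCounting
import Literature.Computability.Complexity.GnpSprinkling
import Literature.Computability.Complexity.ACRealize
import Literature.Computability.Complexity.ACRealizeConnectives
import Literature.Computability.Complexity.ACRealizeOver
import Literature.Computability.Complexity.CliqueRestriction
import Literature.Combinatorics.SetFamily.BiasedMeasure
import Literature.Computability.Complexity.CliqueThresholdBounds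

set_option linter.dupNamespace false

/-!
# Disproof attempts on `SliceACZero` (crux stmt-PneNP-2835, route PneNP/OneSlice) — findings

`SliceACZero` is an implication `Hyp → Conc` (`sliceACZero_iff`, definitional), in schedule form
`Hyp = ∀ d c, ∃ k ≥ 3, ∃ δ > 0, InnerHyp d c k δ`, `Conc = ∀ d c, ∃ k ≥ 3, ∃ δ > 0, InnerConc d c k δ`:

* `InnerHyp d c k δ` = "eventually in n, for EVERY density q in the critical window
  |q·C(n,2) − m_k(n)| ≤ m_k(n)^{3/4}, every {¬,∧,∨}-circuit of acDepth ≤ d whose G(n,q)-error against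
  k-CLIQUE is ≤ δ has more than n^c gates" — `Hyp` is the fixed-δ, window-uniform, single-threshold
  average-case AC⁰ lower bound (Rossman 2008 strength; NOT provable or refutable cheaply here:
  `Literature.Computability.Complexity.rossman2008_thm11` is vendored but refuted AS PRINTED in a
  degenerate corner, `not_rossman2008_thm11`; the corrected fact is pending acq-02439);
* `InnerConc d c k δ` = the same with G(n,q) replaced by the uniform measure on every central slice
  (exactly j edges, |j − m_k(n)| ≤ m_k(n)^{3/4}; error count ≤ δ · #slice).

## Verdict of this pass: NO KILL.  Why it resists

A refutation needs `Hyp ∧ ¬Conc`.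
1. `Hyp` is (a mild strengthening of) Rossman's single-threshold AC⁰ theorem; certifying it is a
   major formalisation (switching lemmas at density n^{-2/(k-1)}), far outside a disprover's box,
   and there is no reason to believe it false (vacuity risk LOW, see item notes gen-2).
2. `¬Conc` says: for some fixed depth d and exponent c, for EVERY k ≥ 3 and δ > 0, infinitely often
   some central slice carries a depth-d AC circuit with ≤ n^c gates that δ-approximates k-CLIQUE.
   Degenerate circuits do not provide this: on a central slice Pr[k-clique] → 1 − e^{-1/k!} ∈ (0,1)
   (Poisson/second moment), so literals (size 0), constants (size 1) and single gates have error
   bounded below by min(e^{-1/k!}, 1 − e^{-1/k!})/2 once δ is chosen after k; a genuine poly-size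
   constant-depth average-case k-clique detector with k-independent exponent would be needed — the
   slice analogue of a counterexample to Rossman 2008, against the total-influence heuristic
   (adding j^{0.6} random edges moves a uniform j-edge graph to a uniform (j + j^{0.6})-edge graph and
   flips a width-t DNF w.p. ≲ t·j^{-0.4}).
3. Small/finite models say nothing: every clause is under `∀ᶠ n in atTop`.
So the crux is "true if the slice switching/influence technology exists" (declared difficulty L);
the disprover's certified output is the LOAD-BEARING analysis below.

## Certified content (all sorry-free; parts I, II, IV, V are filed under `Theorems/SliceACZero/Negative/`; VI and III live here)

I. LOAD-BEARING CLAUSES (parametrised inner forms; each dropped clause makes the inner clause false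
   for ALL admissible parameters, so the corresponding global statement is false outright and the crux
   with that clause dropped from its conclusion is equivalent to `¬Hyp`, i.e. provable only vacuously):
  * `not_innerConcNoWindow`  — drop centrality of j (any d, c; k ≥ 2; δ ≥ 0): slice j = 0 is the
    empty graph, the gate-free circuit `x_e` (size 0, depth 0) is exact there;
  * `not_innerConcWindowAbove` — keep only `m_k(n) ≤ j` (d ≥ 1): top slice j = C(n,2), gate `∧₀`;
  * `not_innerConcNoBasis`   — drop `C.IsOver acBasis` (d ≥ 1): ONE gate of fan-in C(n,2) whose
    truth table IS k-CLIQUE (size 1, acDepth 1, error 0 on every slice);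
  * `not_innerConcNoError`   — drop the accuracy hypothesis: `x_e`;
  * `not_innerHypNoWindow` (q = 0), `not_innerHypNoBasis` (clique gate at the central density) — the
    same clauses on the hypothesis side;
  * global corollaries `not_concNoWindow`, `not_concWindowAbove`, `not_concNoBasis`, `not_concNoError`,
    `not_hypNoWindow`, `not_hypNoBasis`.
II. ORDER OF QUANTIFIERS / TIGHTNESS IN k: `not_innerConc_of_le`, `not_innerHyp_of_le` — for
   `d ≥ 2` and `k ≤ c` the GENUINE inner clause is false for EVERY δ ≥ 0 (exhaustive clique DNF, in
   tree as `exists_cliqueDNF_monotoneAC`: acDepth ≤ 2, ≤ C(n,k)+1 ≤ n^c gates, exact); hence every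
   witness has `c < k` (`lt_of_innerConc`, `lt_of_innerHyp`) and the strengthenings with `∀ c ∀ k`
   are false (`not_concForallK`, `not_hypForallK`). A prover must let `k` grow with `c`
   (Rossman/Amano: `k ≈ 4c + O(1)` is the truth).
IV. δ MUST SHRINK WITH k (first moments): `firstMoment_slice` — on a slice `j ≤ C(n,2)·n^{-2/(k-1)}`
   at most a `1/k!`-fraction of the graphs carry a `k`-clique (exact superset count on the slice +
   ratio bound; slice analogue of the in-tree `gnpProb_clique_le`); hence for `d ≥ 1` and
   `δ ≥ 1/k!` the inner clauses are false via the constant-`0` circuit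
   (`not_innerConc_of_factorial_inv_le`, `not_innerHyp_of_factorial_inv_le`), every witness has
   `δ < 1/k!` (`lt_factorial_inv_of_innerConc/Hyp`), and the quantifier order `∃ δ ∀ c ∃ k` is false
   (`not_concDeltaFirst`, `not_hypDeltaFirst`).
V. HOW DEEP MAY THE WINDOW REACH? `not_innerConcLowWindow` — moving the lower window edge to
   `m · n^{-ε}` (any fixed `ε > 0`) makes the inner clause of `Conc` false for every `δ > 0`
   (`d ≥ 1`, `k ≥ 3`): on the slice `j = ⌈m n^{-ε}⌉₊` at most a `(2n^{-ε})^{C(k,2)}/k!`-fraction carries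
   a `k`-clique (`firstMoment_slice'`), so the constant-`0` circuit is `δ`-accurate. The admissible
   windows are `m · n^{±o(1)}`; the route's `m ± m^{3/4}` is inside (the upper edge at `m · n^{ε}` would
   need `Pr_j[no k-clique] → 0` on the slice, second moment — not attempted).
VI. THE `∀ᶠ` THRESHOLD MUST GROW WITH k (`mk_four`, `innerConc_body_false_at_four`): at `n = 4`,
   `k = 101` the window `5 ± 5^{3/4}` contains the EMPTY slices `j = 7, 8 > C(4,2)`, where `x_e`
   (size 0) meets the accuracy hypothesis `0 ≤ δ·0`; so the body of `Conc` at a fixed `n` fails for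
   suitable `k` and the threshold `n₀(k)` of `∀ᶠ n` is genuinely `k`-dependent (provers: ensure
   `m + m^{3/4} ≤ C(n,2)` eventually before touching slices).
III. (work file only) `Hyp`, `Conc` as names, `sliceACZero_iff'`, the packaging
   `(Hyp → Conc-without-X) ↔ ¬Hyp`, and `sliceTarget_of_concNoDepth`: dropping `C.acDepth ≤ d` from
   `Conc` gives a statement that IMPLIES the route TARGET `SliceTarget` (monotone fan-in-2 circuits are
   AC circuits; on one slice monotone = general by Berkowitz, so the two are equivalent up to the
   polynomial overhead of `SliceMonotonization`) — the depth bound is exactly what makes this a rung.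
Not attempted: the upper polynomial-width window `[m, m·n^ε]` (should fail via `Pr_j[no k-clique] → 0`,
second moment on the slice; not in tree) — recorded as a paper claim only.


## Gen-2 / cycle 2 (2026-08-16, refuter-cdisprove-stmt-PneNP-2835-g2-0): status of the lines + Part VII

STATUS. The crux is being PROVED, not refuted: the lead picked `russo-window-ladder` (PICKED.md); the
registered skeleton is `Lines/binomial-hybrid-influence-budget.lean` v2 (same lever: Filmus–Mossel §8
one-edge hybrid over slices + binomial hazard `O(√m)` + AND-coin + `I = Σ_k W^{≥k}` + Boppana/LMN via
the in-tree Tal theorem `ACForm.tailWeight_le_tailBound`, which is PROVED, as is `Circuit.exists_acForm`).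
Its five stubs are classical TRUE facts (two drefute passes, exact brute force, 0 stub-false). So a kill
of the crux would need a kill of Boppana's theorem or of the hybrid identity — there is none. This pass
therefore certifies the LOAD-BEARING HYPOTHESES OF THE LINES' C⁺ instead (Part VII), in the generic-cube
vocabulary of `russo-window-ladder` (`wt/prodWeight/prodAvg/sliceAvg`, copied verbatim; the edge cube
`E(K_n) ≃ Fin C(n,2)` is a special case and the three witnesses are symmetric functions, so they bite
`sliceGap` of the binomial line equally):

VII. `SliceIndist` (C⁺: for `j ≥ j₀`, `2j ≤ N`, every `acBasis` circuit of `acDepth ≤ d` and `≤ j^c`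
   gates has `|E_{μ_{j/N}}[C] − a_j(C)| ≤ ε`) — each of its three structural hypotheses is NEEDED:
  * `not_sliceIndistNearTop` (any `d ≥ 1`, any `c`): weaken `2j ≤ N` to `j < N` ⇒ FALSE. Witness: one
    `∧`-gate over all `N = j+1` inputs at the slice `j = N−1`: `a_j = 0`, `E_{μ_{j/N}} = (1−1/N)^N ≥ 1/6`
    (`sixth_le`). By the ones/zeros symmetry the honest hypothesis is `min(j, N−j) → ∞` (rate
    `polylog/√min(j,N−j)`); the crux only ever uses `j ≈ m_k(n) ≪ N`, so `2j ≤ N` is the right half.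
  * `not_sliceIndistNoSize` (any `d ≥ 2`): drop `C.size ≤ j^c` ⇒ FALSE. Witness: the exact-weight DNF
    `[|x| = j]` (`exists_exactWeight_circuit`, `acDepth 2`, size `≈ C(N,j)`) at `N = 2j`: `a_j = 1`,
    `E_{μ_{1/2}} = C(2j,j)/4^j ≤ 1/2` (`two_mul_centralBinom_le`). Depth 2 alone does not fool the slice;
    SMALL depth 2 does — the size enters only through `polylog(size)` (Boppana), and this witness shows
    the dependence cannot be removed. (At `d = 1` the size-free statement is plausibly TRUE with rate
    `O(1/j)`: a single `∧/∨` of literals; not pursued.)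
  * `not_sliceIndistNoDepth` (any `c ≥ 2`): drop `C.acDepth ≤ d` ⇒ FALSE. Witness: PARITY as a chain of
    XORs over `acBasis` (`exists_parity_circuit`: `≤ 5N+1` gates, depth `≈ 2N`) at `N = 2j`, `j` even:
    parity vanishes identically on the slice, `E_{μ_{1/2}} = 1/2` (`two_mul_card_filter_odd_wt`). The
    depth bound is exactly what Boppana consumes (total influence `N` vs `polylog(size)^{d-1}`).
  All three are sorry-free (standard axioms) and filed as `Theorems/SliceACZero/Negative/SliceIndistVariants.lean`.
  Read-back of the C⁺ in Lean semantics (for the provers): `sliceAvg f j = 0/0 = 0` for `j > N` is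
  excluded by `2j ≤ N`; `prodAvg` at `q = j/N ∈ [0,1/2]`; `|·|` is the real absolute value; `C.size`
  counts `¬`-gates, `acDepth` does not — consistent with `acInfluence`/`boppana` (`max d 1`).
Not attempted this cycle (recorded for the next): the UPPER window edge `m·n^{ε}` of `Conc` (needs
`Pr_j[no k-clique] → 0` on the slice: LYM monotonicity of a down-set's slice densities + Markov for
`Bin(N, j/2N)` + second moment / disjoint-block amplification in `G(n,q)`; none of the three in tree).

## Gen-2 / cycle 2, Part VIII (NEW crux-level result): the window of `Conc` cannot be widened UPWARD

VIII. Symmetric completion of Part V. `not_innerConcHighWindow` — moving the upper window edge to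
   `m · n^{θ}` makes the inner clause of `Conc` false for every `δ > 0` whenever `θ > 2/k` (`d ≥ 1`,
   `k ≥ 3`): on the slice `j = ⌊m n^{θ'}⌋₊` (`2/k < θ' < 2/(k-1)`) the constant-`1` circuit is
   `δ`-accurate, because `Pr_j[no k-clique] ≤ 2·Pr_{G(n, j/2N)}[no k-clique]` (VIII-A: slice densities
   of a DOWN-SET are non-increasing by Mathlib's local LYM, and `Bin(N, j/2N)` puts mass `≥ 1/2` below
   `j` by Markov) and `Pr_{G(n,q)}[no k-clique] ≤ (1 − q^{C(k,2)})^{⌊n/k⌋} ≤ exp(−⌊n/k⌋ q^{C(k,2)}) → 0`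
   (VIII-B: disjoint vertex blocks, independence via the in-tree planting identity
   `sum_filter_forall_gnpWeight_mul`; `⌊n/k⌋ q^{C(k,2)} ≳ n^{1+θ'C(k,2)−k}/(2k·4^{C(k,2)}) → ∞` iff
   `θ' > 2/k`). `not_innerConcHighWindow_of_le` — for `k ≤ c` (`d ≥ 2`) it fails for EVERY `θ ≥ 0`
   (clique DNF at the centre). Hence the GLOBAL statement with the window `[m, m·n^{θ}]` is false for
   every `θ > 0`: `not_concHighWindow` (`d = 2`, `c = ⌈2/θ⌉₊ + 1`). With Part V: the admissible windows
   of `Conc` are exactly `m · n^{±o(1)}` at the level of the global statement; the per-`k` sharp claim for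
   `0 < θ ≤ 2/k` would need Janson at density `p·n^{θ}` (not attempted). Reusable by-products:
   `card_slice_div_choose_le_two_mul_sum_biasedWeight` (any down-set, any cube),
   `gnpProb_cliqueFree_le_pow`, `card_slice_cliqueFree_le`. Filed as
   `Theorems/SliceACZero/Negative/{SliceDensity, DisjointCliques, WindowHigh}.lean`.
   VIII-D (`not_innerHypHighWindow`, `not_innerHypHighWindow_of_le`, `not_hypHighWindow`): the same on
   the HYPOTHESIS side — `Hyp` with its `q`-window widened up to `q·C(n,2) = m·n^{θ}` is false for every
   `θ > 0` (such a "more generous" `Hyp` would make the crux vacuously true). Filed as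
   `Theorems/SliceACZero/Negative/WindowHighHyp.lean`.
   VIII-E (`not_innerHypLowWindow`, `not_hypLowWindow`, `not_concLowWindow`): the hypothesis-side mirror of
   Part V (lower edge `q·C(n,2) = m·n^{-ε}`, first moment, constant-`0` circuit) and the global lower-edge
   statements — so the windows of BOTH `Hyp` and `Conc` are pinned to `m·n^{±o(1)}` on both sides.
   Filed as `Theorems/SliceACZero/Negative/WindowLowHyp.lean` (p82553).
   REMARK (new route item `ShallowSliceBound`, stmt-PneNP-14083, added 2026-08-16T05:02Z = `Conc`
   restricted to MONOTONE `{∧ₘ,∨ₘ}`-circuits): the witnesses of Parts I, II, IV, V, VI, VIII, IX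
   (`x_e`, `∧₀`/`∨₀` constants, the clique DNF) are monotone unbounded-fan-in circuits, so the same
   negative statements hold for its window/quantifier variants by the same proofs (not filed here).

IX. (`not_innerConc_two`, `not_concFromTwo`, `mk_two`) The constraint `3 ≤ k` is not cosmetic: at
   `k = 2` the threshold count `m_2(n) = ⌊C(n,2)·n^{-2}⌋₊` is `0`, the window is the single empty slice,
   and the inner clause fails (constant-`0` circuit exact); `k = 3` is the first non-degenerate value.

Nothing here asserts a Theses decl positively.
-/

noncomputable section

namespace Summit.PneNP.PneNP.Cruxes.SliceACZero.Disproof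

open Literature.Computability.Complexity Filter Finset Literature.Combinatorics.SetFamily
open scoped FinsetFamily Topology
open Summit.PneNP.PneNP.Theses.OneSlice (SliceACZero)

/-! ## Part I — vocabulary, witnesses, load-bearing clauses -/

/-! ### Vocabulary: threshold, slice error, the inner clauses of the crux -/

/-- `m_k(n) = ⌊C(n,2) · n^{-2/(k-1)}⌋₊`, the critical edge count (E[#K_k] → 1/k!). [folklore] -/
def mk (n k : ℕ) : ℕ := ⌊((n.choose 2 : ℕ) : ℝ) * (n : ℝ) ^ (-(2 : ℝ) / ((k : ℝ) - 1))⌋₊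

/-- Number of edge vectors with exactly `j` edges (the size of the slice `G(n,j)`). [folklore] -/
def sliceCard (n j : ℕ) : ℕ :=
  #(univ.filter fun x : (⊤ : SimpleGraph (Fin n)).edgeSet → Bool => edgeCount x = j)

/-- Number of edge vectors with exactly `j` edges on which `f` and `g` disagree. [folklore] -/
def sliceErr (n j : ℕ) (f g : ((⊤ : SimpleGraph (Fin n)).edgeSet → Bool) → Bool) : ℕ :=
  #(univ.filter fun x : (⊤ : SimpleGraph (Fin n)).edgeSet → Bool => edgeCount x = j ∧ f x ≠ g x)

/-- Inner clause of the HYPOTHESIS of the crux at fixed `(d, c, k, δ)`: eventually, for every density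
`q` in the critical window, every `acBasis` circuit of `acDepth ≤ d` with `G(n,q)`-error `≤ δ` against
`k`-CLIQUE has more than `n^c` gates (Rossman 2008 strength). [folklore] -/
def InnerHyp (d c k : ℕ) (δ : ℝ) : Prop :=
  ∀ᶠ n : ℕ in atTop, ∀ q : ℝ, 0 ≤ q → q ≤ 1 →
    |q * (n.choose 2 : ℕ) - (mk n k : ℝ)| ≤ (mk n k : ℝ) ^ ((3 : ℝ) / 4) →
    ∀ C : Circuit ((⊤ : SimpleGraph (Fin n)).edgeSet), C.IsOver acBasis → C.acDepth ≤ d →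
      gnpDisagreeProb n q C.eval (cliqueFn n k) ≤ δ → n ^ c < C.size

/-- Inner clause of the CONCLUSION of the crux at fixed `(d, c, k, δ)`: the same on every central
slice `G(n,j)`. [folklore] -/
def InnerConc (d c k : ℕ) (δ : ℝ) : Prop :=
  ∀ᶠ n : ℕ in atTop, ∀ j : ℕ, |(j : ℝ) - (mk n k : ℝ)| ≤ (mk n k : ℝ) ^ ((3 : ℝ) / 4) →
    ∀ C : Circuit ((⊤ : SimpleGraph (Fin n)).edgeSet), C.IsOver acBasis → C.acDepth ≤ d →
      (sliceErr n j C.eval (cliqueFn n k) : ℝ) ≤ δ * sliceCard n j → n ^ c < C.size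

/-- **Read-back.** The crux is literally
`(∀ d c, ∃ k ≥ 3, ∃ δ > 0, InnerHyp d c k δ) → (∀ d c, ∃ k ≥ 3, ∃ δ > 0, InnerConc d c k δ)`
(definitional unfolding of the route decl). [folklore] -/
theorem sliceACZero_iff : SliceACZero ↔
    ((∀ d c : ℕ, ∃ k : ℕ, 3 ≤ k ∧ ∃ δ : ℝ, 0 < δ ∧ InnerHyp d c k δ) →
      ∀ d c : ℕ, ∃ k : ℕ, 3 ≤ k ∧ ∃ δ : ℝ, 0 < δ ∧ InnerConc d c k δ) :=
  Iff.rfl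

/-! ### Small circuits used as witnesses -/

/-- The all-false vector is the only edge vector with no edge switched on. [folklore] -/
theorem eq_false_of_edgeCount_eq_zero {n : ℕ} {x : (⊤ : SimpleGraph (Fin n)).edgeSet → Bool}
    (h : edgeCount x = 0) : x = fun _ => false := by
  funext e
  rw [edgeCount, Finset.card_eq_zero, Finset.filter_eq_empty_iff] at h
  simpa using h (mem_univ e)

/-- The all-true vector is the only edge vector with all `C(n,2)` edges switched on. [folklore] -/
theorem eq_true_of_edgeCount_eq {n : ℕ} {x : (⊤ : SimpleGraph (Fin n)).edgeSet → Bool}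
    (h : edgeCount x = n.choose 2) : x = fun _ => true := by
  have huniv : (univ.filter fun e : (⊤ : SimpleGraph (Fin n)).edgeSet => x e = true) = univ := by
    refine Finset.eq_univ_of_card _ ?_
    rw [card_edgeSet_top_fin n]
    exact h
  funext e
  have he := Finset.mem_univ e
  rw [← huniv, Finset.mem_filter] at he
  exact he.2

/-- The empty graph has no `k`-clique for `k ≥ 2`: `CLIQUE_k(∅) = 0`. [folklore] -/
theorem cliqueFn_false {n k : ℕ} (hk : 2 ≤ k) :
    cliqueFn n k (fun _ : (⊤ : SimpleGraph (Fin n)).edgeSet => false) = false := by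
  rw [cliqueFn_eq_false_iff]
  have h : cliqueGraph (fun _ : (⊤ : SimpleGraph (Fin n)).edgeSet => false) = ⊥ := by
    ext u v
    simp [cliqueGraph_adj]
  rw [h]
  exact SimpleGraph.cliqueFree_bot hk

/-- The complete graph `K_n` has a `k`-clique for `k ≤ n`: `CLIQUE_k(K_n) = 1`. [folklore] -/
theorem cliqueFn_true {n k : ℕ} (hk : k ≤ n) :
    cliqueFn n k (fun _ : (⊤ : SimpleGraph (Fin n)).edgeSet => true) = true := by
  have h : (fun _ : (⊤ : SimpleGraph (Fin n)).edgeSet => true) = cliqueVec (univ : Finset (Fin n)) := by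
    funext e
    simp [cliqueVec]
  rw [h]
  exact cliqueFn_cliqueVec (by simpa using hk)

/-- For `n ≥ 2` the complete graph `K_n` has an edge (the input variable used by the size-0
witnesses). [folklore] -/
theorem exists_edge {n : ℕ} (hn : 2 ≤ n) : Nonempty ((⊤ : SimpleGraph (Fin n)).edgeSet) := by
  refine ⟨⟨s(⟨0, by omega⟩, ⟨1, by omega⟩), ?_⟩⟩
  rw [SimpleGraph.mem_edgeSet, SimpleGraph.top_adj]
  simp [Fin.ext_iff]

/-- The gate-free circuit `x_e`: size `0`, `acDepth 0`, over every basis. [folklore] -/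
theorem input_facts {ι : Type*} (i : ι) (B : Set GateFn) :
    (Circuit.input i).IsOver B ∧ (Circuit.input i).acDepth = 0 ∧ (Circuit.input i).size = 0 ∧
      ∀ x, (Circuit.input i).eval x = x i :=
  ⟨fun g hg => by simp [Circuit.input] at hg, rfl, rfl, fun _ => rfl⟩

/-- **One gate of fan-in `|ι|` with an arbitrary truth table `f`**: a circuit (over `fullBasis`,
in general NOT over `acBasis`) of size `1` and `acDepth ≤ 1` computing `f` exactly. With
`f = cliqueFn n k` this is the witness that the basis restriction is load-bearing. [folklore] -/
theorem exists_oneGate_circuit (ι : Type*) [Fintype ι] [DecidableEq ι] (f : (ι → Bool) → Bool) :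
    ∃ C : Circuit ι, C.size = 1 ∧ C.acDepth ≤ 1 ∧ ∀ x, C.eval x = f x := by
  let C : Circuit ι :=
    { gates := [⟨Fintype.card ι, fun v => f fun i => v (Fintype.equivFin ι i),
        fun a => .inl ((Fintype.equivFin ι).symm a)⟩]
      output := .inr 0
      wf := fun j h a m hm => by
        simp only [List.length_singleton, Nat.lt_one_iff] at h
        subst h
        simp at hm
      wf_output := fun m h => by cases h; simp }
  refine ⟨C, rfl, ?_, ?_⟩
  · simp only [Circuit.acDepth, Circuit.depthWith, Circuit.depthVals, C, List.foldl_cons,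
      List.foldl_nil, List.nil_append, List.getD_cons_zero]
    refine Nat.add_le_of_le_sub' (by unfold acWeight; split <;> simp) ?_
    exact (Finset.sup_le fun a _ => le_rfl).trans (Nat.zero_le _)
  · intro x
    have h : C.eval x = f (fun i => x ((Fintype.equivFin ι).symm (Fintype.equivFin ι i))) := rfl
    rw [h]
    simp

/-- `m_k(n) ≤ C(n,2)` for `k ≥ 2` (the threshold density is at most `1`). [folklore] -/
theorem mk_le_choose {n k : ℕ} (hn : 1 ≤ n) (hk : 2 ≤ k) : mk n k ≤ n.choose 2 := by
  refine Nat.floor_le_of_le ?_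
  have hn1 : (1 : ℝ) ≤ n := by exact_mod_cast hn
  have hk1 : (1 : ℝ) < k := by exact_mod_cast hk
  have hexp : -(2 : ℝ) / ((k : ℝ) - 1) ≤ 0 :=
    div_nonpos_of_nonpos_of_nonneg (by norm_num) (by linarith)
  have hpow : (n : ℝ) ^ (-(2 : ℝ) / ((k : ℝ) - 1)) ≤ 1 :=
    Real.rpow_le_one_of_one_le_of_nonpos hn1 hexp
  calc ((n.choose 2 : ℕ) : ℝ) * (n : ℝ) ^ (-(2 : ℝ) / ((k : ℝ) - 1))
      ≤ ((n.choose 2 : ℕ) : ℝ) * 1 := mul_le_mul_of_nonneg_left hpow (Nat.cast_nonneg _)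
    _ = _ := mul_one _

/-- The density `q = m_k(n)/C(n,2)` is in `[0,1]` and at the centre of the window
(`n ≥ 2`, `k ≥ 2`). [folklore] -/
theorem centre_density {n k : ℕ} (hn : 2 ≤ n) (hk : 2 ≤ k) :
    0 ≤ (mk n k : ℝ) / (n.choose 2 : ℕ) ∧ (mk n k : ℝ) / (n.choose 2 : ℕ) ≤ 1 ∧
      |(mk n k : ℝ) / (n.choose 2 : ℕ) * (n.choose 2 : ℕ) - (mk n k : ℝ)| ≤
        (mk n k : ℝ) ^ ((3 : ℝ) / 4) := by
  have hN : (0 : ℝ) < (n.choose 2 : ℕ) := by exact_mod_cast Nat.choose_pos hn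
  refine ⟨div_nonneg (Nat.cast_nonneg _) hN.le, ?_, ?_⟩
  · rw [div_le_one hN]
    exact_mod_cast mk_le_choose (by omega) hk
  · rw [div_mul_cancel₀ _ hN.ne', sub_self, abs_zero]
    exact Real.rpow_nonneg (Nat.cast_nonneg _) _

/-- The central edge count `j = m_k(n)` is in the window. [folklore] -/
theorem centre_count (n k : ℕ) :
    |((mk n k : ℕ) : ℝ) - (mk n k : ℝ)| ≤ (mk n k : ℝ) ^ ((3 : ℝ) / 4) := by
  rw [sub_self, abs_zero]
  exact Real.rpow_nonneg (Nat.cast_nonneg _) _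

/-- An exact circuit has slice error `0`. [folklore] -/
theorem sliceErr_eq_zero_of_forall {n : ℕ} (j : ℕ)
    {f g : ((⊤ : SimpleGraph (Fin n)).edgeSet → Bool) → Bool} (h : ∀ x, f x = g x) :
    sliceErr n j f g = 0 := by
  rw [sliceErr, Finset.card_eq_zero, Finset.filter_eq_empty_iff]
  rintro x - ⟨-, hne⟩
  exact hne (h x)

/-- A circuit that computes `g` exactly has `G(n,q)`-error `0` against `g`. [folklore] -/
theorem gnpDisagreeProb_eq_zero_of_forall {n : ℕ} (q : ℝ)
    {f g : ((⊤ : SimpleGraph (Fin n)).edgeSet → Bool) → Bool} (h : ∀ x, f x = g x) :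
    gnpDisagreeProb n q f g = 0 := by
  rw [gnpDisagreeProb]
  refine Finset.sum_eq_zero fun x hx => ?_
  rw [Finset.mem_filter] at hx
  exact absurd (h x) hx.2

/-! ### Load-bearing clauses of the conclusion -/

/-- `InnerConc` with the centrality hypothesis `|j − m_k(n)| ≤ m_k(n)^{3/4}` deleted. [folklore] -/
def InnerConcNoWindow (d c k : ℕ) (δ : ℝ) : Prop :=
  ∀ᶠ n : ℕ in atTop, ∀ j : ℕ,
    ∀ C : Circuit ((⊤ : SimpleGraph (Fin n)).edgeSet), C.IsOver acBasis → C.acDepth ≤ d →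
      (sliceErr n j C.eval (cliqueFn n k) : ℝ) ≤ δ * sliceCard n j → n ^ c < C.size

/-- **The window is load-bearing** — for EVERY `d, c`, `k ≥ 2`, `δ ≥ 0`: without centrality the
clause fails at the slice `j = 0` (the empty graph), where the gate-free circuit `x_e` (size `0`,
depth `0`) agrees with `CLIQUE_k = 0`; `n ^ c < 0` is false. Any proof of the crux must use
`|j − m_k(n)| ≤ m_k(n)^{3/4}` at least to exclude `j = 0`. [folklore] -/
theorem not_innerConcNoWindow (d c : ℕ) {k : ℕ} (hk : 2 ≤ k) {δ : ℝ} (hδ : 0 ≤ δ) :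
    ¬ InnerConcNoWindow d c k δ := by
  intro h
  obtain ⟨n, hn, hn2⟩ := (h.and (eventually_ge_atTop 2)).exists
  obtain ⟨e⟩ := exists_edge hn2
  obtain ⟨hB, hD, hS, hE⟩ := input_facts e acBasis
  have h0 : sliceErr n 0 (Circuit.input e).eval (cliqueFn n k) = 0 := by
    rw [sliceErr, Finset.card_eq_zero, Finset.filter_eq_empty_iff]
    rintro x - ⟨hx0, hne⟩
    have hx := eq_false_of_edgeCount_eq_zero hx0
    subst hx
    exact hne (by rw [hE, cliqueFn_false hk])
  have herr : (sliceErr n 0 (Circuit.input e).eval (cliqueFn n k) : ℝ) ≤ δ * sliceCard n 0 := by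
    rw [h0, Nat.cast_zero]
    exact mul_nonneg hδ (Nat.cast_nonneg _)
  have := hn 0 (Circuit.input e) hB (hD.trans_le (Nat.zero_le d)) herr
  rw [hS] at this
  exact Nat.not_lt_zero _ this

/-- `InnerConc` with the two-sided window replaced by the one-sided condition `m_k(n) ≤ j`.
[folklore] -/
def InnerConcWindowAbove (d c k : ℕ) (δ : ℝ) : Prop :=
  ∀ᶠ n : ℕ in atTop, ∀ j : ℕ, mk n k ≤ j →
    ∀ C : Circuit ((⊤ : SimpleGraph (Fin n)).edgeSet), C.IsOver acBasis → C.acDepth ≤ d →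
      (sliceErr n j C.eval (cliqueFn n k) : ℝ) ≤ δ * sliceCard n j → n ^ c < C.size

/-- **The window needs an upper cutoff** — for every `d ≥ 1`, `c`, `k ≥ 2`, `δ ≥ 0`: with only
`m_k(n) ≤ j` the clause fails at the top slice `j = C(n,2)` (the complete graph, `CLIQUE_k = 1` once
`n ≥ k`), where the one-gate constant circuit `∧₀ = true` (size `1`, `acDepth 1`) is exact;
`n ^ c < 1` is false. The honest open question — how WIDE the window may be (e.g. `[m, m·n^ε]`
should already fail via `Pr_j[no k-clique] → 0`, a second-moment computation on the slice) — is not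
attempted. [folklore] -/
theorem not_innerConcWindowAbove {d : ℕ} (hd : 1 ≤ d) (c : ℕ) {k : ℕ} (hk : 2 ≤ k) {δ : ℝ}
    (hδ : 0 ≤ δ) : ¬ InnerConcWindowAbove d c k δ := by
  intro h
  obtain ⟨n, hn, hnk⟩ := (h.and (eventually_ge_atTop (max k 1))).exists
  have hkn : k ≤ n := (le_max_left k 1).trans hnk
  have hn1 : 1 ≤ n := (le_max_right k 1).trans hnk
  have h0 : sliceErr n (n.choose 2) (Circuit.const _ true).eval (cliqueFn n k) = 0 := by
    rw [sliceErr, Finset.card_eq_zero, Finset.filter_eq_empty_iff]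
    rintro x - ⟨hx0, hne⟩
    have hx := eq_true_of_edgeCount_eq hx0
    subst hx
    exact hne (by rw [Circuit.eval_const, cliqueFn_true hkn])
  have herr : (sliceErr n (n.choose 2) (Circuit.const _ true).eval (cliqueFn n k) : ℝ) ≤
      δ * sliceCard n (n.choose 2) := by
    rw [h0, Nat.cast_zero]
    exact mul_nonneg hδ (Nat.cast_nonneg _)
  have hlt := hn (n.choose 2) (mk_le_choose hn1 hk) (Circuit.const _ true)
    (Circuit.const_isOver_acBasis true) (by rw [Circuit.acDepth_const]; exact hd) herr
  rw [Circuit.size_const] at hlt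
  exact absurd (Nat.one_le_pow c n hn1) (not_le.2 hlt)

/-- `InnerConc` with the basis hypothesis `C.IsOver acBasis` deleted (gates of arbitrary truth table
and fan-in allowed). [folklore] -/
def InnerConcNoBasis (d c k : ℕ) (δ : ℝ) : Prop :=
  ∀ᶠ n : ℕ in atTop, ∀ j : ℕ, |(j : ℝ) - (mk n k : ℝ)| ≤ (mk n k : ℝ) ^ ((3 : ℝ) / 4) →
    ∀ C : Circuit ((⊤ : SimpleGraph (Fin n)).edgeSet), C.acDepth ≤ d →
      (sliceErr n j C.eval (cliqueFn n k) : ℝ) ≤ δ * sliceCard n j → n ^ c < C.size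

/-- **The basis restriction is load-bearing** — for every `d ≥ 1`, `c`, `k`, `δ ≥ 0`: a single gate
of fan-in `C(n,2)` whose truth table is `CLIQUE_k` has size `1`, `acDepth 1` and error `0` on every
slice, in particular on the central slice `j = m_k(n)`; `n ^ c < 1` is false. (So the crux is
genuinely about the weakness of `{¬, ∧ₖ, ∨ₖ}`-gates, not about depth alone.) [folklore] -/
theorem not_innerConcNoBasis {d : ℕ} (hd : 1 ≤ d) (c k : ℕ) {δ : ℝ} (hδ : 0 ≤ δ) :
    ¬ InnerConcNoBasis d c k δ := by
  intro h
  obtain ⟨n, hn, hn1⟩ := (h.and (eventually_ge_atTop 1)).exists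
  obtain ⟨C, hS, hD, hE⟩ :=
    exists_oneGate_circuit ((⊤ : SimpleGraph (Fin n)).edgeSet) (cliqueFn n k)
  have herr : (sliceErr n (mk n k) C.eval (cliqueFn n k) : ℝ) ≤ δ * sliceCard n (mk n k) := by
    rw [sliceErr_eq_zero_of_forall _ hE, Nat.cast_zero]
    exact mul_nonneg hδ (Nat.cast_nonneg _)
  have hlt := hn (mk n k) (centre_count n k) C (hD.trans hd) herr
  rw [hS] at hlt
  exact absurd (Nat.one_le_pow c n hn1) (not_le.2 hlt)

/-- `InnerConc` with the accuracy hypothesis deleted ("every bounded-depth AC circuit is large").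
[folklore] -/
def InnerConcNoError (d c k : ℕ) : Prop :=
  ∀ᶠ n : ℕ in atTop, ∀ j : ℕ, |(j : ℝ) - (mk n k : ℝ)| ≤ (mk n k : ℝ) ^ ((3 : ℝ) / 4) →
    ∀ C : Circuit ((⊤ : SimpleGraph (Fin n)).edgeSet), C.IsOver acBasis → C.acDepth ≤ d →
      n ^ c < C.size

/-- **The accuracy hypothesis is load-bearing** (trivially; all `d, c, k`): the gate-free circuit
`x_e` has size `0`. Recorded only to complete the census of clauses. [folklore] -/
theorem not_innerConcNoError (d c k : ℕ) : ¬ InnerConcNoError d c k := by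
  intro h
  obtain ⟨n, hn, hn2⟩ := (h.and (eventually_ge_atTop 2)).exists
  obtain ⟨e⟩ := exists_edge hn2
  obtain ⟨hB, hD, hS, -⟩ := input_facts e acBasis
  have := hn (mk n k) (centre_count n k) (Circuit.input e) hB (hD.trans_le (Nat.zero_le d))
  rw [hS] at this
  exact Nat.not_lt_zero _ this

/-! ### The same clauses on the hypothesis side -/

/-- `InnerHyp` with the window clause on `q` deleted. [folklore] -/
def InnerHypNoWindow (d c k : ℕ) (δ : ℝ) : Prop :=
  ∀ᶠ n : ℕ in atTop, ∀ q : ℝ, 0 ≤ q → q ≤ 1 →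
    ∀ C : Circuit ((⊤ : SimpleGraph (Fin n)).edgeSet), C.IsOver acBasis → C.acDepth ≤ d →
      gnpDisagreeProb n q C.eval (cliqueFn n k) ≤ δ → n ^ c < C.size

/-- At `q = 0` the `G(n,0)`-error of `x_e` against `CLIQUE_k` vanishes: the only vector of positive
weight is the empty graph, where both are `0`. [folklore] -/
theorem gnpDisagreeProb_zero_input {n k : ℕ} (hk : 2 ≤ k) (e : (⊤ : SimpleGraph (Fin n)).edgeSet) :
    gnpDisagreeProb n 0 (Circuit.input e).eval (cliqueFn n k) = 0 := by
  rw [gnpDisagreeProb]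
  refine Finset.sum_eq_zero fun x hx => ?_
  rw [Finset.mem_filter] at hx
  have hne : edgeCount x ≠ 0 := by
    intro h0
    have hx0 := eq_false_of_edgeCount_eq_zero h0
    subst hx0
    exact hx.2 (by rw [(input_facts e acBasis).2.2.2, cliqueFn_false hk])
  rw [gnpWeight, zero_pow hne, zero_mul]

/-- **The `q`-window is load-bearing on the hypothesis side** — all `d, c`, `k ≥ 2`, `δ ≥ 0`: at
`q = 0` the random graph is empty a.s. and `x_e` (size `0`) is exact. [folklore] -/
theorem not_innerHypNoWindow (d c : ℕ) {k : ℕ} (hk : 2 ≤ k) {δ : ℝ} (hδ : 0 ≤ δ) :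
    ¬ InnerHypNoWindow d c k δ := by
  intro h
  obtain ⟨n, hn, hn2⟩ := (h.and (eventually_ge_atTop 2)).exists
  obtain ⟨e⟩ := exists_edge hn2
  obtain ⟨hB, hD, hS, -⟩ := input_facts e acBasis
  have herr : gnpDisagreeProb n 0 (Circuit.input e).eval (cliqueFn n k) ≤ δ := by
    rw [gnpDisagreeProb_zero_input hk e]
    exact hδ
  have := hn 0 le_rfl zero_le_one (Circuit.input e) hB (hD.trans_le (Nat.zero_le d)) herr
  rw [hS] at this
  exact Nat.not_lt_zero _ this

/-- `InnerHyp` with the basis hypothesis deleted. [folklore] -/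
def InnerHypNoBasis (d c k : ℕ) (δ : ℝ) : Prop :=
  ∀ᶠ n : ℕ in atTop, ∀ q : ℝ, 0 ≤ q → q ≤ 1 →
    |q * (n.choose 2 : ℕ) - (mk n k : ℝ)| ≤ (mk n k : ℝ) ^ ((3 : ℝ) / 4) →
    ∀ C : Circuit ((⊤ : SimpleGraph (Fin n)).edgeSet), C.acDepth ≤ d →
      gnpDisagreeProb n q C.eval (cliqueFn n k) ≤ δ → n ^ c < C.size

/-- **The basis restriction is load-bearing on the hypothesis side** — `d ≥ 1`, all `c`, `k ≥ 2`,
`δ ≥ 0`: the one-gate CLIQUE circuit at the central density `q = m_k(n)/C(n,2)`. [folklore] -/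
theorem not_innerHypNoBasis {d : ℕ} (hd : 1 ≤ d) (c : ℕ) {k : ℕ} (hk : 2 ≤ k) {δ : ℝ}
    (hδ : 0 ≤ δ) : ¬ InnerHypNoBasis d c k δ := by
  intro h
  obtain ⟨n, hn, hn2⟩ := (h.and (eventually_ge_atTop 2)).exists
  obtain ⟨C, hS, hD, hE⟩ :=
    exists_oneGate_circuit ((⊤ : SimpleGraph (Fin n)).edgeSet) (cliqueFn n k)
  obtain ⟨hq0, hq1, hqw⟩ := centre_density hn2 hk
  have herr : gnpDisagreeProb n ((mk n k : ℝ) / (n.choose 2 : ℕ)) C.eval (cliqueFn n k) ≤ δ := by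
    rw [gnpDisagreeProb_eq_zero_of_forall _ hE]
    exact hδ
  have hlt := hn _ hq0 hq1 hqw C (hD.trans hd) herr
  rw [hS] at hlt
  exact absurd (Nat.one_le_pow c n (by omega)) (not_le.2 hlt)

/-! ### Global corollaries (the dropped-clause versions of `Conc` / `Hyp` are false outright) -/

/-- `Conc` without the window is false. [folklore] -/
theorem not_concNoWindow :
    ¬ ∀ d c : ℕ, ∃ k : ℕ, 3 ≤ k ∧ ∃ δ : ℝ, 0 < δ ∧ InnerConcNoWindow d c k δ := fun h => by
  obtain ⟨k, hk, δ, hδ, hI⟩ := h 0 0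
  exact not_innerConcNoWindow 0 0 (by omega) hδ.le hI

/-- `Conc` with the one-sided window `m_k(n) ≤ j` is false. [folklore] -/
theorem not_concWindowAbove :
    ¬ ∀ d c : ℕ, ∃ k : ℕ, 3 ≤ k ∧ ∃ δ : ℝ, 0 < δ ∧ InnerConcWindowAbove d c k δ := fun h => by
  obtain ⟨k, hk, δ, hδ, hI⟩ := h 1 0
  exact not_innerConcWindowAbove le_rfl 0 (by omega) hδ.le hI

/-- `Conc` without the basis restriction is false. [folklore] -/
theorem not_concNoBasis :
    ¬ ∀ d c : ℕ, ∃ k : ℕ, 3 ≤ k ∧ ∃ δ : ℝ, 0 < δ ∧ InnerConcNoBasis d c k δ := fun h => by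
  obtain ⟨k, -, δ, hδ, hI⟩ := h 1 0
  exact not_innerConcNoBasis le_rfl 0 k hδ.le hI

/-- `Conc` without the accuracy hypothesis is false. [folklore] -/
theorem not_concNoError :
    ¬ ∀ d c : ℕ, ∃ k : ℕ, 3 ≤ k ∧ ∃ δ : ℝ, 0 < δ ∧ InnerConcNoError d c k := fun h => by
  obtain ⟨k, -, δ, -, hI⟩ := h 0 0
  exact not_innerConcNoError 0 0 k hI

/-- `Hyp` without the window is false. [folklore] -/
theorem not_hypNoWindow :
    ¬ ∀ d c : ℕ, ∃ k : ℕ, 3 ≤ k ∧ ∃ δ : ℝ, 0 < δ ∧ InnerHypNoWindow d c k δ := fun h => by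
  obtain ⟨k, hk, δ, hδ, hI⟩ := h 0 0
  exact not_innerHypNoWindow 0 0 (by omega) hδ.le hI

/-- `Hyp` without the basis restriction is false. [folklore] -/
theorem not_hypNoBasis :
    ¬ ∀ d c : ℕ, ∃ k : ℕ, 3 ≤ k ∧ ∃ δ : ℝ, 0 < δ ∧ InnerHypNoBasis d c k δ := fun h => by
  obtain ⟨k, hk, δ, hδ, hI⟩ := h 1 0
  exact not_innerHypNoBasis le_rfl 0 (by omega) hδ.le hI

/-! ## Part II — order of quantifiers: the clique size `k` must exceed the exponent `c`

The inner clause at fixed `(d, c, k, δ)` is FALSE whenever `d ≥ 2` and `k ≤ c`, for every `δ ≥ 0`: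
the exhaustive clique DNF `⋁_{|A|=k} ⋀_{e ⊆ A} x_e` (in tree: `exists_cliqueDNF_monotoneAC`) is an
`acBasis` circuit of `acDepth ≤ 2`, size `≤ C(n,k) + 1 ≤ n^k ≤ n^c`, exact on every slice and at
every density. Hence the witness `k` of `Conc d c` satisfies `k > c` (`lt_of_innerConc`); the natural
strengthening "one exponent works for every `k ≥ 3`" is false (`not_concForallK`); by the
Rossman/Amano average-case upper bound `n^{k/4+O(1)}` (not vendored for AC⁰ on slices) the true
requirement is `k ≳ 4c`. The same holds verbatim for `Hyp`. -/

/-- The exhaustive clique DNF as an `acBasis` circuit of `acDepth ≤ 2` (from the in-tree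
`exists_cliqueDNF_monotoneAC`, Alon–Boppana 1987 §3). [cite: AlonBoppana1987, §3] -/
theorem exists_cliqueDNF (n k : ℕ) :
    ∃ C : Circuit ((⊤ : SimpleGraph (Fin n)).edgeSet), C.IsOver acBasis ∧ C.acDepth ≤ 2 ∧
      C.size ≤ n.choose k + 1 ∧ ∀ x, C.eval x = cliqueFn n k x := by
  obtain ⟨C, hB, hd, hs, hE⟩ := exists_cliqueDNF_monotoneAC n k
  exact ⟨C, hB.mono monotoneACBasis_subset_acBasis, (acDepth_le_depth C).trans hd, hs, hE⟩

/-- For `n ≥ 2` and `2 ≤ k ≤ c` the exhaustive DNF has at most `n^c` gates. [folklore] -/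
theorem choose_succ_le_pow {n k c : ℕ} (hn : 2 ≤ n) (hk : 2 ≤ k) (hkc : k ≤ c) :
    n.choose k + 1 ≤ n ^ c :=
  Nat.succ_le_of_lt ((Nat.choose_lt_pow (by omega) hk).trans_le (Nat.pow_le_pow_right (by omega) hkc))

/-- **`k ≤ c` is impossible in `Conc` (depth ≥ 2)**: the inner clause fails for every `δ ≥ 0`,
witnessed on the central slice `j = m_k(n)` by the exhaustive clique DNF. [folklore] -/
theorem not_innerConc_of_le {d c k : ℕ} (hd : 2 ≤ d) (hk : 2 ≤ k) (hkc : k ≤ c) {δ : ℝ}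
    (hδ : 0 ≤ δ) : ¬ InnerConc d c k δ := by
  intro h
  obtain ⟨n, hn, hn2⟩ := (h.and (eventually_ge_atTop 2)).exists
  obtain ⟨C, hB, hD, hS, hE⟩ := exists_cliqueDNF n k
  have herr : (sliceErr n (mk n k) C.eval (cliqueFn n k) : ℝ) ≤ δ * sliceCard n (mk n k) := by
    rw [sliceErr_eq_zero_of_forall _ hE, Nat.cast_zero]
    exact mul_nonneg hδ (Nat.cast_nonneg _)
  have hlt := hn (mk n k) (centre_count n k) C hB (hD.trans hd) herr
  exact absurd (hS.trans (choose_succ_le_pow hn2 hk hkc)) (not_le.2 hlt)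

/-- **`k ≤ c` is impossible in `Hyp` (depth ≥ 2)** likewise, at the central density. [folklore] -/
theorem not_innerHyp_of_le {d c k : ℕ} (hd : 2 ≤ d) (hk : 2 ≤ k) (hkc : k ≤ c) {δ : ℝ}
    (hδ : 0 ≤ δ) : ¬ InnerHyp d c k δ := by
  intro h
  obtain ⟨n, hn, hn2⟩ := (h.and (eventually_ge_atTop 2)).exists
  obtain ⟨C, hB, hD, hS, hE⟩ := exists_cliqueDNF n k
  obtain ⟨hq0, hq1, hqw⟩ := centre_density hn2 hk
  have herr : gnpDisagreeProb n ((mk n k : ℝ) / (n.choose 2 : ℕ)) C.eval (cliqueFn n k) ≤ δ := by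
    rw [gnpDisagreeProb_eq_zero_of_forall _ hE]
    exact hδ
  have hlt := hn _ hq0 hq1 hqw C hB (hD.trans hd) herr
  exact absurd (hS.trans (choose_succ_le_pow hn2 hk hkc)) (not_le.2 hlt)

/-- Any witness `k ≥ 2` of `Conc` at depth `d ≥ 2` exceeds the exponent: `c < k`. [folklore] -/
theorem lt_of_innerConc {d c k : ℕ} (hd : 2 ≤ d) (hk : 2 ≤ k) {δ : ℝ} (hδ : 0 ≤ δ)
    (h : InnerConc d c k δ) : c < k :=
  lt_of_not_ge fun hkc => not_innerConc_of_le hd hk hkc hδ h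

/-- Any witness `k ≥ 2` of `Hyp` at depth `d ≥ 2` exceeds the exponent: `c < k`. [folklore] -/
theorem lt_of_innerHyp {d c k : ℕ} (hd : 2 ≤ d) (hk : 2 ≤ k) {δ : ℝ} (hδ : 0 ≤ δ)
    (h : InnerHyp d c k δ) : c < k :=
  lt_of_not_ge fun hkc => not_innerHyp_of_le hd hk hkc hδ h

/-- **The `∀ c ∀ k` strengthening of `Conc` is false** ("one exponent for all clique sizes";
`d = 2`, `c = k = 3`: the triangle DNF has `≤ C(n,3)+1 ≤ n^3` gates). [folklore] -/
theorem not_concForallK :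
    ¬ ∀ d c : ℕ, ∀ k : ℕ, 3 ≤ k → ∃ δ : ℝ, 0 < δ ∧ InnerConc d c k δ := fun h => by
  obtain ⟨δ, hδ, hI⟩ := h 2 3 3 le_rfl
  exact not_innerConc_of_le le_rfl (by norm_num) le_rfl hδ.le hI

/-- **The `∀ c ∀ k` strengthening of `Hyp` is false** (same witness at the central density).
[folklore] -/
theorem not_hypForallK :
    ¬ ∀ d c : ℕ, ∀ k : ℕ, 3 ≤ k → ∃ δ : ℝ, 0 < δ ∧ InnerHyp d c k δ := fun h => by
  obtain ⟨δ, hδ, hI⟩ := h 2 3 3 le_rfl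
  exact not_innerHyp_of_le le_rfl (by norm_num) le_rfl hδ.le hI

/-! ## Part IV — `δ` must shrink with `k`: first moments on the central slice / at the central density

The accuracy parameter cannot be chosen before the clique size: for `d ≥ 1`, every `c`, `k ≥ 2` and
every `δ ≥ 1/k!` the inner clauses are FALSE, witnessed by the one-gate constant circuit `∨₀ = 0`
(`not_innerConc_of_factorial_inv_le`, `not_innerHyp_of_factorial_inv_le`): on the central slice
`j = m_k(n)` (resp. at the central density `q = m_k(n)/C(n,2)`) the fraction of graphs with a
`k`-clique is at most `C(n,k) (j/C(n,2))^{C(k,2)} ≤ (n^k/k!) · n^{-k} = 1/k!` (first moment; on the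
slice through the exact count `#{x : |x| = j, K_A ⊆ x} = C(N - C(k,2), j - C(k,2))` and the ratio bound
`C(N-K, j-K) N^K ≤ C(N,j) j^K`). Hence every witness `(k, δ)` has `δ < 1/k!`
(`lt_factorial_inv_of_innerConc`), and the strengthenings with the quantifier order `∃ δ ∀ c ∃ k`
are false (`not_concDeltaFirst`, `not_hypDeltaFirst`: given `δ`, take `c = ⌈1/δ⌉₊`; a witness
`k ≤ c` is killed by the clique DNF of Part II, a witness `k > c` by the constant circuit).
`firstMoment_slice` is the slice analogue of the in-tree `gnpProb_clique_le` and may serve provers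
(it is one half of the Poisson window `Pr_j[k-clique] → 1 - e^{-1/k!}`). -/

section Moment

variable {n : ℕ}

/-- The support (set of switched-on edges) of an edge vector. [folklore] -/
def supp (x : (⊤ : SimpleGraph (Fin n)).edgeSet → Bool) : Finset ((⊤ : SimpleGraph (Fin n)).edgeSet) :=
  univ.filter fun e => x e = true

/-- Membership in the support. [folklore] -/
theorem mem_supp {x : (⊤ : SimpleGraph (Fin n)).edgeSet → Bool}
    {e : (⊤ : SimpleGraph (Fin n)).edgeSet} : e ∈ supp x ↔ x e = true := by
  simp [supp]

/-- The support has `e(x)` elements (definitional). [folklore] -/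
theorem card_supp (x : (⊤ : SimpleGraph (Fin n)).edgeSet → Bool) : #(supp x) = edgeCount x := rfl

/-- An edge vector is determined by its support. [folklore] -/
theorem supp_injective : Function.Injective (supp (n := n)) := by
  intro x y h
  funext e
  have he : e ∈ supp x ↔ e ∈ supp y := by rw [h]
  rw [mem_supp, mem_supp] at he
  exact Bool.eq_iff_iff.2 he

/-- The indicator vector of an edge set has that set as support. [folklore] -/
theorem supp_indicator (s : Finset ((⊤ : SimpleGraph (Fin n)).edgeSet)) :
    supp (fun e => decide (e ∈ s)) = s := by
  ext e
  simp [supp]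

/-- **Size of a slice**: `#{x : e(x) = j} = C(C(n,2), j)`. [folklore] -/
theorem sliceCard_eq (n j : ℕ) : sliceCard n j = (n.choose 2).choose j := by
  rw [← card_edgeSet_top_fin n, ← Finset.card_univ, ← Finset.card_powersetCard]
  refine Finset.card_bij (fun x _ => supp x) ?_ ?_ ?_
  · intro x hx
    rw [Finset.mem_powersetCard]
    exact ⟨Finset.subset_univ _, (Finset.mem_filter.1 hx).2⟩
  · intro x _ y _ h
    exact supp_injective h
  · intro s hs
    refine ⟨fun e => decide (e ∈ s), ?_, supp_indicator s⟩
    rw [Finset.mem_filter]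
    refine ⟨Finset.mem_univ _, ?_⟩
    rw [← card_supp, supp_indicator]
    exact (Finset.mem_powersetCard.1 hs).2

/-- **Slice vectors containing a fixed edge set**: at most `C(N - |S|, j - |S|)` vectors with
exactly `j` edges switch on every edge of `S` (`|S| ≤ j`; Mathlib's
`Finset.card_filter_powersetCard_subset` through the support bijection). [folklore] -/
theorem card_slice_supset_le (j : ℕ) (S : Finset ((⊤ : SimpleGraph (Fin n)).edgeSet))
    (hSj : #S ≤ j) :
    #(univ.filter fun x : (⊤ : SimpleGraph (Fin n)).edgeSet → Bool =>
        edgeCount x = j ∧ ∀ e ∈ S, x e = true) ≤ (n.choose 2 - #S).choose (j - #S) := by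
  set P : ((⊤ : SimpleGraph (Fin n)).edgeSet → Bool) → Prop := fun x =>
    edgeCount x = j ∧ ∀ e ∈ S, x e = true with hP
  have h1 : #(univ.filter P) = #((univ.filter P).image supp) :=
    (Finset.card_image_of_injective _ supp_injective).symm
  have h2 : (univ.filter P).image supp ⊆
      ((univ : Finset ((⊤ : SimpleGraph (Fin n)).edgeSet)).powersetCard j).filter fun Q => S ⊆ Q := by
    intro s hs
    rw [Finset.mem_image] at hs
    obtain ⟨x, hx, rfl⟩ := hs
    rw [Finset.mem_filter] at hx ⊢
    obtain ⟨-, hj, hS⟩ := hx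
    exact ⟨Finset.mem_powersetCard.2 ⟨Finset.subset_univ _, hj⟩, fun e he => mem_supp.2 (hS e he)⟩
  rw [h1]
  refine (Finset.card_le_card h2).trans ?_
  have := card_filter_supset_powersetCard_le (univ : Finset ((⊤ : SimpleGraph (Fin n)).edgeSet)) S hSj
  rwa [Finset.card_univ, card_edgeSet_top_fin] at this

/-- A graph with a `k`-clique has at least `C(k,2)` edges. [folklore] -/
theorem choose_le_edgeCount_of_cliqueFn {k : ℕ} {x : (⊤ : SimpleGraph (Fin n)).edgeSet → Bool}
    (hx : cliqueFn n k x = true) : k.choose 2 ≤ edgeCount x := by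
  have hne := (cliqueCount_ne_zero_iff x).2 hx
  rw [Ne, cliqueCount_eq_zero_iff_forall] at hne
  push Not at hne
  obtain ⟨A, hA, hAx⟩ := hne
  rw [← (Finset.mem_powersetCard.1 hA).2, ← card_filter_cliqueVec A, ← card_supp]
  exact Finset.card_le_card fun e he => mem_supp.2 (hAx e (Finset.mem_filter.1 he).2)

/-- **Union bound on the slice**: the vectors with exactly `j ≥ C(k,2)` edges carrying a `k`-clique
number at most `C(n,k) · C(C(n,2) - C(k,2), j - C(k,2))`. [folklore] -/
theorem card_slice_clique_le (j k : ℕ) (hKj : k.choose 2 ≤ j) :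
    #(univ.filter fun x : (⊤ : SimpleGraph (Fin n)).edgeSet → Bool =>
        edgeCount x = j ∧ cliqueFn n k x = true) ≤
      n.choose k * (n.choose 2 - k.choose 2).choose (j - k.choose 2) := by
  set T := powersetCard k (univ : Finset (Fin n)) with hT
  set F : Finset (Fin n) → Finset ((⊤ : SimpleGraph (Fin n)).edgeSet → Bool) := fun A =>
    univ.filter fun x => edgeCount x = j ∧
      ∀ e ∈ univ.filter (fun e : (⊤ : SimpleGraph (Fin n)).edgeSet => cliqueVec A e = true),
        x e = true with hF
  have hsub : (univ.filter fun x : (⊤ : SimpleGraph (Fin n)).edgeSet → Bool =>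
      edgeCount x = j ∧ cliqueFn n k x = true) ⊆ T.biUnion F := by
    intro x hx
    rw [Finset.mem_filter] at hx
    obtain ⟨-, hj, hcl⟩ := hx
    have hne := (cliqueCount_ne_zero_iff x).2 hcl
    rw [Ne, cliqueCount_eq_zero_iff_forall] at hne
    push Not at hne
    obtain ⟨A, hA, hAx⟩ := hne
    rw [Finset.mem_biUnion]
    refine ⟨A, hA, ?_⟩
    rw [hF, Finset.mem_filter]
    exact ⟨Finset.mem_univ _, hj, fun e he => hAx e (Finset.mem_filter.1 he).2⟩
  have hFle : ∀ A ∈ T, #(F A) ≤ (n.choose 2 - k.choose 2).choose (j - k.choose 2) := by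
    intro A hA
    have hcard : #(univ.filter fun e : (⊤ : SimpleGraph (Fin n)).edgeSet => cliqueVec A e = true) =
        k.choose 2 := by
      rw [card_filter_cliqueVec, (Finset.mem_powersetCard.1 hA).2]
    have h := card_slice_supset_le j
      (univ.filter fun e : (⊤ : SimpleGraph (Fin n)).edgeSet => cliqueVec A e = true) (hcard ▸ hKj)
    rw [hcard] at h
    exact h
  calc _ ≤ #(T.biUnion F) := Finset.card_le_card hsub
    _ ≤ ∑ A ∈ T, #(F A) := Finset.card_biUnion_le
    _ ≤ ∑ A ∈ T, (n.choose 2 - k.choose 2).choose (j - k.choose 2) := Finset.sum_le_sum hFle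
    _ = n.choose k * (n.choose 2 - k.choose 2).choose (j - k.choose 2) := by
        rw [Finset.sum_const, hT, Finset.card_powersetCard, Finset.card_univ, Fintype.card_fin,
          smul_eq_mul]

/-- **Ratio bound** `C(N-K, j-K) · N^K ≤ C(N, j) · j^K` for `K ≤ j ≤ N` ("the probability that a
uniform `j`-set contains a fixed `K`-set is at most `(j/N)^K`"). [folklore] -/
theorem choose_sub_mul_pow_le_choose_mul_pow {N j K : ℕ} (hKj : K ≤ j) (hjN : j ≤ N) :
    (N - K).choose (j - K) * N ^ K ≤ N.choose j * j ^ K := by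
  have h1 : N.choose j * j.choose K = N.choose K * (N - K).choose (j - K) := Nat.choose_mul hKj
  have h2 := choose_mul_pow_le_choose_mul_pow hjN K
  have hKN : K ≤ N := hKj.trans hjN
  have h3 : (N - K).choose (j - K) * N ^ K * N.choose K ≤ N.choose j * j ^ K * N.choose K := by
    calc (N - K).choose (j - K) * N ^ K * N.choose K
        = (N.choose j * j.choose K) * N ^ K := by rw [h1]; ring
      _ = N.choose j * (j.choose K * N ^ K) := by ring
      _ ≤ N.choose j * (N.choose K * j ^ K) := Nat.mul_le_mul_left _ h2
      _ = N.choose j * j ^ K * N.choose K := by ring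
  exact Nat.le_of_mul_le_mul_right h3 (Nat.choose_pos hKN)

/-- **Threshold arithmetic**: `C(n,k) · (j/C(n,2))^{C(k,2)} ≤ 1/k!` whenever
`j ≤ C(n,2) · n^{-2/(k-1)}` (as `(n^{-2/(k-1)})^{C(k,2)} = n^{-k}` and `C(n,k) ≤ n^k/k!`). [folklore] -/
theorem choose_mul_ratio_pow_le {n k j : ℕ} (hk : 2 ≤ k) (hn : 1 ≤ n) (hN : 0 < n.choose 2)
    (hjm : (j : ℝ) ≤ (n.choose 2 : ℕ) * (n : ℝ) ^ (-(2 : ℝ) / ((k : ℝ) - 1))) :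
    (n.choose k : ℝ) * ((j : ℝ) / (n.choose 2 : ℕ)) ^ (k.choose 2) ≤ 1 / (k.factorial : ℝ) := by
  have hNr : (0 : ℝ) < (n.choose 2 : ℕ) := by exact_mod_cast hN
  have hn0 : (0 : ℝ) ≤ n := Nat.cast_nonneg _
  have hnpos : (0 : ℝ) < n := by exact_mod_cast hn
  have hratio : (j : ℝ) / (n.choose 2 : ℕ) ≤ (n : ℝ) ^ (-(2 : ℝ) / ((k : ℝ) - 1)) := by
    rw [div_le_iff₀ hNr, mul_comm]
    exact hjm
  have hratio0 : 0 ≤ (j : ℝ) / (n.choose 2 : ℕ) := div_nonneg (Nat.cast_nonneg _) hNr.le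
  have hpow : ((j : ℝ) / (n.choose 2 : ℕ)) ^ (k.choose 2) ≤
      ((n : ℝ) ^ (-(2 : ℝ) / ((k : ℝ) - 1))) ^ (k.choose 2) :=
    pow_le_pow_left₀ hratio0 hratio _
  have hexp : ((n : ℝ) ^ (-(2 : ℝ) / ((k : ℝ) - 1))) ^ (k.choose 2) = ((n : ℝ) ^ k)⁻¹ := by
    rw [← Real.rpow_mul_natCast hn0, Nat.cast_choose_two]
    have hk1 : (k : ℝ) - 1 ≠ 0 := by
      have : (2 : ℝ) ≤ k := by exact_mod_cast hk
      linarith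
    have : -(2 : ℝ) / ((k : ℝ) - 1) * ((k : ℝ) * ((k : ℝ) - 1) / 2) = -(k : ℝ) := by
      field_simp
    rw [this, Real.rpow_neg hn0, Real.rpow_natCast]
  have hchoose : (n.choose k : ℝ) ≤ (n : ℝ) ^ k / (k.factorial : ℝ) := by
    have := Nat.choose_le_pow_div k n (α := ℝ)
    simpa using this
  have hnk : (0 : ℝ) < (n : ℝ) ^ k := pow_pos hnpos k
  calc (n.choose k : ℝ) * ((j : ℝ) / (n.choose 2 : ℕ)) ^ (k.choose 2)
      ≤ ((n : ℝ) ^ k / k.factorial) * ((n : ℝ) ^ k)⁻¹ := by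
        rw [← hexp]
        exact mul_le_mul hchoose hpow (pow_nonneg hratio0 _)
          (div_nonneg (pow_nonneg hn0 _) (Nat.cast_nonneg _))
    _ = 1 / k.factorial := by
        field_simp

/-- **First moment on the slice at the threshold**: if `C(k,2) ≤ j ≤ C(n,2)` and
`j ≤ C(n,2) · n^{-2/(k-1)}`, then at most a `1/k!`-fraction of the graphs with exactly `j` edges
have a `k`-clique (slice analogue of the in-tree `gnpProb_clique_le`). [folklore] -/
theorem firstMoment_slice {k j : ℕ} (hk : 2 ≤ k) (hn : 1 ≤ n) (hKj : k.choose 2 ≤ j)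
    (hjN : j ≤ n.choose 2)
    (hjm : (j : ℝ) ≤ (n.choose 2 : ℕ) * (n : ℝ) ^ (-(2 : ℝ) / ((k : ℝ) - 1))) :
    (#(univ.filter fun x : (⊤ : SimpleGraph (Fin n)).edgeSet → Bool =>
        edgeCount x = j ∧ cliqueFn n k x = true) : ℝ) ≤ 1 / (k.factorial : ℝ) * sliceCard n j := by
  have hK1 : 0 < k.choose 2 := Nat.choose_pos hk
  have hN : 0 < n.choose 2 := by omega
  have hNr : (0 : ℝ) < (n.choose 2 : ℕ) := by exact_mod_cast hN
  have hcomb := card_slice_clique_le (n := n) j k hKj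
  have hratio := choose_sub_mul_pow_le_choose_mul_pow (K := k.choose 2) hKj hjN
  have hratio' : (((n.choose 2 - k.choose 2).choose (j - k.choose 2) : ℕ) : ℝ) ≤
      ((n.choose 2).choose j : ℕ) * ((j : ℝ) / (n.choose 2 : ℕ)) ^ (k.choose 2) := by
    rw [div_pow, ← mul_div_assoc, le_div_iff₀ (pow_pos hNr _)]
    exact_mod_cast hratio
  calc (#(univ.filter fun x : (⊤ : SimpleGraph (Fin n)).edgeSet → Bool =>
          edgeCount x = j ∧ cliqueFn n k x = true) : ℝ)
      ≤ (n.choose k : ℝ) * (((n.choose 2 - k.choose 2).choose (j - k.choose 2) : ℕ) : ℝ) := by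
        exact_mod_cast hcomb
    _ ≤ (n.choose k : ℝ) * (((n.choose 2).choose j : ℕ) * ((j : ℝ) / (n.choose 2 : ℕ)) ^ (k.choose 2)) :=
        mul_le_mul_of_nonneg_left hratio' (Nat.cast_nonneg _)
    _ = ((n.choose k : ℝ) * ((j : ℝ) / (n.choose 2 : ℕ)) ^ (k.choose 2)) *
          ((n.choose 2).choose j : ℕ) := by ring
    _ ≤ 1 / (k.factorial : ℝ) * ((n.choose 2).choose j : ℕ) :=
        mul_le_mul_of_nonneg_right (choose_mul_ratio_pow_le hk hn hN hjm) (Nat.cast_nonneg _)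
    _ = 1 / (k.factorial : ℝ) * sliceCard n j := by rw [sliceCard_eq]

/-- The slice error of the constant-`0` circuit against `k`-CLIQUE counts the clique vectors of the
slice. [folklore] -/
theorem sliceErr_const_false (j k : ℕ) :
    sliceErr n j (Circuit.const _ false).eval (cliqueFn n k) =
      #(univ.filter fun x : (⊤ : SimpleGraph (Fin n)).edgeSet → Bool =>
        edgeCount x = j ∧ cliqueFn n k x = true) := by
  unfold sliceErr
  congr 1
  refine Finset.filter_congr fun x _ => ?_
  rw [Circuit.eval_const, ne_comm, Bool.ne_false_iff]

/-- The `G(n,q)`-error of the constant-`0` circuit against `k`-CLIQUE is `Pr[k-clique]`. [folklore] -/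
theorem gnpDisagreeProb_const_false (q : ℝ) (k : ℕ) :
    gnpDisagreeProb n q (Circuit.const _ false).eval (cliqueFn n k) =
      ∑ x ∈ univ.filter (fun x : (⊤ : SimpleGraph (Fin n)).edgeSet → Bool => cliqueFn n k x = true),
        gnpWeight n q x := by
  rw [gnpDisagreeProb]
  refine Finset.sum_congr ?_ fun _ _ => rfl
  refine Finset.filter_congr fun x _ => ?_
  rw [Circuit.eval_const, ne_comm, Bool.ne_false_iff]

/-- **`δ ≥ 1/k!` is impossible in `Conc`** (`d ≥ 1`, every `c`, `k ≥ 2`): on the central slice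
`j = m_k(n)` the constant-`0` circuit (one `∨₀` gate, size `1`, `acDepth 1`) errs on at most a
`1/k!`-fraction; `n ^ c < 1` is false. So every witness `(k, δ)` of `Conc` has `δ < 1/k!`.
[folklore] -/
theorem not_innerConc_of_factorial_inv_le {d : ℕ} (hd : 1 ≤ d) (c : ℕ) {k : ℕ} (hk : 2 ≤ k)
    {δ : ℝ} (hδ : 1 / (k.factorial : ℝ) ≤ δ) : ¬ InnerConc d c k δ := by
  intro h
  obtain ⟨n, hn, hn1⟩ := (h.and (eventually_ge_atTop 1)).exists
  have hδ0 : 0 ≤ δ := (by positivity : (0 : ℝ) ≤ 1 / (k.factorial : ℝ)).trans hδ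
  have herr : (sliceErr n (mk n k) (Circuit.const _ false).eval (cliqueFn n k) : ℝ) ≤
      δ * sliceCard n (mk n k) := by
    rw [sliceErr_const_false]
    by_cases hKm : k.choose 2 ≤ mk n k
    · calc _ ≤ 1 / (k.factorial : ℝ) * sliceCard n (mk n k) :=
            firstMoment_slice hk hn1 hKm (mk_le_choose hn1 hk) (Nat.floor_le (by positivity))
        _ ≤ δ * sliceCard n (mk n k) := mul_le_mul_of_nonneg_right hδ (Nat.cast_nonneg _)
    · have h0 : #(univ.filter fun x : (⊤ : SimpleGraph (Fin n)).edgeSet → Bool =>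
          edgeCount x = mk n k ∧ cliqueFn n k x = true) = 0 := by
        rw [Finset.card_eq_zero, Finset.filter_eq_empty_iff]
        rintro x - ⟨hj, hcl⟩
        exact hKm (hj ▸ choose_le_edgeCount_of_cliqueFn hcl)
      rw [h0, Nat.cast_zero]
      exact mul_nonneg hδ0 (Nat.cast_nonneg _)
  have hlt := hn (mk n k) (centre_count n k) (Circuit.const _ false)
    (Circuit.const_isOver_acBasis false) (by rw [Circuit.acDepth_const]; exact hd) herr
  rw [Circuit.size_const] at hlt
  exact absurd (Nat.one_le_pow c n hn1) (not_le.2 hlt)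

/-- **`δ ≥ 1/k!` is impossible in `Hyp`** likewise, at the central density (through the in-tree
first moment `gnpProb_clique_le`). [folklore] -/
theorem not_innerHyp_of_factorial_inv_le {d : ℕ} (hd : 1 ≤ d) (c : ℕ) {k : ℕ} (hk : 2 ≤ k)
    {δ : ℝ} (hδ : 1 / (k.factorial : ℝ) ≤ δ) : ¬ InnerHyp d c k δ := by
  intro h
  obtain ⟨n, hn, hn2⟩ := (h.and (eventually_ge_atTop 2)).exists
  obtain ⟨hq0, hq1, hqw⟩ := centre_density hn2 hk
  have hN : 0 < n.choose 2 := Nat.choose_pos hn2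
  have herr : gnpDisagreeProb n ((mk n k : ℝ) / (n.choose 2 : ℕ)) (Circuit.const _ false).eval
      (cliqueFn n k) ≤ δ := by
    rw [gnpDisagreeProb_const_false]
    refine (gnpProb_clique_le hq0 hq1 k).trans ?_
    exact (choose_mul_ratio_pow_le hk (by omega) hN (Nat.floor_le (by positivity))).trans hδ
  have hlt := hn _ hq0 hq1 hqw (Circuit.const _ false) (Circuit.const_isOver_acBasis false)
    (by rw [Circuit.acDepth_const]; exact hd) herr
  rw [Circuit.size_const] at hlt
  exact absurd (Nat.one_le_pow c n (by omega)) (not_le.2 hlt)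

/-- Every witness `(k, δ)` of `Conc` (at `d ≥ 1`, `k ≥ 2`) has `δ < 1/k!`. [folklore] -/
theorem lt_factorial_inv_of_innerConc {d c k : ℕ} (hd : 1 ≤ d) (hk : 2 ≤ k) {δ : ℝ}
    (h : InnerConc d c k δ) : δ < 1 / (k.factorial : ℝ) :=
  lt_of_not_ge fun hδ => not_innerConc_of_factorial_inv_le hd c hk hδ h

/-- Every witness `(k, δ)` of `Hyp` (at `d ≥ 1`, `k ≥ 2`) has `δ < 1/k!`. [folklore] -/
theorem lt_factorial_inv_of_innerHyp {d c k : ℕ} (hd : 1 ≤ d) (hk : 2 ≤ k) {δ : ℝ}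
    (h : InnerHyp d c k δ) : δ < 1 / (k.factorial : ℝ) :=
  lt_of_not_ge fun hδ => not_innerHyp_of_factorial_inv_le hd c hk hδ h

/-- If `k > ⌈1/δ⌉₊` then `1/k! ≤ δ`. [folklore] -/
theorem factorial_inv_le_of_ceil_lt {δ : ℝ} (hδ : 0 < δ) {k : ℕ} (hk : ⌈1 / δ⌉₊ < k) :
    1 / (k.factorial : ℝ) ≤ δ := by
  have hk0 : (0 : ℝ) < k := by exact_mod_cast (Nat.zero_le _).trans_lt hk
  have h1 : 1 / δ < k := (Nat.le_ceil _).trans_lt (by exact_mod_cast hk)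
  have h2 : 1 / (k : ℝ) < δ := (one_div_lt hδ hk0).1 h1
  have h3 : 1 / (k.factorial : ℝ) ≤ 1 / (k : ℝ) :=
    one_div_le_one_div_of_le hk0 (by exact_mod_cast Nat.self_le_factorial k)
  exact h3.trans h2.le

/-- **`δ` cannot be chosen before `k` in `Conc`**: the quantifier order `∀ d ∃ δ ∀ c ∃ k` is false
(`d = 2`; given `δ` take `c = ⌈1/δ⌉₊`: a witness `k ≤ c` is killed by the clique DNF, a witness
`k > c` has `1/k! ≤ δ` and is killed by the constant circuit). [folklore] -/
theorem not_concDeltaFirst :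
    ¬ ∀ d : ℕ, ∃ δ : ℝ, 0 < δ ∧ ∀ c : ℕ, ∃ k : ℕ, 3 ≤ k ∧ InnerConc d c k δ := by
  intro h
  obtain ⟨δ, hδ, hc⟩ := h 2
  obtain ⟨k, hk3, hI⟩ := hc ⌈1 / δ⌉₊
  by_cases hkc : k ≤ ⌈1 / δ⌉₊
  · exact not_innerConc_of_le le_rfl (by omega) hkc hδ.le hI
  · exact not_innerConc_of_factorial_inv_le (by norm_num) _ (by omega)
      (factorial_inv_le_of_ceil_lt hδ (not_le.1 hkc)) hI

/-- **`δ` cannot be chosen before `k` in `Hyp`** (same argument at the central density). [folklore] -/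
theorem not_hypDeltaFirst :
    ¬ ∀ d : ℕ, ∃ δ : ℝ, 0 < δ ∧ ∀ c : ℕ, ∃ k : ℕ, 3 ≤ k ∧ InnerHyp d c k δ := by
  intro h
  obtain ⟨δ, hδ, hc⟩ := h 2
  obtain ⟨k, hk3, hI⟩ := hc ⌈1 / δ⌉₊
  by_cases hkc : k ≤ ⌈1 / δ⌉₊
  · exact not_innerHyp_of_le le_rfl (by omega) hkc hδ.le hI
  · exact not_innerHyp_of_factorial_inv_le (by norm_num) _ (by omega)
      (factorial_inv_le_of_ceil_lt hδ (not_le.1 hkc)) hI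

end Moment

/-! ## Part V — how far down may the window reach? Not to `m · n^{-ε}` (subcritical slices)

A quantitative tightness statement about the WINDOW: if the lower edge of the window is moved from
`m - m^{3/4}` down to `m · n^{-ε}` for any fixed `ε > 0`, the inner clause of `Conc` becomes FALSE
(`d ≥ 1`, every `c`, `k ≥ 3`, every `δ > 0`): on the slice `j = ⌈m n^{-ε}⌉₊` the first moment gives
`Pr_j[k-clique] ≤ (2 n^{-ε})^{C(k,2)}/k! → 0`, so the constant-`0` circuit is `δ`-accurate
(`not_innerConcLowWindow`). Hence the admissible windows are `m · n^{±o(1)}`; the route's `m ± m^{3/4}`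
sits safely inside (and must: the intended transfer needs `±√j·log j` room around every central `j`).
The symmetric statement for the UPPER edge (`j = m · n^{ε}`, constant-`1` circuit) needs
`Pr_j[no k-clique] → 0`, a second-moment/Janson bound on the slice — not attempted. -/

section LowWindow

variable {n : ℕ}

/-- **Threshold arithmetic with a density factor `t`**: if `j ≤ C(n,2) · n^{-2/(k-1)} · t` then
`C(n,k) · (j/C(n,2))^{C(k,2)} ≤ t^{C(k,2)}/k!`. [folklore] -/
theorem choose_mul_ratio_pow_le' {n k j : ℕ} (hk : 2 ≤ k) (hn : 1 ≤ n) (hN : 0 < n.choose 2)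
    {t : ℝ} (hjm : (j : ℝ) ≤ (n.choose 2 : ℕ) * (n : ℝ) ^ (-(2 : ℝ) / ((k : ℝ) - 1)) * t) :
    (n.choose k : ℝ) * ((j : ℝ) / (n.choose 2 : ℕ)) ^ (k.choose 2) ≤
      t ^ (k.choose 2) / (k.factorial : ℝ) := by
  have hNr : (0 : ℝ) < (n.choose 2 : ℕ) := by exact_mod_cast hN
  have hn0 : (0 : ℝ) ≤ n := Nat.cast_nonneg _
  have hnpos : (0 : ℝ) < n := by exact_mod_cast hn
  have ha0 : 0 ≤ (n : ℝ) ^ (-(2 : ℝ) / ((k : ℝ) - 1)) := Real.rpow_nonneg hn0 _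
  have hratio : (j : ℝ) / (n.choose 2 : ℕ) ≤ (n : ℝ) ^ (-(2 : ℝ) / ((k : ℝ) - 1)) * t := by
    rw [div_le_iff₀ hNr]
    calc (j : ℝ) ≤ (n.choose 2 : ℕ) * (n : ℝ) ^ (-(2 : ℝ) / ((k : ℝ) - 1)) * t := hjm
      _ = (n : ℝ) ^ (-(2 : ℝ) / ((k : ℝ) - 1)) * t * (n.choose 2 : ℕ) := by ring
  have hratio0 : 0 ≤ (j : ℝ) / (n.choose 2 : ℕ) := div_nonneg (Nat.cast_nonneg _) hNr.le
  have hpow : ((j : ℝ) / (n.choose 2 : ℕ)) ^ (k.choose 2) ≤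
      ((n : ℝ) ^ (-(2 : ℝ) / ((k : ℝ) - 1)) * t) ^ (k.choose 2) :=
    pow_le_pow_left₀ hratio0 hratio _
  have hexp : ((n : ℝ) ^ (-(2 : ℝ) / ((k : ℝ) - 1))) ^ (k.choose 2) = ((n : ℝ) ^ k)⁻¹ := by
    rw [← Real.rpow_mul_natCast hn0, Nat.cast_choose_two]
    have hk1 : (k : ℝ) - 1 ≠ 0 := by
      have : (2 : ℝ) ≤ k := by exact_mod_cast hk
      linarith
    have : -(2 : ℝ) / ((k : ℝ) - 1) * ((k : ℝ) * ((k : ℝ) - 1) / 2) = -(k : ℝ) := by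
      field_simp
    rw [this, Real.rpow_neg hn0, Real.rpow_natCast]
  have hchoose : (n.choose k : ℝ) ≤ (n : ℝ) ^ k / (k.factorial : ℝ) := by
    have := Nat.choose_le_pow_div k n (α := ℝ)
    simpa using this
  have hnk : (0 : ℝ) < (n : ℝ) ^ k := pow_pos hnpos k
  calc (n.choose k : ℝ) * ((j : ℝ) / (n.choose 2 : ℕ)) ^ (k.choose 2)
      ≤ ((n : ℝ) ^ k / k.factorial) * (((n : ℝ) ^ k)⁻¹ * t ^ (k.choose 2)) := by
        rw [← hexp, ← mul_pow]
        exact mul_le_mul hchoose hpow (pow_nonneg hratio0 _)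
          (div_nonneg (pow_nonneg hn0 _) (Nat.cast_nonneg _))
    _ = t ^ (k.choose 2) / k.factorial := by
        field_simp

/-- **First moment on a slice below the threshold**: if `C(k,2) ≤ j ≤ C(n,2)` and
`j ≤ C(n,2) · n^{-2/(k-1)} · t`, at most a `t^{C(k,2)}/k!`-fraction of the graphs with
exactly `j` edges have a `k`-clique. [folklore] -/
theorem firstMoment_slice' {k j : ℕ} (hk : 2 ≤ k) (hn : 1 ≤ n) (hKj : k.choose 2 ≤ j)
    (hjN : j ≤ n.choose 2) {t : ℝ}
    (hjm : (j : ℝ) ≤ (n.choose 2 : ℕ) * (n : ℝ) ^ (-(2 : ℝ) / ((k : ℝ) - 1)) * t) :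
    (#(univ.filter fun x : (⊤ : SimpleGraph (Fin n)).edgeSet → Bool =>
        edgeCount x = j ∧ cliqueFn n k x = true) : ℝ) ≤
      t ^ (k.choose 2) / (k.factorial : ℝ) * sliceCard n j := by
  have hK1 : 0 < k.choose 2 := Nat.choose_pos hk
  have hN : 0 < n.choose 2 := by omega
  have hNr : (0 : ℝ) < (n.choose 2 : ℕ) := by exact_mod_cast hN
  have hcomb := card_slice_clique_le (n := n) j k hKj
  have hratio := choose_sub_mul_pow_le_choose_mul_pow (K := k.choose 2) hKj hjN
  have hratio' : (((n.choose 2 - k.choose 2).choose (j - k.choose 2) : ℕ) : ℝ) ≤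
      ((n.choose 2).choose j : ℕ) * ((j : ℝ) / (n.choose 2 : ℕ)) ^ (k.choose 2) := by
    rw [div_pow, ← mul_div_assoc, le_div_iff₀ (pow_pos hNr _)]
    exact_mod_cast hratio
  calc (#(univ.filter fun x : (⊤ : SimpleGraph (Fin n)).edgeSet → Bool =>
          edgeCount x = j ∧ cliqueFn n k x = true) : ℝ)
      ≤ (n.choose k : ℝ) * (((n.choose 2 - k.choose 2).choose (j - k.choose 2) : ℕ) : ℝ) := by
        exact_mod_cast hcomb
    _ ≤ (n.choose k : ℝ) * (((n.choose 2).choose j : ℕ) * ((j : ℝ) / (n.choose 2 : ℕ)) ^ (k.choose 2)) :=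
        mul_le_mul_of_nonneg_left hratio' (Nat.cast_nonneg _)
    _ = ((n.choose k : ℝ) * ((j : ℝ) / (n.choose 2 : ℕ)) ^ (k.choose 2)) *
          ((n.choose 2).choose j : ℕ) := by ring
    _ ≤ t ^ (k.choose 2) / (k.factorial : ℝ) * ((n.choose 2).choose j : ℕ) :=
        mul_le_mul_of_nonneg_right (choose_mul_ratio_pow_le' hk hn hN hjm) (Nat.cast_nonneg _)
    _ = t ^ (k.choose 2) / (k.factorial : ℝ) * sliceCard n j := by rw [sliceCard_eq]

/-- `InnerConc` with the window `[m_k(n) - m_k(n)^{3/4}, m_k(n) + m_k(n)^{3/4}]` replaced by the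
polynomially deeper one-sided window `[m_k(n) · n^{-ε}, m_k(n)]`. [folklore] -/
def InnerConcLowWindow (d c k : ℕ) (δ ε : ℝ) : Prop :=
  ∀ᶠ n : ℕ in atTop, ∀ j : ℕ, (mk n k : ℝ) * (n : ℝ) ^ (-ε) ≤ j → j ≤ mk n k →
    ∀ C : Circuit ((⊤ : SimpleGraph (Fin n)).edgeSet), C.IsOver acBasis → C.acDepth ≤ d →
      (sliceErr n j C.eval (cliqueFn n k) : ℝ) ≤ δ * sliceCard n j → n ^ c < C.size

/-- **The window cannot reach the subcritical slices `j ≈ m · n^{-ε}`** (`d ≥ 1`, every `c`, `k ≥ 3`,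
every `δ > 0`, `ε > 0`): there `Pr_j[k-clique] ≤ (2n^{-ε})^{C(k,2)}/k! ≤ 2 n^{-ε} ≤ δ` eventually, so
the constant-`0` circuit (size `1`) is `δ`-accurate and `n ^ c < 1` fails. [folklore] -/
theorem not_innerConcLowWindow {d : ℕ} (hd : 1 ≤ d) (c : ℕ) {k : ℕ} (hk : 3 ≤ k) {δ ε : ℝ}
    (hδ : 0 < δ) (hε : 0 < ε) : ¬ InnerConcLowWindow d c k δ ε := by
  intro h
  -- eventually n^{-ε} ≤ min (1/2) (δ/2)
  have hsmall : ∀ᶠ n : ℕ in atTop, (n : ℝ) ^ (-ε) < min (1 / 2) (δ / 2) :=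
    ((tendsto_rpow_neg_atTop hε).comp tendsto_natCast_atTop_atTop).eventually
      (gt_mem_nhds (lt_min (by norm_num) (by linarith)))
  obtain ⟨n, hn, hn1, hsm⟩ := (h.and ((eventually_ge_atTop 1).and hsmall)).exists
  have hk2 : 2 ≤ k := by omega
  have hn0 : (0 : ℝ) ≤ n := Nat.cast_nonneg _
  have hnε0 : 0 ≤ (n : ℝ) ^ (-ε) := Real.rpow_nonneg hn0 _
  have hnε1 : (n : ℝ) ^ (-ε) ≤ 1 :=
    Real.rpow_le_one_of_one_le_of_nonpos (by exact_mod_cast hn1) (by linarith)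
  have hhalf : (n : ℝ) ^ (-ε) < 1 / 2 := hsm.trans_le (min_le_left _ _)
  have hdel : (n : ℝ) ^ (-ε) < δ / 2 := hsm.trans_le (min_le_right _ _)
  set x : ℝ := (mk n k : ℝ) * (n : ℝ) ^ (-ε) with hx
  have hx0 : 0 ≤ x := mul_nonneg (Nat.cast_nonneg _) hnε0
  set j : ℕ := ⌈x⌉₊ with hj
  have hjlow : x ≤ j := Nat.le_ceil x
  have hjup : j ≤ mk n k := by
    refine Nat.ceil_le.2 ?_
    calc x ≤ (mk n k : ℝ) * 1 := mul_le_mul_of_nonneg_left hnε1 (Nat.cast_nonneg _)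
      _ = (mk n k : ℕ) := by rw [mul_one]
  -- the constant-0 circuit is δ-accurate on slice j
  have herr : (sliceErr n j (Circuit.const _ false).eval (cliqueFn n k) : ℝ) ≤ δ * sliceCard n j := by
    rw [sliceErr_const_false]
    by_cases hKj : k.choose 2 ≤ j
    · -- here x ≥ j - 1 ≥ K - 1 ≥ 2, so j ≤ x + 1 ≤ 2x
      have hK3 : 3 ≤ k.choose 2 := by
        have := Nat.choose_le_choose 2 hk
        simpa using this
      have hx1 : 1 ≤ x := by
        have : (j : ℝ) < x + 1 := Nat.ceil_lt_add_one hx0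
        have hj3 : (3 : ℝ) ≤ j := by exact_mod_cast hK3.trans hKj
        linarith
      have hj2x : (j : ℝ) ≤ 2 * x := by
        have : (j : ℝ) < x + 1 := Nat.ceil_lt_add_one hx0
        linarith
      have hmk : (mk n k : ℝ) ≤ (n.choose 2 : ℕ) * (n : ℝ) ^ (-(2 : ℝ) / ((k : ℝ) - 1)) :=
        Nat.floor_le (by positivity)
      have hjm : (j : ℝ) ≤ (n.choose 2 : ℕ) * (n : ℝ) ^ (-(2 : ℝ) / ((k : ℝ) - 1)) *
          (2 * (n : ℝ) ^ (-ε)) := by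
        calc (j : ℝ) ≤ 2 * x := hj2x
          _ = (mk n k : ℝ) * (2 * (n : ℝ) ^ (-ε)) := by rw [hx]; ring
          _ ≤ _ := mul_le_mul_of_nonneg_right hmk (by positivity)
      have hfm := firstMoment_slice' hk2 hn1 hKj (hjup.trans (mk_le_choose hn1 hk2)) hjm
      refine hfm.trans (mul_le_mul_of_nonneg_right ?_ (Nat.cast_nonneg _))
      -- (2 n^{-ε})^K / k! ≤ 2 n^{-ε} ≤ δ
      have hb0 : 0 ≤ 2 * (n : ℝ) ^ (-ε) := by positivity
      have hb1 : 2 * (n : ℝ) ^ (-ε) ≤ 1 := by linarith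
      have hK1 : 1 ≤ k.choose 2 := by omega
      have hfac : (1 : ℝ) ≤ k.factorial := by exact_mod_cast Nat.one_le_iff_ne_zero.2 (Nat.factorial_ne_zero k)
      calc (2 * (n : ℝ) ^ (-ε)) ^ (k.choose 2) / (k.factorial : ℝ)
          ≤ (2 * (n : ℝ) ^ (-ε)) ^ (k.choose 2) := div_le_self (pow_nonneg hb0 _) hfac
        _ ≤ (2 * (n : ℝ) ^ (-ε)) ^ 1 := pow_le_pow_of_le_one hb0 hb1 hK1
        _ ≤ δ := by rw [pow_one]; linarith
    · have h0 : #(univ.filter fun x : (⊤ : SimpleGraph (Fin n)).edgeSet → Bool =>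
          edgeCount x = j ∧ cliqueFn n k x = true) = 0 := by
        rw [Finset.card_eq_zero, Finset.filter_eq_empty_iff]
        rintro y - ⟨hyj, hcl⟩
        exact hKj (hyj ▸ choose_le_edgeCount_of_cliqueFn hcl)
      rw [h0, Nat.cast_zero]
      exact mul_nonneg hδ.le (Nat.cast_nonneg _)
  have hlt := hn j (by rw [hj]; exact hjlow) hjup (Circuit.const _ false)
    (Circuit.const_isOver_acBasis false) (by rw [Circuit.acDepth_const]; exact hd) herr
  rw [Circuit.size_const] at hlt
  exact absurd (Nat.one_le_pow c n hn1) (not_le.2 hlt)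

end LowWindow

/-! ## Part VI — the `∀ᶠ n` threshold must grow with `k`: empty slices inside the window

For `k` large against `log n` the threshold density `n^{-2/(k-1)}` is close to `1`, `m_k(n)` is close to
`C(n,2)`, and the window `m ± m^{3/4}` sticks out ABOVE `C(n,2)`: those slices are EMPTY, the accuracy
hypothesis `0 ≤ δ · 0` holds for every circuit, and the clause demands `n^c < |C|` of the gate-free
circuit `x_e` — false. Certified instance: `n = 4`, `k = 101` (`m = ⌊6 · 4^{-1/50}⌋ = 5`,
`5^{3/4} ≥ 2`, so `j = 7 > 6 = C(4,2)` is in the window): `innerConc_body_false_at_four`. So the body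
of `Conc` at a FIXED `n` fails for suitable `k`, i.e. the threshold `n₀` hidden in `∀ᶠ n` is
necessarily a function of `k` (any proof must wait until `m + m^{3/4} ≤ C(n,2)`, roughly
`n ≳ 2^{k}`-free but `n^{2/(k-1)}`-dependent: `C(n,2)^{1/4}(1 - n^{-2/(k-1)}) ≥ 1`). -/

section EmptySlices

/-- `⌊6 · 4^{-1/50}⌋ = 5`: the critical edge count `m_101(4)`. [folklore] -/
theorem mk_four : mk 4 101 = 5 := by
  have h4 : (1 : ℝ) < 4 := by norm_num
  have hroot : (4 : ℝ) ^ ((1 : ℝ) / 50) ≤ 6 / 5 := by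
    refine le_of_pow_le_pow_left₀ (n := 50) (by norm_num) (by norm_num) ?_
    rw [← Real.rpow_mul_natCast (by norm_num : (0 : ℝ) ≤ 4)]
    norm_num
  have hroot0 : (0 : ℝ) < (4 : ℝ) ^ ((1 : ℝ) / 50) := Real.rpow_pos_of_pos (by norm_num) _
  have hneg : (4 : ℝ) ^ (-(2 : ℝ) / ((101 : ℕ) - 1 : ℝ)) = ((4 : ℝ) ^ ((1 : ℝ) / 50))⁻¹ := by
    rw [← Real.rpow_neg (by norm_num : (0 : ℝ) ≤ 4)]
    norm_num
  have hlow : (5 : ℝ) / 6 ≤ ((4 : ℝ) ^ ((1 : ℝ) / 50))⁻¹ := by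
    rw [show (5 : ℝ) / 6 = (6 / 5)⁻¹ by norm_num]
    exact inv_anti₀ hroot0 hroot
  have hup : ((4 : ℝ) ^ ((1 : ℝ) / 50))⁻¹ < 1 :=
    inv_lt_one_of_one_lt₀ (Real.one_lt_rpow h4 (by norm_num))
  unfold mk
  rw [Nat.floor_eq_iff (by positivity)]
  have hN : ((Nat.choose 4 2 : ℕ) : ℝ) = 6 := by norm_num [Nat.choose]
  rw [hN, show ((4 : ℕ) : ℝ) = 4 by norm_num, show ((101 : ℕ) : ℝ) - 1 = ((101 : ℕ) - 1 : ℝ) by rfl,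
    hneg]
  constructor
  · push_cast
    linarith
  · push_cast
    linarith

/-- `5^{3/4} ≥ 2` (as `5^3 = 125 ≥ 16 = 2^4`). [folklore] -/
theorem two_le_five_rpow : (2 : ℝ) ≤ (5 : ℝ) ^ ((3 : ℝ) / 4) := by
  refine le_of_pow_le_pow_left₀ (n := 4) (by norm_num) (Real.rpow_nonneg (by norm_num) _) ?_
  rw [← Real.rpow_mul_natCast (by norm_num : (0 : ℝ) ≤ 5)]
  norm_num

/-- The error count on a slice is at most the size of the slice. [folklore] -/
theorem sliceErr_le_sliceCard (n j : ℕ) (f g : ((⊤ : SimpleGraph (Fin n)).edgeSet → Bool) → Bool) :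
    sliceErr n j f g ≤ sliceCard n j :=
  Finset.card_le_card (Finset.monotone_filter_right _ fun _ _ h => h.1)

/-- **The body of `Conc` at `n = 4` fails for `k = 101`** (every `d`, `c`, `δ`): the slice
`j = 7 > C(4,2)` lies in the window `|j − 5| ≤ 5^{3/4}` and is EMPTY, so the gate-free circuit `x_e`
(size `0`) meets the accuracy hypothesis `0 ≤ δ · 0` and `4^c < 0` fails. Hence the threshold `n₀`
of `∀ᶠ n` in `Conc` must depend on `k`. [folklore] -/
theorem innerConc_body_false_at_four (d c : ℕ) (δ : ℝ) :
    ¬ (∀ j : ℕ, |(j : ℝ) - (mk 4 101 : ℝ)| ≤ (mk 4 101 : ℝ) ^ ((3 : ℝ) / 4) →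
        ∀ C : Circuit ((⊤ : SimpleGraph (Fin 4)).edgeSet), C.IsOver acBasis → C.acDepth ≤ d →
          (sliceErr 4 j C.eval (cliqueFn 4 101) : ℝ) ≤ δ * sliceCard 4 j → 4 ^ c < C.size) := by
  intro h
  obtain ⟨e⟩ := exists_edge (n := 4) (by norm_num)
  obtain ⟨hB, hD, hS, -⟩ := input_facts e acBasis
  have hwin : |((7 : ℕ) : ℝ) - (mk 4 101 : ℝ)| ≤ (mk 4 101 : ℝ) ^ ((3 : ℝ) / 4) := by
    rw [mk_four]
    simp only [Nat.cast_ofNat]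
    rw [show |(7 : ℝ) - 5| = 2 by norm_num]
    exact two_le_five_rpow
  have hcard : sliceCard 4 7 = 0 := by
    rw [sliceCard_eq]
    decide
  have herr : (sliceErr 4 7 (Circuit.input e).eval (cliqueFn 4 101) : ℝ) ≤ δ * sliceCard 4 7 := by
    have h0 : sliceErr 4 7 (Circuit.input e).eval (cliqueFn 4 101) = 0 :=
      Nat.eq_zero_of_le_zero (hcard ▸ sliceErr_le_sliceCard 4 7 _ _)
    rw [h0, hcard, Nat.cast_zero, mul_zero]
  have hlt := h 7 hwin (Circuit.input e) hB (hD.trans_le (Nat.zero_le d)) herr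
  rw [hS] at hlt
  exact Nat.not_lt_zero _ hlt

end EmptySlices

/-! ## Part III — work-file packaging (not filed under Theorems/) -/

/-- The hypothesis of the crux as one proposition. [folklore] -/
def Hyp : Prop := ∀ d c : ℕ, ∃ k : ℕ, 3 ≤ k ∧ ∃ δ : ℝ, 0 < δ ∧ InnerHyp d c k δ

/-- The conclusion of the crux as one proposition. [folklore] -/
def Conc : Prop := ∀ d c : ℕ, ∃ k : ℕ, 3 ≤ k ∧ ∃ δ : ℝ, 0 < δ ∧ InnerConc d c k δ

/-- `SliceACZero ↔ (Hyp → Conc)` (definitional). [folklore] -/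
theorem sliceACZero_iff' : SliceACZero ↔ (Hyp → Conc) := Iff.rfl

/-- Dropping the window from the conclusion turns the crux into `¬Hyp`: it would then be provable
exactly if Rossman's single-threshold bound (in the inline form) were FALSE. [folklore] -/
theorem without_window_iff_not_hyp :
    (Hyp → ∀ d c : ℕ, ∃ k : ℕ, 3 ≤ k ∧ ∃ δ : ℝ, 0 < δ ∧ InnerConcNoWindow d c k δ) ↔ ¬ Hyp :=
  ⟨fun h hH => not_concNoWindow (h hH), fun h hH => absurd hH h⟩

/-- Dropping the basis restriction from the conclusion turns the crux into `¬Hyp`. [folklore] -/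
theorem without_basis_iff_not_hyp :
    (Hyp → ∀ d c : ℕ, ∃ k : ℕ, 3 ≤ k ∧ ∃ δ : ℝ, 0 < δ ∧ InnerConcNoBasis d c k δ) ↔ ¬ Hyp :=
  ⟨fun h hH => not_concNoBasis (h hH), fun h hH => absurd hH h⟩

/-- Dropping the accuracy hypothesis from the conclusion turns the crux into `¬Hyp`. [folklore] -/
theorem without_error_iff_not_hyp :
    (Hyp → ∀ d c : ℕ, ∃ k : ℕ, 3 ≤ k ∧ ∃ δ : ℝ, 0 < δ ∧ InnerConcNoError d c k) ↔ ¬ Hyp :=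
  ⟨fun h hH => not_concNoError (h hH), fun h hH => absurd hH h⟩

/-- Replacing the two-sided window of the conclusion by `m_k(n) ≤ j` turns the crux into `¬Hyp`.
[folklore] -/
theorem window_above_iff_not_hyp :
    (Hyp → ∀ d c : ℕ, ∃ k : ℕ, 3 ≤ k ∧ ∃ δ : ℝ, 0 < δ ∧ InnerConcWindowAbove d c k δ) ↔ ¬ Hyp :=
  ⟨fun h hH => not_concWindowAbove (h hH), fun h hH => absurd hH h⟩

/-! ### Glue the intended proof needs: a central edge count gives a central density -/

/-- **Window match.** For an edge count `j` in the window of `Conc` (and `j ≤ C(n,2)`, which holds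
for every central `j` eventually but not for all small `n`: e.g. `n = 4`, `k = 101` has `m = 5`,
`m + m^{3/4} > 8 > C(4,2) = 6`, where the slices `j = 7, 8` are EMPTY and the inner clause of `Conc`
fails outright — harmless under `∀ᶠ n`), the density `q = j / C(n,2)` is admissible in `Hyp`:
`0 ≤ q ≤ 1` and `|q·C(n,2) − m_k(n)| ≤ m_k(n)^{3/4}`. This is the (only) way the intended
slice-to-binomial transfer consumes `Hyp`: at `q = j/C(n,2)` for EVERY central `j`, so the `q`-window
of `Hyp` must cover the `j`-window of `Conc` (restating `Hyp` at the single density `m_k(n)/C(n,2)`, as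
once suggested, would strand the slices with `|j − m| ≫ √m`). [folklore] -/
theorem density_of_central_count {n k j : ℕ} (hn : 2 ≤ n)
    (hj : |(j : ℝ) - (mk n k : ℝ)| ≤ (mk n k : ℝ) ^ ((3 : ℝ) / 4)) (hjN : j ≤ n.choose 2) :
    0 ≤ (j : ℝ) / (n.choose 2 : ℕ) ∧ (j : ℝ) / (n.choose 2 : ℕ) ≤ 1 ∧
      |(j : ℝ) / (n.choose 2 : ℕ) * (n.choose 2 : ℕ) - (mk n k : ℝ)| ≤ (mk n k : ℝ) ^ ((3 : ℝ) / 4) := by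
  have hN : (0 : ℝ) < (n.choose 2 : ℕ) := by exact_mod_cast Nat.choose_pos hn
  refine ⟨div_nonneg (Nat.cast_nonneg _) hN.le, ?_, ?_⟩
  · rw [div_le_one hN]
    exact_mod_cast hjN
  · rwa [div_mul_cancel₀ _ hN.ne']

/-! ### The depth bound is what makes the crux a rung: without it, `Conc` is the route target -/

/-- `InnerConc` with the depth bound `C.acDepth ≤ d` deleted (poly-size AC circuits of any depth,
i.e. all of P/poly up to the basis). [folklore] -/
def InnerConcNoDepth (c k : ℕ) (δ : ℝ) : Prop :=
  ∀ᶠ n : ℕ in atTop, ∀ j : ℕ, |(j : ℝ) - (mk n k : ℝ)| ≤ (mk n k : ℝ) ^ ((3 : ℝ) / 4) →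
    ∀ C : Circuit ((⊤ : SimpleGraph (Fin n)).edgeSet), C.IsOver acBasis →
      (sliceErr n j C.eval (cliqueFn n k) : ℝ) ≤ δ * sliceCard n j → n ^ c < C.size

/-- `{∧₂, ∨₂} ⊆ {¬} ∪ {∧ₘ, ∨ₘ | m}`: a monotone fan-in-2 circuit is an AC circuit. [folklore] -/
theorem monotoneBasis_subset_acBasis : monotoneBasis ⊆ acBasis := by
  intro g hg
  simp only [monotoneBasis, Set.mem_insert_iff, Set.mem_singleton_iff] at hg
  rcases hg with rfl | rfl
  · exact and_mem_acBasis 2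
  · exact or_mem_acBasis 2

/-- **Without the depth bound the conclusion implies the route TARGET** `SliceTarget` (monotone
`{∧₂,∨₂}`-circuits are AC circuits; the error normalisation and the window are literally the same).
So `Conc` is the bounded-depth shadow of `X`; the depth clause is the whole difference between rung
#4 and the summit-strength statement. (Work file only: a positive implication into a Theses decl.)
[folklore] -/
theorem sliceTarget_of_concNoDepth
    (h : ∀ c : ℕ, ∃ k : ℕ, 3 ≤ k ∧ ∃ δ : ℝ, 0 < δ ∧ InnerConcNoDepth c k δ) :
    Summit.PneNP.PneNP.Theses.OneSlice.SliceTarget := by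
  intro c
  obtain ⟨k, hk, δ, hδ, hI⟩ := h c
  refine ⟨k, hk, δ, hδ, hI.mono fun n hn j hj C hC herr => ?_⟩
  exact hn j hj C (hC.mono monotoneBasis_subset_acBasis) herr

/-! ## Part VII — the lines' C⁺ `SliceIndist`: each structural hypothesis is load-bearing

Generic finite cube `{0,1}^ι`; vocabulary copied VERBATIM from `Lines/russo-window-ladder.lean`
(§Vocabulary) so that the refuted variants differ from the line's `SliceIndist` in exactly one clause.
Filed as `Theorems/SliceACZero/Negative/SliceIndistVariants.lean` (namespace `…Theorems.SliceACZero.Negative`). -/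

/-! ### Vocabulary on a finite cube (verbatim copy of `Lines/russo-window-ladder.lean` §Vocabulary) -/

section Cube

variable {ι : Type} [Fintype ι] [DecidableEq ι]

/-- `|x|`: the number of ones of `x` (verbatim copy of the russo-window-ladder vocabulary). [folklore] -/
def wt (x : ι → Bool) : ℕ := #(univ.filter fun i => x i = true)

/-- The `μ_q` weight `q^{|x|}(1−q)^{N−|x|}` (verbatim copy). [folklore] -/
def prodWeight (q : ℝ) (x : ι → Bool) : ℝ := q ^ wt x * (1 - q) ^ (Fintype.card ι - wt x)

/-- `E_{μ_q}[f]` as a finite sum (verbatim copy). [folklore] -/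
def prodAvg (q : ℝ) (f : (ι → Bool) → Bool) : ℝ :=
  ∑ x ∈ univ.filter (fun x : ι → Bool => f x = true), prodWeight q x

/-- `a_ℓ(f)`: the fraction of the Hamming slice `{|x| = ℓ}` on which `f = 1` (verbatim copy). [folklore] -/
def sliceAvg (f : (ι → Bool) → Bool) (ℓ : ℕ) : ℝ :=
  (#(univ.filter fun x : ι → Bool => wt x = ℓ ∧ f x = true) : ℝ) /
    (#(univ.filter fun x : ι → Bool => wt x = ℓ) : ℝ)

omit [DecidableEq ι] in
/-- The all-ones point has weight `N`. [folklore] -/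
theorem wt_const_true : wt (fun _ : ι => true) = Fintype.card ι := by
  simp [wt]

omit [DecidableEq ι] in
/-- `|x| ≤ N`. [folklore] -/
theorem wt_le_card (x : ι → Bool) : wt x ≤ Fintype.card ι := by
  unfold wt
  exact (Finset.card_filter_le _ _).trans (by rw [Finset.card_univ])

/-- The number of points of weight `j` on `{0,1}^ι` is `C(N,j)`. [folklore] -/
theorem card_filter_wt_eq (j : ℕ) :
    #(univ.filter fun x : ι → Bool => wt x = j) = (Fintype.card ι).choose j := by
  rw [← Finset.card_univ (α := ι), ← Finset.card_powersetCard]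
  refine Finset.card_nbij' (fun x => univ.filter fun i => x i = true) (fun S i => decide (i ∈ S))
    ?_ ?_ ?_ ?_
  · intro x hx
    rw [Finset.mem_coe, Finset.mem_filter] at hx
    rw [Finset.mem_coe, Finset.mem_powersetCard]
    exact ⟨Finset.filter_subset _ _, hx.2⟩
  · intro S hS
    rw [Finset.mem_coe, Finset.mem_powersetCard] at hS
    rw [Finset.mem_coe, Finset.mem_filter]
    refine ⟨Finset.mem_univ _, ?_⟩
    unfold wt
    have : (univ.filter fun i : ι => decide (i ∈ S) = true) = S := by
      ext i
      simp
    rw [this]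
    exact hS.2
  · intro x _
    funext i
    simp
  · intro S _
    ext i
    simp

end Cube

/-! ### The C⁺ of the line `russo-window-ladder` (verbatim) and three variants -/

/-- VERBATIM COPY of `SliceIndist`, the C⁺ ("Transfer") of `Lines/russo-window-ladder.lean`:
slice/product indistinguishability for small bounded-depth circuits on any finite cube, at the
matched density `q = j/N`, for `j ≥ j₀` and `2j ≤ N`. (Recorded here only to make the three
variants below literally comparable; nothing is claimed about it in this file.) [folklore] -/
def SliceIndist : Prop :=
  ∀ (d c : ℕ) (ε : ℝ), 0 < ε → ∃ j₀ : ℕ, ∀ (ι : Type) [Fintype ι] [DecidableEq ι] (j : ℕ),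
    j₀ ≤ j → 2 * j ≤ Fintype.card ι →
      ∀ C : Circuit ι, C.IsOver acBasis → C.acDepth ≤ d → C.size ≤ j ^ c →
        |prodAvg ((j : ℝ) / (Fintype.card ι : ℝ)) C.eval - sliceAvg C.eval j| ≤ ε

/-- Variant A of `SliceIndist` at depth `d` and size exponent `c`: the headroom `2 * j ≤ N`
weakened to `j < N` (slices near the TOP of the cube allowed). FALSE for every `d ≥ 1` and every `c`:
`not_sliceIndistNearTop`. [folklore] -/
def SliceIndistNearTop (d c : ℕ) : Prop :=
  ∀ ε : ℝ, 0 < ε → ∃ j₀ : ℕ, ∀ (ι : Type) [Fintype ι] [DecidableEq ι] (j : ℕ),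
    j₀ ≤ j → j < Fintype.card ι →
      ∀ C : Circuit ι, C.IsOver acBasis → C.acDepth ≤ d → C.size ≤ j ^ c →
        |prodAvg ((j : ℝ) / (Fintype.card ι : ℝ)) C.eval - sliceAvg C.eval j| ≤ ε

/-- Variant B of `SliceIndist` at depth `d`: the size bound `C.size ≤ j ^ c` dropped (all circuits
of `acDepth ≤ d`). FALSE for every `d ≥ 2`: `not_sliceIndistNoSize`. [folklore] -/
def SliceIndistNoSize (d : ℕ) : Prop :=
  ∀ ε : ℝ, 0 < ε → ∃ j₀ : ℕ, ∀ (ι : Type) [Fintype ι] [DecidableEq ι] (j : ℕ),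
    j₀ ≤ j → 2 * j ≤ Fintype.card ι →
      ∀ C : Circuit ι, C.IsOver acBasis → C.acDepth ≤ d →
        |prodAvg ((j : ℝ) / (Fintype.card ι : ℝ)) C.eval - sliceAvg C.eval j| ≤ ε

/-! ### Variant A is false: one `∧`-gate at the slice `j = N − 1` -/

/-- **One unbounded fan-in `∧`-gate reading every input**: size `≤ 1`, `acDepth ≤ 1`, over `acBasis`,
computing `x ↦ [∀ i, x i]`. [folklore] -/
theorem exists_andAll_circuit (ι : Type) [Fintype ι] :
    ∃ C : Circuit ι, C.IsOver acBasis ∧ C.acDepth ≤ 1 ∧ C.size ≤ 1 ∧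
      ∀ x, C.eval x = true ↔ ∀ i, x i = true := by
  have h : ACReal (fun x : ι → Bool => decide (∀ k : ι, (fun (k : ι) (y : ι → Bool) => y k) k x = true))
      (0 + 1) (Fintype.card ι * 0 + 1) :=
    acReal_forall_fintype (f := fun (k : ι) (y : ι → Bool) => y k) fun k => acReal_input k
  obtain ⟨C, hB, hd, hs, he⟩ := h.toCircuit
  refine ⟨C, hB, by simpa using hd, by simpa using hs, fun x => ?_⟩
  rw [he]
  exact decide_eq_true_iff

/-- `(j/(j+1))^{j+1} ≥ 1/6` for `j ≥ 1` (from `1 + 1/j ≤ e^{1/j}` and `e < 3`). [folklore] -/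
theorem sixth_le {j : ℕ} (hj : 1 ≤ j) : (1 : ℝ) / 6 ≤ ((j : ℝ) / (j + 1)) ^ (j + 1) := by
  have hj0 : (0 : ℝ) < j := by exact_mod_cast hj
  have h1 : (1 + 1 / (j : ℝ)) ^ j ≤ 3 := by
    have hexp := Real.add_one_le_exp (1 / (j : ℝ))
    calc (1 + 1 / (j : ℝ)) ^ j ≤ (Real.exp (1 / (j : ℝ))) ^ j := by
          exact pow_le_pow_left₀ (by positivity) (by linarith) j
      _ = Real.exp 1 := by
          rw [← Real.exp_nat_mul]
          congr 1
          field_simp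
      _ ≤ 3 := by
          have := Real.exp_one_lt_d9
          linarith
  have h3 : (1 + 1 / (j : ℝ)) ≤ 2 := by
    have : 1 / (j : ℝ) ≤ 1 := by
      rw [div_le_one hj0]
      exact_mod_cast hj
    linarith
  have h2 : (1 + 1 / (j : ℝ)) ^ (j + 1) ≤ 6 := by
    rw [pow_succ]
    calc (1 + 1 / (j : ℝ)) ^ j * (1 + 1 / (j : ℝ)) ≤ 3 * 2 :=
          mul_le_mul h1 h3 (by positivity) (by norm_num)
      _ = 6 := by norm_num
  have h4 : ((j : ℝ) / (j + 1)) * (1 + 1 / (j : ℝ)) = 1 := by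
    field_simp
  have h5 : ((j : ℝ) / (j + 1)) ^ (j + 1) * (1 + 1 / (j : ℝ)) ^ (j + 1) = 1 := by
    rw [← mul_pow, h4, one_pow]
  have h6 : 0 < (1 + 1 / (j : ℝ)) ^ (j + 1) := by positivity
  rw [eq_one_div_of_mul_eq_one_left h5]
  exact one_div_le_one_div_of_le h6 h2

/-- **Variant A is FALSE.** Witness: `ι = Fin (j+1)`, the slice `j = N − 1`, and the single
`∧`-gate `C = ⋀ᵢ xᵢ` (size `1 ≤ j^c`, `acDepth 1`): `a_j(C) = 0` (no point of weight `N−1` is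
all-ones) while `E_{μ_{j/N}}[C] = (1 − 1/N)^N ≥ 1/6`. So the headroom `2j ≤ N` in `SliceIndist` is
load-bearing; by the ones/zeros symmetry of the cube the true condition is `min(j, N − j) → ∞`
(rate `polylog / √min(j, N−j)`), of which `2j ≤ N` plus `j ≥ j₀` is the half used by the crux
(`j ≈ m_k(n) ≪ C(n,2)`). [folklore] -/
theorem not_sliceIndistNearTop {d : ℕ} (hd1 : 1 ≤ d) (c : ℕ) : ¬ SliceIndistNearTop d c := by
  intro h
  obtain ⟨j₀, hj₀⟩ := h (1 / 10) (by norm_num)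
  set j : ℕ := max j₀ 1 with hj
  have hj1 : 1 ≤ j := le_max_right _ _
  obtain ⟨C, hB, hd, hs, he⟩ := exists_andAll_circuit (Fin (j + 1))
  have hsz : C.size ≤ j ^ c := hs.trans (Nat.one_le_pow c j hj1)
  have key := hj₀ (Fin (j + 1)) j (le_max_left _ _) (by simp) C hB (hd.trans hd1) hsz
  have hslice : sliceAvg C.eval j = 0 := by
    unfold sliceAvg
    rw [Finset.card_eq_zero.2, Nat.cast_zero, zero_div]
    rw [Finset.filter_eq_empty_iff]
    rintro x - ⟨hw, hx⟩
    have hall : ∀ i, x i = true := (he x).1 hx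
    have hx' : x = fun _ => true := funext hall
    rw [hx', wt_const_true, Fintype.card_fin] at hw
    omega
  have hprod : prodAvg ((j : ℝ) / (Fintype.card (Fin (j + 1)) : ℝ)) C.eval =
      ((j : ℝ) / (j + 1)) ^ (j + 1) := by
    unfold prodAvg
    have hfilter : (univ.filter fun x : Fin (j + 1) → Bool => C.eval x = true) = {fun _ => true} := by
      ext x
      simp only [Finset.mem_filter, Finset.mem_univ, true_and, Finset.mem_singleton, he]
      constructor
      · intro hx
        funext i
        exact hx i
      · rintro rfl i
        rfl
    rw [hfilter, Finset.sum_singleton]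
    unfold prodWeight
    rw [wt_const_true, Fintype.card_fin, Nat.sub_self, pow_zero, mul_one]
    push_cast
    ring
  rw [hslice, hprod, sub_zero] at key
  have hlow : (1 : ℝ) / 6 ≤ ((j : ℝ) / (j + 1)) ^ (j + 1) := sixth_le hj1
  rw [abs_of_nonneg (by positivity)] at key
  linarith

/-! ### Variant B is false: the exact-weight indicator `[|x| = j]` (depth 2) at `N = 2j` -/

/-- **The exact-weight indicator as a depth-2 circuit**: `⋁_{|S| = j} ⋀ᵢ [xᵢ = 1_S(i)]`, over
`acBasis`, `acDepth ≤ 2` (negations are free), computing `x ↦ [|x| = j]` (size `C(N,j)·(N+1)+1`,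
irrelevant here). [folklore] -/
theorem exists_exactWeight_circuit (ι : Type) [Fintype ι] [DecidableEq ι] (j : ℕ) :
    ∃ C : Circuit ι, C.IsOver acBasis ∧ C.acDepth ≤ 2 ∧ ∀ x, C.eval x = true ↔ wt x = j := by
  have hin : ∀ S : {S : Finset ι // #S = j},
      ACReal (fun x : ι → Bool => decide (∀ i : ι,
        (fun (i : ι) (y : ι → Bool) => decide (y i = decide (i ∈ S.1))) i x = true))
        (0 + 1) (Fintype.card ι * 1 + 1) :=
    fun S => acReal_forall_fintype fun i => acReal_lit i (decide (i ∈ S.1))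
  have hout := acReal_exists_fintype hin
  obtain ⟨C, hB, hd, -, he⟩ := hout.toCircuit
  refine ⟨C, hB, hd, fun x => ?_⟩
  rw [he, decide_eq_true_iff]
  simp only [decide_eq_true_eq]
  constructor
  · rintro ⟨S, hS⟩
    unfold wt
    have : (univ.filter fun i : ι => x i = true) = S.1 := by
      ext i
      simp only [Finset.mem_filter, Finset.mem_univ, true_and]
      rw [hS i]
      simp
    rw [this]
    exact S.2
  · intro hw
    refine ⟨⟨univ.filter fun i : ι => x i = true, hw⟩, fun i => ?_⟩
    simp

/-- `2·C(2j, j) ≤ 4^j` for `j ≥ 1` (the central binomial coefficient is at most half of the row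
sum; from `Nat.sum_range_choose_halfway` and `Nat.choose_symm_half`). [folklore] -/
theorem two_mul_centralBinom_le {j : ℕ} (hj : 1 ≤ j) : 2 * (2 * j).choose j ≤ 4 ^ j := by
  obtain ⟨m, rfl⟩ : ∃ m, j = m + 1 := ⟨j - 1, by omega⟩
  have hsum := Nat.sum_range_choose_halfway m
  have hle : (2 * m + 1).choose m ≤ 4 ^ m := by
    rw [← hsum]
    exact Finset.single_le_sum (f := fun i => (2 * m + 1).choose i) (fun _ _ => Nat.zero_le _)
      (Finset.mem_range.2 (Nat.lt_succ_self m))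
  have hrec : (2 * (m + 1)).choose (m + 1) = (2 * m + 1).choose m + (2 * m + 1).choose (m + 1) := by
    rw [show 2 * (m + 1) = (2 * m + 1) + 1 by ring, Nat.choose_succ_succ']
  rw [hrec, Nat.choose_symm_half, pow_succ]
  omega

/-- **Variant B is FALSE.** Witness: `ι = Fin (2j)`, the middle slice, and the depth-2 exact-weight
circuit `C = [|x| = j]`: `a_j(C) = 1` while `E_{μ_{1/2}}[C] = C(2j,j)/4^j ≤ 1/2`. So the size bound
in `SliceIndist` is load-bearing (any `polylog(size)/√j` rate is killed by size `≈ C(N,j)`): the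
slice is NOT fooled by depth-2 circuits in general, only by SMALL ones. [folklore] -/
theorem not_sliceIndistNoSize {d : ℕ} (hd2 : 2 ≤ d) : ¬ SliceIndistNoSize d := by
  intro h
  obtain ⟨j₀, hj₀⟩ := h (1 / 4) (by norm_num)
  set j : ℕ := max j₀ 1 with hj
  have hj1 : 1 ≤ j := le_max_right _ _
  obtain ⟨C, hB, hd, he⟩ := exists_exactWeight_circuit (Fin (2 * j)) j
  have key := hj₀ (Fin (2 * j)) j (le_max_left _ _) (by simp) C hB (hd.trans hd2)
  have hcardj : #(univ.filter fun x : Fin (2 * j) → Bool => wt x = j) = (2 * j).choose j := by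
    rw [card_filter_wt_eq, Fintype.card_fin]
  have hfilter : (univ.filter fun x : Fin (2 * j) → Bool => C.eval x = true) =
      univ.filter fun x : Fin (2 * j) → Bool => wt x = j := by
    ext x
    simp [he]
  have hslice : sliceAvg C.eval j = 1 := by
    unfold sliceAvg
    have hnum : (univ.filter fun x : Fin (2 * j) → Bool => wt x = j ∧ C.eval x = true) =
        univ.filter fun x : Fin (2 * j) → Bool => wt x = j := by
      ext x
      simp [he]
    rw [hnum, hcardj]
    have hpos : (0 : ℝ) < ((2 * j).choose j : ℕ) := by exact_mod_cast Nat.choose_pos (by omega)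
    exact div_self hpos.ne'
  have hq : (j : ℝ) / (Fintype.card (Fin (2 * j)) : ℝ) = 1 / 2 := by
    rw [Fintype.card_fin]
    have hj0 : (0 : ℝ) < j := by exact_mod_cast hj1
    push_cast
    field_simp
  have hprod : prodAvg ((j : ℝ) / (Fintype.card (Fin (2 * j)) : ℝ)) C.eval ≤ 1 / 2 := by
    rw [hq]
    unfold prodAvg
    rw [hfilter]
    have hterm : ∀ x ∈ (univ.filter fun x : Fin (2 * j) → Bool => wt x = j),
        prodWeight (1 / 2 : ℝ) x = (1 / 4 : ℝ) ^ j := by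
      intro x hx
      rw [Finset.mem_filter] at hx
      unfold prodWeight
      rw [hx.2, Fintype.card_fin, show 2 * j - j = j by omega, ← mul_pow]
      norm_num
    rw [Finset.sum_congr rfl hterm, Finset.sum_const, hcardj, nsmul_eq_mul]
    have hcb : (2 : ℝ) * ((2 * j).choose j : ℕ) ≤ (4 : ℝ) ^ j := by
      exact_mod_cast two_mul_centralBinom_le hj1
    have h4 : (0 : ℝ) < (4 : ℝ) ^ j := by positivity
    have : (((2 * j).choose j : ℕ) : ℝ) * (1 / 4 : ℝ) ^ j = (((2 * j).choose j : ℕ) : ℝ) / 4 ^ j := by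
      rw [one_div_pow, mul_one_div]
    rw [this, div_le_iff₀ h4]
    linarith
  rw [hslice] at key
  have h2 := (abs_sub_le_iff.1 key).2
  linarith

/-! ### Variant C is false: PARITY (unbounded depth, linear size) is constant on every slice -/

/-- Variant C of `SliceIndist` at size exponent `c`: the depth bound `C.acDepth ≤ d` dropped (all
circuits over `acBasis` with `≤ j^c` gates). FALSE for every `c ≥ 2`: `not_sliceIndistNoDepth`.
[folklore] -/
def SliceIndistNoDepth (c : ℕ) : Prop :=
  ∀ ε : ℝ, 0 < ε → ∃ j₀ : ℕ, ∀ (ι : Type) [Fintype ι] [DecidableEq ι] (j : ℕ),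
    j₀ ≤ j → 2 * j ≤ Fintype.card ι →
      ∀ C : Circuit ι, C.IsOver acBasis → C.size ≤ j ^ c →
        |prodAvg ((j : ℝ) / (Fintype.card ι : ℝ)) C.eval - sliceAvg C.eval j| ≤ ε

/-- The parity of the first `m` coordinates of `x : Fin N → Bool`. [folklore] -/
def prefParity (N m : ℕ) (x : Fin N → Bool) : Bool :=
  decide (Odd #(univ.filter fun i : Fin N => (i : ℕ) < m ∧ x i = true))

/-- No coordinate below `0`: the empty prefix has even parity. [folklore] -/
theorem prefParity_zero (N : ℕ) (x : Fin N → Bool) : prefParity N 0 x = false := by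
  unfold prefParity
  have : (univ.filter fun i : Fin N => (i : ℕ) < 0 ∧ x i = true) = ∅ := by
    ext i
    simp
  rw [this, Finset.card_empty]
  decide

/-- One more coordinate: `parity_{m+1} = parity_m ⊕ x_m`. [folklore] -/
theorem prefParity_succ {N m : ℕ} (hm : m < N) (x : Fin N → Bool) :
    prefParity N (m + 1) x = Bool.xor (prefParity N m x) (x ⟨m, hm⟩) := by
  unfold prefParity
  have hsplit : (univ.filter fun i : Fin N => (i : ℕ) < m + 1 ∧ x i = true) =
      (univ.filter fun i : Fin N => (i : ℕ) < m ∧ x i = true) ∪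
        (univ.filter fun i : Fin N => i = ⟨m, hm⟩ ∧ x i = true) := by
    ext i
    simp only [Finset.mem_union, Finset.mem_filter, Finset.mem_univ, true_and, Fin.ext_iff]
    constructor
    · rintro ⟨hi, hx⟩
      rcases Nat.lt_succ_iff_lt_or_eq.1 hi with h | h
      · exact Or.inl ⟨h, hx⟩
      · exact Or.inr ⟨h, hx⟩
    · rintro (⟨h, hx⟩ | ⟨h, hx⟩)
      · exact ⟨Nat.lt_succ_of_lt h, hx⟩
      · exact ⟨by simp [h], hx⟩
  have hdisj : Disjoint (univ.filter fun i : Fin N => (i : ℕ) < m ∧ x i = true)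
      (univ.filter fun i : Fin N => i = ⟨m, hm⟩ ∧ x i = true) := by
    rw [Finset.disjoint_filter]
    rintro i - ⟨hi, -⟩ ⟨rfl, -⟩
    exact lt_irrefl _ hi
  rw [hsplit, Finset.card_union_of_disjoint hdisj]
  cases hxm : x ⟨m, hm⟩
  · have : (univ.filter fun i : Fin N => i = ⟨m, hm⟩ ∧ x i = true) = ∅ := by
      ext i
      simp only [Finset.mem_filter, Finset.mem_univ, true_and, Finset.notMem_empty, iff_false,
        not_and]
      rintro rfl
      simp [hxm]
    rw [this, Finset.card_empty, Nat.add_zero, Bool.xor_false]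
  · have : (univ.filter fun i : Fin N => i = ⟨m, hm⟩ ∧ x i = true) = {⟨m, hm⟩} := by
      ext i
      simp only [Finset.mem_filter, Finset.mem_univ, true_and, Finset.mem_singleton]
      constructor
      · exact fun h => h.1
      · rintro rfl
        exact ⟨rfl, hxm⟩
    rw [this, Finset.card_singleton, Bool.xor_true]
    by_cases hodd : Odd #(univ.filter fun i : Fin N => (i : ℕ) < m ∧ x i = true)
    · have : ¬ Odd (#(univ.filter fun i : Fin N => (i : ℕ) < m ∧ x i = true) + 1) :=
        fun h' => (Nat.odd_add_one.1 h') hodd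
      simp [hodd, this]
    · have : Odd (#(univ.filter fun i : Fin N => (i : ℕ) < m ∧ x i = true) + 1) :=
        Nat.odd_add_one.2 hodd
      simp [hodd, this]

/-- The full prefix is the parity of the weight. [folklore] -/
theorem prefParity_self (N : ℕ) (x : Fin N → Bool) : prefParity N N x = decide (Odd (wt x)) := by
  unfold prefParity wt
  have : (univ.filter fun i : Fin N => (i : ℕ) < N ∧ x i = true) =
      univ.filter fun i : Fin N => x i = true := by
    ext i
    simp
  rw [this]

/-- XOR of two wires as a depth-2, 5-gate `{∧,∨,¬}`-circuit: `(a ∧ ¬b) ∨ (¬a ∧ b)`. [folklore] -/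
theorem acReal_xor2 :
    ACReal (fun v : Fin 2 → Bool => Bool.xor (v 0) (v 1)) 2 5 := by
  have ha : ACReal (fun v : Fin 2 → Bool => v 0 && !v 1) (0 + 1) (0 + 1 + 1) :=
    acReal_and (acReal_input 0) (acReal_notInput 1)
  have hb : ACReal (fun v : Fin 2 → Bool => !v 0 && v 1) (0 + 1) (1 + 0 + 1) :=
    acReal_and (acReal_notInput 0) (acReal_input 1)
  have h := acReal_or ha hb
  refine (h.congr fun v => ?_).mono (by norm_num) (by norm_num)
  cases v 0 <;> cases v 1 <;> rfl

/-- **Parity has linear-size `{∧,∨,¬}`-circuits** (a chain of XORs; depth `2m+1`, `5m+1` gates for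
the first `m` coordinates). [folklore] -/
theorem acReal_prefParity (N : ℕ) : ∀ m, m ≤ N → ACReal (prefParity N m) (2 * m + 1) (5 * m + 1) := by
  intro m
  induction m with
  | zero =>
    intro _
    exact ((acReal_const false).congr fun x => (prefParity_zero N x).symm).mono (by norm_num)
      (by norm_num)
  | succ m ih =>
    intro hm1
    have hm : m < N := hm1
    have hP : ACRealOver acBasis (prefParity N m) (2 * m + 1) (5 * m + 1) :=
      (ih hm.le).toOver subset_rfl
    have hL : ACRealOver acBasis (fun x : Fin N → Bool => x ⟨m, hm⟩) (2 * m + 1) 0 :=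
      ((acReal_input (ι := Fin N) ⟨m, hm⟩).mono (Nat.zero_le _) le_rfl).toOver subset_rfl
    have hF : ACRealOver acBasis (fun v : Fin 2 → Bool => Bool.xor (v 0) (v 1)) 2 5 :=
      acReal_xor2.toOver subset_rfl
    have hcomp := ACRealOver.comp hF
      (f := ![prefParity N m, fun x : Fin N → Bool => x ⟨m, hm⟩])
      (d := 2 * m + 1) (s := ![5 * m + 1, 0])
      (fun j => by
        fin_cases j
        · simpa using hP
        · simpa using hL)
    have hcomp' := (acRealOver_acBasis_iff _ _ _).1 hcomp
    refine (hcomp'.congr fun x => ?_).mono (by omega) ?_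
    · simp only [Matrix.cons_val_zero, Matrix.cons_val_one]
      rw [prefParity_succ hm]
    · simp [Fin.sum_univ_two]
      omega

/-- **A parity circuit**: over `acBasis`, `≤ 5N+1` gates (depth unbounded), accepting exactly the
points of odd weight. [folklore] -/
theorem exists_parity_circuit (N : ℕ) :
    ∃ C : Circuit (Fin N), C.IsOver acBasis ∧ C.size ≤ 5 * N + 1 ∧
      ∀ x, C.eval x = true ↔ Odd (wt x) := by
  obtain ⟨C, hB, -, hs, he⟩ := (acReal_prefParity N N le_rfl).toCircuit
  refine ⟨C, hB, hs, fun x => ?_⟩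
  rw [he, prefParity_self, decide_eq_true_iff]

/-- Flipping one coordinate changes the weight by one, hence flips its parity. [folklore] -/
theorem odd_wt_update_not_iff {N : ℕ} (x : Fin N → Bool) (i : Fin N) :
    Odd (wt (Function.update x i (!x i))) ↔ ¬ Odd (wt x) := by
  unfold wt
  cases hxi : x i
  · -- switching `i` on inserts it
    have : (univ.filter fun k : Fin N => Function.update x i (!false) k = true) =
        insert i (univ.filter fun k : Fin N => x k = true) := by
      ext k
      by_cases hk : k = i
      · subst hk
        simp
      · simp [hk]
    rw [this, Finset.card_insert_of_notMem (by simp [hxi]), Nat.odd_add_one]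
  · -- switching `i` off erases it
    have : (univ.filter fun k : Fin N => Function.update x i (!true) k = true) =
        (univ.filter fun k : Fin N => x k = true).erase i := by
      ext k
      by_cases hk : k = i
      · subst hk
        simp
      · simp [hk]
    have hmem : i ∈ (univ.filter fun k : Fin N => x k = true) := by simp [hxi]
    rw [this]
    have hcard := Finset.card_erase_add_one hmem
    rw [← hcard, Nat.odd_add_one, not_not]

/-- Exactly half of the cube has odd weight (`N ≥ 1`). [folklore] -/
theorem two_mul_card_filter_odd_wt {N : ℕ} (hN : 1 ≤ N) :
    2 * #(univ.filter fun x : Fin N → Bool => Odd (wt x)) = 2 ^ N := by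
  set A := univ.filter fun x : Fin N → Bool => Odd (wt x) with hA
  set B := univ.filter fun x : Fin N → Bool => ¬ Odd (wt x) with hB
  have hAB : #A + #B = 2 ^ N := by
    rw [hA, hB, Finset.card_filter_add_card_filter_not, Finset.card_univ, Fintype.card_fun,
      Fintype.card_bool, Fintype.card_fin]
  let i₀ : Fin N := ⟨0, hN⟩
  let φ : (Fin N → Bool) → (Fin N → Bool) := fun x => Function.update x i₀ (!x i₀)
  have hφφ : ∀ x, φ (φ x) = x := by
    intro x
    simp only [φ, Function.update_self, Bool.not_not, Function.update_idem, Function.update_eq_self]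
  have hAeqB : #A = #B := by
    refine Finset.card_nbij' φ φ ?_ ?_ (fun x _ => hφφ x) (fun x _ => hφφ x)
    · intro x hx
      rw [Finset.mem_coe, hA, Finset.mem_filter] at hx
      rw [Finset.mem_coe, hB, Finset.mem_filter]
      exact ⟨Finset.mem_univ _, fun h => (odd_wt_update_not_iff x i₀).1 h hx.2⟩
    · intro x hx
      rw [Finset.mem_coe, hB, Finset.mem_filter] at hx
      rw [Finset.mem_coe, hA, Finset.mem_filter]
      refine ⟨Finset.mem_univ _, ?_⟩
      by_contra h
      exact hx.2 (by simpa using (odd_wt_update_not_iff x i₀).not.1 h)  -- ¬Odd (wt (φ x)) → Odd (wt x)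
  omega

/-- **Variant C is FALSE.** Witness: `ι = Fin (2j)` with `j` even, the middle slice, and the parity
circuit (`≤ 10j+1 ≤ j²` gates, depth `≈ 4j`): parity vanishes identically on the slice (`a_j = 0`)
but `E_{μ_{1/2}}[parity] = 1/2`. So the depth bound in `SliceIndist` is load-bearing: it is exactly
what Boppana's influence bound consumes (parity has total influence `N`, not `polylog(size)`).
[folklore] -/
theorem not_sliceIndistNoDepth {c : ℕ} (hc2 : 2 ≤ c) : ¬ SliceIndistNoDepth c := by
  intro h
  obtain ⟨j₀, hj₀⟩ := h (1 / 4) (by norm_num)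
  set j : ℕ := 2 * max j₀ 6 with hj
  have hj12 : 12 ≤ j := by omega
  have hjeven : Even j := ⟨max j₀ 6, by omega⟩
  obtain ⟨C, hB, hs, he⟩ := exists_parity_circuit (2 * j)
  have hsize : C.size ≤ j ^ c := by
    refine hs.trans (le_trans ?_ (Nat.pow_le_pow_right (by omega) hc2))
    rw [pow_two]
    have := Nat.mul_le_mul_right j hj12
    omega
  have key := hj₀ (Fin (2 * j)) j (by omega) (by simp) C hB hsize
  have hslice : sliceAvg C.eval j = 0 := by
    unfold sliceAvg
    rw [Finset.card_eq_zero.2, Nat.cast_zero, zero_div]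
    rw [Finset.filter_eq_empty_iff]
    rintro x - ⟨hw, hx⟩
    have hodd : Odd (wt x) := (he x).1 hx
    rw [hw] at hodd
    exact (Nat.not_even_iff_odd.2 hodd) hjeven
  have hq : (j : ℝ) / (Fintype.card (Fin (2 * j)) : ℝ) = 1 / 2 := by
    rw [Fintype.card_fin]
    have hj0 : (0 : ℝ) < j := by exact_mod_cast (show 0 < j by omega)
    push_cast
    field_simp
  have hprod : prodAvg ((j : ℝ) / (Fintype.card (Fin (2 * j)) : ℝ)) C.eval = 1 / 2 := by
    rw [hq]
    unfold prodAvg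
    have hfilter : (univ.filter fun x : Fin (2 * j) → Bool => C.eval x = true) =
        univ.filter fun x : Fin (2 * j) → Bool => Odd (wt x) := by
      ext x
      simp [he]
    have hterm : ∀ x ∈ (univ.filter fun x : Fin (2 * j) → Bool => Odd (wt x)),
        prodWeight (1 / 2 : ℝ) x = (1 / 2 : ℝ) ^ (2 * j) := by
      intro x _
      unfold prodWeight
      rw [show (1 : ℝ) - 1 / 2 = 1 / 2 by norm_num, ← pow_add, Fintype.card_fin,
        Nat.add_sub_cancel' ((wt_le_card x).trans (by rw [Fintype.card_fin]))]
    rw [hfilter, Finset.sum_congr rfl hterm, Finset.sum_const, nsmul_eq_mul]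
    have hcount := two_mul_card_filter_odd_wt (N := 2 * j) (by omega)
    have hcount' : (2 : ℝ) * (#(univ.filter fun x : Fin (2 * j) → Bool => Odd (wt x)) : ℝ) =
        (2 : ℝ) ^ (2 * j) := by
      exact_mod_cast hcount
    have h2 : (0 : ℝ) < (2 : ℝ) ^ (2 * j) := by positivity
    rw [one_div_pow, one_div, ← div_eq_mul_inv, div_eq_iff h2.ne', one_div,
      inv_mul_eq_div, eq_div_iff (by norm_num : (2 : ℝ) ≠ 0)]
    linarith
  rw [hslice, hprod, sub_zero] at key
  norm_num [abs_of_pos] at key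


/-! ## Part VIII — the window of `Conc` cannot reach the supercritical slices (upper edge `m · n^{θ}`)

VIII-A: slice densities of a down-set vs the biased measure (generic cube, Mathlib's local LYM + Markov);
VIII-B: `Pr_{G(n,q)}[no k-clique] ≤ (1 − q^{C(k,2)})^{⌊n/k⌋}` (disjoint blocks, planting identity);
VIII-C: assembly (`not_innerConcHighWindow`, `not_innerConcHighWindow_of_le`, `not_concHighWindow`).
Filed as `Theorems/SliceACZero/Negative/{SliceDensity, DisjointCliques, WindowHigh}.lean`. -/



section Density

variable {α : Type*} [DecidableEq α] [Fintype α]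

/-- **Slice densities of a down-set are non-increasing** (one step): local LYM for `𝒟 # (r+1)`,
whose shadow lies in `𝒟 # r`. [folklore] -/
theorem card_slice_succ_div_choose_le (𝒟 : Finset (Finset α))
    (h𝒟 : IsLowerSet (𝒟 : Set (Finset α))) (r : ℕ) :
    (#(𝒟 # (r + 1)) : ℝ) / (Fintype.card α).choose (r + 1) ≤
      (#(𝒟 # r) : ℝ) / (Fintype.card α).choose r := by
  have hsz : ((𝒟 # (r + 1) : Finset (Finset α)) : Set (Finset α)).Sized (r + 1) := sized_slice
  have hlym : (#(𝒟 # (r + 1)) : ℝ) / (Fintype.card α).choose (r + 1) ≤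
      (#(∂ (𝒟 # (r + 1))) : ℝ) / (Fintype.card α).choose r := by
    have := Finset.local_lubell_yamamoto_meshalkin_inequality_div (𝕜 := ℝ)
      (Nat.succ_ne_zero r) hsz
    simpa using this
  refine hlym.trans (div_le_div_of_nonneg_right ?_ (Nat.cast_nonneg _))
  have hsub : ∂ (𝒟 # (r + 1)) ⊆ 𝒟 # r := by
    intro t ht
    rw [mem_shadow_iff] at ht
    obtain ⟨s, hs, a, ha, rfl⟩ := ht
    rw [mem_slice] at hs ⊢
    refine ⟨h𝒟 (erase_subset a s) hs.1, ?_⟩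
    rw [card_erase_of_mem ha, hs.2, Nat.add_sub_cancel]
  exact_mod_cast card_le_card hsub

/-- **Slice densities of a down-set are non-increasing.** [folklore] -/
theorem card_slice_div_choose_antitone (𝒟 : Finset (Finset α))
    (h𝒟 : IsLowerSet (𝒟 : Set (Finset α))) {ℓ j : ℕ} (h : ℓ ≤ j) :
    (#(𝒟 # j) : ℝ) / (Fintype.card α).choose j ≤ (#(𝒟 # ℓ) : ℝ) / (Fintype.card α).choose ℓ := by
  induction j, h using Nat.le_induction with
  | base => exact le_rfl
  | succ j _ ih => exact (card_slice_succ_div_choose_le 𝒟 h𝒟 j).trans ih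

end Density

section Binomial

/-- Total binomial mass: `Σ_{r ≤ N} C(N,r) q^r (1−q)^{N−r} = 1`. [folklore] -/
theorem sum_range_choose_mul_pow_mul_pow (N : ℕ) (q : ℝ) :
    ∑ r ∈ range (N + 1), (N.choose r : ℝ) * q ^ r * (1 - q) ^ (N - r) = 1 := by
  calc ∑ r ∈ range (N + 1), (N.choose r : ℝ) * q ^ r * (1 - q) ^ (N - r)
      = ∑ m ∈ range (N + 1), q ^ m * (1 - q) ^ (N - m) * (N.choose m : ℝ) :=
        Finset.sum_congr rfl fun r _ => by ring
    _ = (q + (1 - q)) ^ N := (add_pow q (1 - q) N).symm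
    _ = 1 := by norm_num

/-- Binomial mean as a finite sum: `Σ_{r ≤ N} r · C(N,r) q^r (1−q)^{N−r} = N q`. [folklore] -/
theorem sum_range_mul_choose_mul_pow (N : ℕ) (q : ℝ) :
    ∑ r ∈ range (N + 1), (r : ℝ) * ((N.choose r : ℝ) * q ^ r * (1 - q) ^ (N - r)) = N * q := by
  cases N with
  | zero => simp
  | succ M =>
    rw [Finset.sum_range_succ', Nat.cast_zero, zero_mul, add_zero]
    have hterm : ∀ s ∈ range (M + 1),
        ((s + 1 : ℕ) : ℝ) * (((M + 1).choose (s + 1) : ℝ) * q ^ (s + 1) * (1 - q) ^ (M + 1 - (s + 1))) =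
          ((M + 1 : ℕ) : ℝ) * q * ((M.choose s : ℝ) * q ^ s * (1 - q) ^ (M - s)) := by
      intro s _
      have hc : ((M + 1 : ℕ) : ℝ) * (M.choose s : ℝ) = ((M + 1).choose (s + 1) : ℝ) * ((s + 1 : ℕ) : ℝ) := by
        exact_mod_cast Nat.add_one_mul_choose_eq M s
      rw [show M + 1 - (s + 1) = M - s by omega, pow_succ]
      have : ((s + 1 : ℕ) : ℝ) * ((M + 1).choose (s + 1) : ℝ) = ((M + 1 : ℕ) : ℝ) * (M.choose s : ℝ) := by
        rw [hc]; ring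
      calc ((s + 1 : ℕ) : ℝ) * (((M + 1).choose (s + 1) : ℝ) * (q ^ s * q) * (1 - q) ^ (M - s))
          = (((s + 1 : ℕ) : ℝ) * ((M + 1).choose (s + 1) : ℝ)) * (q ^ s * q) * (1 - q) ^ (M - s) := by
            ring
        _ = (((M + 1 : ℕ) : ℝ) * (M.choose s : ℝ)) * (q ^ s * q) * (1 - q) ^ (M - s) := by rw [this]
        _ = _ := by ring
    rw [Finset.sum_congr rfl hterm, ← Finset.mul_sum, sum_range_choose_mul_pow_mul_pow, mul_one]

/-- **Markov for the binomial upper tail**: `P[Bin(N,q) ≥ j+1] ≤ N q/(j+1)` (`0 ≤ q ≤ 1`), the tail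
written as the finite sum over `Ico (j+1) (N+1)`. [folklore] -/
theorem binomial_upper_tail_le (N j : ℕ) {q : ℝ} (hq0 : 0 ≤ q) (hq1 : q ≤ 1) :
    ∑ r ∈ Ico (j + 1) (N + 1), (N.choose r : ℝ) * q ^ r * (1 - q) ^ (N - r) ≤
      N * q / ((j : ℝ) + 1) := by
  have hB : ∀ r, 0 ≤ (N.choose r : ℝ) * q ^ r * (1 - q) ^ (N - r) := fun r =>
    mul_nonneg (mul_nonneg (Nat.cast_nonneg _) (pow_nonneg hq0 _)) (pow_nonneg (by linarith) _)
  have hj1 : (0 : ℝ) < (j : ℝ) + 1 := by positivity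
  rw [le_div_iff₀ hj1]
  calc (∑ r ∈ Ico (j + 1) (N + 1), (N.choose r : ℝ) * q ^ r * (1 - q) ^ (N - r)) * ((j : ℝ) + 1)
      = ∑ r ∈ Ico (j + 1) (N + 1), ((j : ℝ) + 1) * ((N.choose r : ℝ) * q ^ r * (1 - q) ^ (N - r)) := by
        rw [Finset.sum_mul]
        exact Finset.sum_congr rfl fun r _ => by ring
    _ ≤ ∑ r ∈ Ico (j + 1) (N + 1), (r : ℝ) * ((N.choose r : ℝ) * q ^ r * (1 - q) ^ (N - r)) := by
        refine Finset.sum_le_sum fun r hr => ?_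
        rw [Finset.mem_Ico] at hr
        have : (j : ℝ) + 1 ≤ r := by exact_mod_cast hr.1
        exact mul_le_mul_of_nonneg_right this (hB r)
    _ ≤ ∑ r ∈ range (N + 1), (r : ℝ) * ((N.choose r : ℝ) * q ^ r * (1 - q) ^ (N - r)) := by
        refine Finset.sum_le_sum_of_subset_of_nonneg ?_ fun r _ _ => mul_nonneg (Nat.cast_nonneg _) (hB r)
        intro r hr
        rw [Finset.mem_Ico] at hr
        exact Finset.mem_range.2 hr.2
    _ = N * q := sum_range_mul_choose_mul_pow N q

end Binomial

section Mixture

variable {α : Type*} [DecidableEq α] [Fintype α]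

omit [DecidableEq α] in
/-- **The biased measure of a family is the binomial mixture of its slice counts**:
`μ_q(𝒟) = Σ_{r ≤ N} #(𝒟 # r) · q^r (1−q)^{N−r}`. [folklore] -/
theorem sum_biasedWeight_eq_sum_card_slice (𝒟 : Finset (Finset α)) (q : ℝ) :
    ∑ W ∈ 𝒟, biasedWeight q W =
      ∑ r ∈ range (Fintype.card α + 1),
        (#(𝒟 # r) : ℝ) * (q ^ r * (1 - q) ^ (Fintype.card α - r)) := by
  have hmaps : ∀ W ∈ 𝒟, #W ∈ range (Fintype.card α + 1) := fun W _ =>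
    Finset.mem_range.2 (Nat.lt_succ_of_le (Finset.card_le_univ W))
  rw [← Finset.sum_fiberwise_of_maps_to hmaps]
  refine Finset.sum_congr rfl fun r _ => ?_
  have hset : (𝒟.filter fun W => #W = r) = 𝒟 # r := rfl
  rw [hset]
  have hconst : ∀ W ∈ 𝒟 # r, biasedWeight q W = q ^ r * (1 - q) ^ (Fintype.card α - r) := by
    intro W hW
    rw [mem_slice] at hW
    rw [biasedWeight, hW.2]
  rw [Finset.sum_congr rfl hconst, Finset.sum_const, nsmul_eq_mul]

/-- **Slice density of a down-set ≤ twice its biased measure at half the matched density.**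
For a down-set `𝒟 ⊆ 2^α` and `1 ≤ j ≤ N = |α|`:
`#(𝒟 # j)/C(N,j) ≤ 2 · μ_{j/(2N)}(𝒟)`. Proof: `μ_q(𝒟) = Σ_r d_r C(N,r) q^r(1−q)^{N−r}
≥ d_j · P[Bin(N,q) ≤ j] ≥ d_j · (1 − Nq/(j+1)) ≥ d_j/2` (densities antitone; Markov with
`Nq = j/2`). [folklore] -/
theorem card_slice_div_choose_le_two_mul_sum_biasedWeight (𝒟 : Finset (Finset α))
    (h𝒟 : IsLowerSet (𝒟 : Set (Finset α))) {j : ℕ} (hj : 1 ≤ j) (hjN : j ≤ Fintype.card α) :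
    (#(𝒟 # j) : ℝ) / (Fintype.card α).choose j ≤
      2 * ∑ W ∈ 𝒟, biasedWeight ((j : ℝ) / (2 * Fintype.card α)) W := by
  set N := Fintype.card α with hNdef
  set q : ℝ := (j : ℝ) / (2 * N) with hqdef
  have hN0 : (0 : ℝ) < N := by exact_mod_cast (show 0 < N by omega)
  have hq0 : 0 ≤ q := by positivity
  have hq1 : q ≤ 1 := by
    rw [hqdef, div_le_one (by positivity)]
    have : (j : ℝ) ≤ N := by exact_mod_cast hjN
    linarith
  have hNq : (N : ℝ) * q = j / 2 := by
    rw [hqdef]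
    field_simp
  set B : ℕ → ℝ := fun r => (N.choose r : ℝ) * q ^ r * (1 - q) ^ (N - r) with hBdef
  have hB0 : ∀ r, 0 ≤ B r := fun r =>
    mul_nonneg (mul_nonneg (Nat.cast_nonneg _) (pow_nonneg hq0 _)) (pow_nonneg (by linarith) _)
  set d : ℕ → ℝ := fun r => (#(𝒟 # r) : ℝ) / (N.choose r : ℝ) with hddef
  have hd0 : ∀ r, 0 ≤ d r := fun r => div_nonneg (Nat.cast_nonneg _) (Nat.cast_nonneg _)
  -- the mixture, rewritten with densities
  have hmix : ∑ W ∈ 𝒟, biasedWeight q W = ∑ r ∈ range (N + 1), d r * B r := by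
    rw [sum_biasedWeight_eq_sum_card_slice]
    refine Finset.sum_congr rfl fun r hr => ?_
    have hrN : r ≤ N := Nat.lt_succ_iff.1 (Finset.mem_range.1 hr)
    have hc : (N.choose r : ℝ) ≠ 0 := by exact_mod_cast (Nat.choose_pos hrN).ne'
    simp only [hddef, hBdef, ← hNdef]
    rw [div_mul_eq_mul_div, eq_div_iff hc]
    ring
  -- lower levels carry density ≥ d j
  have hlow : d j * ∑ r ∈ range (j + 1), B r ≤ ∑ r ∈ range (j + 1), d r * B r := by
    rw [Finset.mul_sum]
    refine Finset.sum_le_sum fun r hr => ?_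
    have hrj : r ≤ j := Nat.lt_succ_iff.1 (Finset.mem_range.1 hr)
    exact mul_le_mul_of_nonneg_right (card_slice_div_choose_antitone 𝒟 h𝒟 hrj) (hB0 r)
  have hsub : ∑ r ∈ range (j + 1), d r * B r ≤ ∑ r ∈ range (N + 1), d r * B r :=
    Finset.sum_le_sum_of_subset_of_nonneg
      (Finset.range_subset_range.2 (Nat.succ_le_succ hjN)) fun r _ _ => mul_nonneg (hd0 r) (hB0 r)
  -- mass of the lower levels ≥ 1/2
  have hsplit : ∑ r ∈ range (j + 1), B r + ∑ r ∈ Ico (j + 1) (N + 1), B r = 1 := by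
    rw [Finset.sum_range_add_sum_Ico _ (Nat.succ_le_succ hjN)]
    exact sum_range_choose_mul_pow_mul_pow N q
  have htail : ∑ r ∈ Ico (j + 1) (N + 1), B r ≤ 1 / 2 := by
    refine (binomial_upper_tail_le N j hq0 hq1).trans ?_
    rw [hNq, div_le_iff₀ (by positivity : (0 : ℝ) < (j : ℝ) + 1)]
    have : (0 : ℝ) ≤ j := Nat.cast_nonneg _
    linarith
  have hmass : 1 / 2 ≤ ∑ r ∈ range (j + 1), B r := by linarith
  -- assemble
  have hdj : d j * (1 / 2) ≤ ∑ W ∈ 𝒟, biasedWeight q W := by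
    calc d j * (1 / 2) ≤ d j * ∑ r ∈ range (j + 1), B r :=
          mul_le_mul_of_nonneg_left hmass (hd0 j)
      _ ≤ ∑ r ∈ range (j + 1), d r * B r := hlow
      _ ≤ ∑ r ∈ range (N + 1), d r * B r := hsub
      _ = ∑ W ∈ 𝒟, biasedWeight q W := hmix.symm
  have : d j ≤ 2 * ∑ W ∈ 𝒟, biasedWeight q W := by linarith
  simpa [hddef] using this

end Mixture




variable {n : ℕ}

/-- Planting a vector with support disjoint from `K_A` does not change whether `K_A` is full. [folklore] -/
theorem forall_cliqueVec_sup_iff {A B : Finset (Fin n)}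
    (hdisj : ∀ e, cliqueVec A e = true → cliqueVec B e = false)
    (x : (⊤ : SimpleGraph (Fin n)).edgeSet → Bool) :
    (∀ e, cliqueVec A e = true → (x ⊔ cliqueVec B) e = true) ↔
      (∀ e, cliqueVec A e = true → x e = true) := by
  constructor
  · intro h e he
    have := h e he
    rw [sup_apply_bool, hdisj e he, Bool.or_false] at this
    exact this
  · intro h e he
    rw [sup_apply_bool, h e he, Bool.true_or]

open Classical in
/-- **Independence of disjoint cliques**: if the clique vectors of `A 0, …, A (T-1)` have pairwise
disjoint supports then `Pr_{G(n,q)}[∀ i < T, K_{A i} ⊈ G] = ∏_{i<T} (1 − q^{e(K_{A i})})`.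
Induction on `T`: `Pr[none of T+1] = Pr[none of T] − Pr[none of T ∧ K_{A T} ⊆ G]`, and by the
planting identity the last term is `q^{e(K_{A T})} · Pr[none of T]` (planting `K_{A T}` does not
touch the other blocks). Valid for every real `q`. [folklore] -/
theorem sum_filter_noneFull_gnpWeight (q : ℝ) (A : ℕ → Finset (Fin n))
    (hdisj : ∀ i j, i ≠ j → ∀ e, cliqueVec (A i) e = true → cliqueVec (A j) e = false) :
    ∀ T : ℕ, ∑ x ∈ univ.filter (fun x : (⊤ : SimpleGraph (Fin n)).edgeSet → Bool =>
        ∀ i < T, ¬ ∀ e, cliqueVec (A i) e = true → x e = true), gnpWeight n q x =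
      ∏ i ∈ range T, (1 - q ^ edgeCount (cliqueVec (A i))) := by
  intro T
  induction T with
  | zero =>
    rw [Finset.prod_range_zero, Finset.filter_true_of_mem]
    · exact sum_gnpWeight q
    · intro x _ i hi
      exact absurd hi (Nat.not_lt_zero i)
  | succ T ih =>
    -- abbreviations
    set P : ((⊤ : SimpleGraph (Fin n)).edgeSet → Bool) → Prop := fun x =>
      ∀ i < T, ¬ ∀ e, cliqueVec (A i) e = true → x e = true with hP
    set F : ((⊤ : SimpleGraph (Fin n)).edgeSet → Bool) → Prop := fun x =>
      ∀ e, cliqueVec (A T) e = true → x e = true with hF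
    have hP1 : ∀ x : (⊤ : SimpleGraph (Fin n)).edgeSet → Bool,
        (∀ i < T + 1, ¬ ∀ e, cliqueVec (A i) e = true → x e = true) ↔ (P x ∧ ¬ F x) := by
      intro x
      constructor
      · intro h
        exact ⟨fun i hi => h i (Nat.lt_succ_of_lt hi), h T (Nat.lt_succ_self T)⟩
      · rintro ⟨h1, h2⟩ i hi
        rcases Nat.lt_succ_iff_lt_or_eq.1 hi with hi' | rfl
        · exact h1 i hi'
        · exact h2
    have hfilt : (univ.filter fun x : (⊤ : SimpleGraph (Fin n)).edgeSet → Bool =>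
        ∀ i < T + 1, ¬ ∀ e, cliqueVec (A i) e = true → x e = true) =
        univ.filter fun x => P x ∧ ¬ F x := by
      ext x
      simp only [Finset.mem_filter, Finset.mem_univ, true_and]
      exact hP1 x
    -- split the event `none of T+1` as `none of T` minus `none of T and block T full`
    have hsplit : ∑ x ∈ univ.filter (fun x => P x ∧ ¬ F x), gnpWeight n q x =
        ∑ x ∈ univ.filter (fun x => P x), gnpWeight n q x -
          ∑ x ∈ univ.filter (fun x => P x ∧ F x), gnpWeight n q x := by
      have hunion : (univ.filter fun x : (⊤ : SimpleGraph (Fin n)).edgeSet → Bool => P x) =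
          (univ.filter fun x => P x ∧ ¬ F x) ∪ (univ.filter fun x => P x ∧ F x) := by
        ext x
        simp only [Finset.mem_union, Finset.mem_filter, Finset.mem_univ, true_and]
        tauto
      have hdis : Disjoint (univ.filter fun x : (⊤ : SimpleGraph (Fin n)).edgeSet → Bool => P x ∧ ¬ F x)
          (univ.filter fun x => P x ∧ F x) := by
        rw [Finset.disjoint_filter]
        rintro x - ⟨-, h⟩ ⟨-, h'⟩
        exact h h'
      rw [hunion, Finset.sum_union hdis]
      ring
    -- the subtracted term, by planting
    have hplant : ∑ x ∈ univ.filter (fun x => P x ∧ F x), gnpWeight n q x =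
        q ^ edgeCount (cliqueVec (A T)) * ∑ x ∈ univ.filter (fun x => P x), gnpWeight n q x := by
      have h := sum_filter_forall_gnpWeight_mul q (cliqueVec (A T)) (fun x => if P x then (1 : ℝ) else 0)
      -- left side of `h` is our subtracted term
      have hL : ∑ x ∈ univ.filter (fun x : (⊤ : SimpleGraph (Fin n)).edgeSet → Bool =>
            ∀ e, cliqueVec (A T) e = true → x e = true),
            gnpWeight n q x * (if P x then (1 : ℝ) else 0) =
          ∑ x ∈ univ.filter (fun x => P x ∧ F x), gnpWeight n q x := by
        rw [Finset.sum_filter, Finset.sum_filter]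
        refine Finset.sum_congr rfl fun x _ => ?_
        change (if F x then gnpWeight n q x * (if P x then (1 : ℝ) else 0) else 0) = _
        by_cases h1 : F x <;> by_cases h2 : P x <;> simp [h1, h2]
      -- right side: planting block `T` does not change `P`
      have hR : ∑ x, gnpWeight n q x * (if P (x ⊔ cliqueVec (A T)) then (1 : ℝ) else 0) =
          ∑ x ∈ univ.filter (fun x => P x), gnpWeight n q x := by
        rw [Finset.sum_filter]
        refine Finset.sum_congr rfl fun x _ => ?_
        have hiff : P (x ⊔ cliqueVec (A T)) ↔ P x := by
          refine forall₂_congr fun i hi => ?_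
          rw [forall_cliqueVec_sup_iff (fun e he => hdisj i T (Nat.ne_of_lt hi) e he)]
        by_cases h2 : P x
        · rw [if_pos (hiff.2 h2), if_pos h2, mul_one]
        · rw [if_neg (fun h' => h2 (hiff.1 h')), if_neg h2, mul_zero]
      rw [← hL, h, hR]
    rw [hfilt, hsplit, hplant, ih, Finset.prod_range_succ]
    ring

/-! ### Consecutive vertex blocks of size `k` -/

/-- The `i`-th block of `k` consecutive vertices `{ik, …, ik + k − 1}` (as a subset of `Fin n`).
[folklore] -/
def block (n k i : ℕ) : Finset (Fin n) := univ.filter fun v => i * k ≤ v.val ∧ v.val < i * k + k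

/-- A block inside `[0, n)` has exactly `k` vertices. [folklore] -/
theorem card_block {k i : ℕ} (h : i * k + k ≤ n) : #(block n k i) = k := by
  have himage : (block n k i).image Fin.val = Finset.Ico (i * k) (i * k + k) := by
    ext m
    simp only [block, Finset.mem_image, Finset.mem_filter, Finset.mem_univ, true_and, Finset.mem_Ico]
    constructor
    · rintro ⟨v, ⟨h1, h2⟩, rfl⟩
      exact ⟨h1, h2⟩
    · rintro ⟨h1, h2⟩
      exact ⟨⟨m, by omega⟩, ⟨h1, h2⟩, rfl⟩
  rw [← Finset.card_image_of_injective _ Fin.val_injective, himage, Nat.card_Ico]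
  omega

/-- Distinct blocks are vertex-disjoint. [folklore] -/
theorem eq_of_mem_block {k i j : ℕ} {v : Fin n} (hi : v ∈ block n k i) (hj : v ∈ block n k j) :
    i = j := by
  simp only [block, Finset.mem_filter, Finset.mem_univ, true_and] at hi hj
  by_contra hne
  rcases lt_or_gt_of_ne hne with h | h
  · have h' : (i + 1) * k ≤ j * k := Nat.mul_le_mul_right k h
    rw [Nat.add_mul, one_mul] at h'
    omega
  · have h' : (j + 1) * k ≤ i * k := Nat.mul_le_mul_right k h
    rw [Nat.add_mul, one_mul] at h'
    omega

/-- The clique vectors of distinct blocks have disjoint supports. [folklore] -/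
theorem cliqueVec_block_disjoint {k : ℕ} (i j : ℕ) (hij : i ≠ j)
    (e : (⊤ : SimpleGraph (Fin n)).edgeSet) (he : cliqueVec (block n k i) e = true) :
    cliqueVec (block n k j) e = false := by
  obtain ⟨e, hemem⟩ := e
  induction e using Sym2.ind with
  | _ u v =>
    rw [cliqueVec_mk] at he ⊢
    rw [decide_eq_true_eq] at he
    rw [decide_eq_false_iff_not]
    rintro ⟨hu, -⟩
    exact hij (eq_of_mem_block he.1 hu)

/-- Blocks with index `< ⌊n/k⌋` fit inside `[0, n)`. [folklore] -/
theorem block_fits {k i : ℕ} (hi : i < n / k) : i * k + k ≤ n := by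
  have h1 : (i + 1) * k ≤ (n / k) * k := Nat.mul_le_mul_right k hi
  have h2 : (n / k) * k ≤ n := Nat.div_mul_le_self n k
  rw [Nat.add_mul, one_mul] at h1
  omega

open Classical in
/-- **`Pr_{G(n,q)}[no k-clique] ≤ (1 − q^{C(k,2)})^{⌊n/k⌋}`** (`0 ≤ q ≤ 1`): a clique-free graph fills
none of the `⌊n/k⌋` disjoint `k`-blocks, and these events are independent. [folklore] -/
theorem gnpProb_cliqueFree_le_pow (k : ℕ) {q : ℝ} (hq0 : 0 ≤ q) (hq1 : q ≤ 1) :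
    ∑ x ∈ univ.filter (fun x : (⊤ : SimpleGraph (Fin n)).edgeSet → Bool => cliqueFn n k x = false),
        gnpWeight n q x ≤ (1 - q ^ k.choose 2) ^ (n / k) := by
  rcases Nat.eq_zero_or_pos k with rfl | hk
  · simp only [Nat.choose_zero_succ, pow_zero, sub_self, Nat.div_zero]
    calc ∑ x ∈ univ.filter (fun x : (⊤ : SimpleGraph (Fin n)).edgeSet → Bool => cliqueFn n 0 x = false),
          gnpWeight n q x ≤ ∑ x, gnpWeight n q x :=
          Finset.sum_le_sum_of_subset_of_nonneg (Finset.filter_subset _ _)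
            fun x _ _ => gnpWeight_nonneg hq0 hq1 x
      _ = 1 := sum_gnpWeight q
  set T := n / k with hT
  -- clique-free graphs fill no block
  have hsub : (univ.filter fun x : (⊤ : SimpleGraph (Fin n)).edgeSet → Bool => cliqueFn n k x = false) ⊆
      univ.filter fun x => ∀ i < T, ¬ ∀ e, cliqueVec (block n k i) e = true → x e = true := by
    intro x hx
    rw [Finset.mem_filter] at hx ⊢
    refine ⟨Finset.mem_univ _, fun i hi hfull => ?_⟩
    have hcard : #(block n k i) = k := card_block (block_fits hi)
    have hle : cliqueVec (block n k i) ≤ x := fun e => by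
      cases hce : cliqueVec (block n k i) e
      · exact Bool.false_le _
      · rw [hfull e hce]
    have hmono := cliqueFn_monotone_holds n k hle
    rw [cliqueFn_cliqueVec (le_of_eq hcard.symm), hx.2] at hmono
    exact absurd hmono (by decide)
  refine (Finset.sum_le_sum_of_subset_of_nonneg hsub fun x _ _ => gnpWeight_nonneg hq0 hq1 x).trans ?_
  rw [sum_filter_noneFull_gnpWeight q (block n k) (fun i j hij => cliqueVec_block_disjoint i j hij) T]
  -- every factor with `i < T` equals `1 - q^{C(k,2)}`
  have hfac : ∀ i ∈ range T, (1 - q ^ edgeCount (cliqueVec (block n k i))) = 1 - q ^ k.choose 2 := by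
    intro i hi
    rw [Finset.mem_range] at hi
    rw [edgeCount, card_filter_cliqueVec, card_block (block_fits hi)]
  rw [Finset.prod_congr rfl hfac, Finset.prod_const, Finset.card_range]


/-! ## Part VIII-C — the window of `Conc` cannot reach the supercritical slices `j ≈ m · n^{θ}`

Mirror image of Part V (`WindowDepth.lean`, lower edge `m · n^{-ε}`): if the UPPER edge of the window
is moved from `m + m^{3/4}` up to `m · n^{θ}`, the inner clause of `Conc` becomes FALSE whenever
`θ > 2/k` (`d ≥ 1`, every `c`, `k ≥ 3`, every `δ > 0`): on the slice `j = ⌊m n^{θ'}⌋₊`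
(`θ' = min θ θ₀`, `2/k < θ₀ < 2/(k-1)`) a uniform `j`-edge graph is `k`-clique-free with probability
at most `2 · Pr_{G(n, j/2N)}[no k-clique] ≤ 2 (1 − q^{C(k,2)})^{⌊n/k⌋} ≤ 2 exp(−⌊n/k⌋ q^{C(k,2)}) → 0`
(slice-vs-binomial comparison of Part VIII-A for the down-set of clique-free graphs; disjoint blocks
of Part VIII-B; `⌊n/k⌋ q^{C(k,2)} ≳ n^{1 + θ' C(k,2) − k} → ∞` exactly when `θ' > 2/k`), so the
constant-`1` circuit (`∧₀`, size `1`, `acDepth 1`) is `δ`-accurate there and `n^c < 1` fails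
(`not_innerConcHighWindow`). For `k ≤ c` (and `d ≥ 2`) the clause fails for EVERY `θ ≥ 0` by the
clique DNF at the centre (`not_innerConcHighWindow_of_le`), whence the GLOBAL statement with the window
`[m, m · n^{θ}]` is false for every `θ > 0` (`not_concHighWindow`: take `c > 2/θ`). The sharp claim at
a FIXED `k` for `0 < θ ≤ 2/k` needs Janson's inequality at densities `p · n^{θ}` — not attempted; together
with Part V the admissible windows of `Conc` are pinned to `m · n^{±o(1)}` globally. -/

section HighWindow

variable {n : ℕ}

/-- The slice error of the constant-`1` circuit against `k`-CLIQUE counts the clique-FREE vectors of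
the slice. [folklore] -/
theorem sliceErr_const_true (j k : ℕ) :
    sliceErr n j (Circuit.const _ true).eval (cliqueFn n k) =
      #(univ.filter fun x : (⊤ : SimpleGraph (Fin n)).edgeSet → Bool =>
        edgeCount x = j ∧ cliqueFn n k x = false) := by
  unfold sliceErr
  congr 1
  refine Finset.filter_congr fun x _ => ?_
  rw [Circuit.eval_const]
  constructor
  · rintro ⟨h1, h2⟩
    refine ⟨h1, ?_⟩
    cases h : cliqueFn n k x
    · rfl
    · exact absurd h.symm h2
  · rintro ⟨h1, h2⟩
    refine ⟨h1, ?_⟩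
    rw [h2]
    decide

open Classical in
/-- **Clique-free graphs are rare on supercritical slices, quantitatively**: for `1 ≤ j ≤ C(n,2)`,
`#{x : |x| = j, x k-clique-free} ≤ 2 (1 − (j/2C(n,2))^{C(k,2)})^{⌊n/k⌋} · #{x : |x| = j}`
(Part VIII-A for the down-set of supports of clique-free vectors, whose biased measure is
`Pr_{G(n,q)}[no k-clique]`, bounded by Part VIII-B). [folklore] -/
theorem card_slice_cliqueFree_le {j : ℕ} (hj : 1 ≤ j) (hjN : j ≤ n.choose 2) (k : ℕ) :
    (#(univ.filter fun x : (⊤ : SimpleGraph (Fin n)).edgeSet → Bool =>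
        edgeCount x = j ∧ cliqueFn n k x = false) : ℝ) ≤
      2 * (1 - ((j : ℝ) / (2 * (n.choose 2 : ℕ))) ^ k.choose 2) ^ (n / k) * sliceCard n j := by
  set E := (⊤ : SimpleGraph (Fin n)).edgeSet with hE
  set 𝒟 : Finset (Finset E) := (univ.filter fun x : E → Bool => cliqueFn n k x = false).image supp
    with h𝒟
  -- 𝒟 is a down-set
  have hlow : IsLowerSet (𝒟 : Set (Finset E)) := by
    intro W W' hW'W hW
    rw [Finset.mem_coe, h𝒟, Finset.mem_image] at hW ⊢
    obtain ⟨x, hx, rfl⟩ := hW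
    rw [Finset.mem_filter] at hx
    refine ⟨fun e => decide (e ∈ W'), ?_, supp_indicator W'⟩
    rw [Finset.mem_filter]
    refine ⟨Finset.mem_univ _, ?_⟩
    have hle : (fun e => decide (e ∈ W')) ≤ x := by
      intro e
      by_cases he : e ∈ W'
      · have : x e = true := mem_supp.1 (hW'W he)
        rw [this]
        exact le_top
      · simp [he]
    have hmono := cliqueFn_monotone_holds n k hle
    rw [hx.2] at hmono
    cases h : cliqueFn n k (fun e => decide (e ∈ W'))
    · rfl
    · rw [h] at hmono
      exact absurd hmono (by decide)
  -- its slice `j` is the image of our set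
  have hslice : #(𝒟 # j) = #(univ.filter fun x : E → Bool => edgeCount x = j ∧ cliqueFn n k x = false) := by
    have : 𝒟 # j = (univ.filter fun x : E → Bool => edgeCount x = j ∧ cliqueFn n k x = false).image supp := by
      ext W
      simp only [Finset.slice, h𝒟, Finset.mem_filter, Finset.mem_image, Finset.mem_univ, true_and]
      constructor
      · rintro ⟨⟨x, hx, rfl⟩, hcard⟩
        exact ⟨x, ⟨by rw [← card_supp]; exact hcard, hx⟩, rfl⟩
      · rintro ⟨x, ⟨hcard, hx⟩, rfl⟩
        exact ⟨⟨x, hx, rfl⟩, by rw [card_supp]; exact hcard⟩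
    rw [this, Finset.card_image_of_injective _ supp_injective]
  -- its biased measure is Pr[no k-clique]
  have hmeas : ∀ q : ℝ, ∑ W ∈ 𝒟, biasedWeight q W =
      ∑ x ∈ univ.filter (fun x : E → Bool => cliqueFn n k x = false), gnpWeight n q x := by
    intro q
    rw [h𝒟, Finset.sum_image fun x _ y _ h => supp_injective h]
    refine Finset.sum_congr rfl fun x _ => ?_
    rw [biasedWeight, card_supp, card_edgeSet_top_fin, gnpWeight]
  have hcardE : Fintype.card E = n.choose 2 := card_edgeSet_top_fin n
  -- Part VIII-A
  have hA := card_slice_div_choose_le_two_mul_sum_biasedWeight 𝒟 hlow hj (by rw [hcardE]; exact hjN)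
  rw [hcardE, hslice, hmeas] at hA
  -- Part VIII-B
  have hN0 : (0 : ℝ) < ((n.choose 2 : ℕ) : ℝ) := by exact_mod_cast (show 0 < n.choose 2 by omega)
  have hq0 : (0 : ℝ) ≤ (j : ℝ) / (2 * (n.choose 2 : ℕ)) := by positivity
  have hq1 : (j : ℝ) / (2 * (n.choose 2 : ℕ)) ≤ 1 := by
    rw [div_le_one (by positivity)]
    have : (j : ℝ) ≤ (n.choose 2 : ℕ) := by exact_mod_cast hjN
    linarith
  have hB := gnpProb_cliqueFree_le_pow (n := n) k hq0 hq1
  have hpos : (0 : ℝ) < ((n.choose 2).choose j : ℕ) := by exact_mod_cast Nat.choose_pos hjN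
  rw [div_le_iff₀ hpos] at hA
  rw [sliceCard_eq]
  calc (#(univ.filter fun x : E → Bool => edgeCount x = j ∧ cliqueFn n k x = false) : ℝ)
      ≤ 2 * (∑ x ∈ univ.filter (fun x : E → Bool => cliqueFn n k x = false),
          gnpWeight n ((j : ℝ) / (2 * (n.choose 2 : ℕ))) x) * ((n.choose 2).choose j : ℕ) := hA
    _ ≤ 2 * (1 - ((j : ℝ) / (2 * (n.choose 2 : ℕ))) ^ k.choose 2) ^ (n / k) * ((n.choose 2).choose j : ℕ) :=
        mul_le_mul_of_nonneg_right (mul_le_mul_of_nonneg_left hB (by norm_num)) (Nat.cast_nonneg _)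

/-- `(1 − x)^T ≤ exp(−T x)` for `x ≤ 1`. [folklore] -/
theorem one_sub_pow_le_exp {x : ℝ} (hx1 : x ≤ 1) (T : ℕ) :
    (1 - x) ^ T ≤ Real.exp (-((T : ℝ) * x)) := by
  calc (1 - x) ^ T ≤ (Real.exp (-x)) ^ T :=
        pow_le_pow_left₀ (by linarith) (Real.one_sub_le_exp_neg x) T
    _ = Real.exp (-((T : ℝ) * x)) := by rw [← Real.exp_nat_mul]; ring_nf

/-- `C(n,2) ≥ n²/4` for `n ≥ 2`. [folklore] -/
theorem sq_div_four_le_choose_two (hn : 2 ≤ n) : (n : ℝ) ^ 2 / 4 ≤ ((n.choose 2 : ℕ) : ℝ) := by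
  rw [Nat.cast_choose_two]
  have h2 : (2 : ℝ) ≤ n := by exact_mod_cast hn
  nlinarith

set_option maxHeartbeats 400000 in
/-- **Arithmetic of the supercritical slice.** For `k ≥ 3`, `2/k < θ' < 2/(k-1)` and `L`, eventually
in `n`: with `N = C(n,2)`, `m = m_k(n)`, `j = ⌊m n^{θ'}⌋₊`, `q = j/(2N)`:
`1 ≤ j ≤ N` and `⌊n/k⌋ · q^{C(k,2)} ≥ L`. [folklore] -/
theorem highWindow_eventually {k : ℕ} (hk : 3 ≤ k) {θ' : ℝ} (hθlo : 2 / (k : ℝ) < θ')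
    (hθhi : θ' < 2 / ((k : ℝ) - 1)) (L : ℝ) :
    ∀ᶠ n : ℕ in atTop, 1 ≤ ⌊(mk n k : ℝ) * (n : ℝ) ^ θ'⌋₊ ∧ ⌊(mk n k : ℝ) * (n : ℝ) ^ θ'⌋₊ ≤ n.choose 2 ∧
      L ≤ ((n / k : ℕ) : ℝ) *
        ((⌊(mk n k : ℝ) * (n : ℝ) ^ θ'⌋₊ : ℝ) / (2 * (n.choose 2 : ℕ))) ^ k.choose 2 := by
  -- constants
  have hk3 : (3 : ℝ) ≤ k := by exact_mod_cast hk
  have hk0 : (0 : ℝ) < k := by linarith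
  have hk1 : (0 : ℝ) < (k : ℝ) - 1 := by linarith
  set α : ℝ := 2 / ((k : ℝ) - 1) with hα
  have hα1 : α ≤ 1 := by rw [hα, div_le_one hk1]; linarith
  have hα0 : 0 < α := by positivity
  have hθ0 : 0 < θ' := lt_trans (by positivity) hθlo
  set K : ℕ := k.choose 2 with hK
  have hKr : (K : ℝ) = k * ((k : ℝ) - 1) / 2 := by rw [hK, Nat.cast_choose_two]
  -- the exponent of growth
  set γ : ℝ := 1 + θ' * K - k with hγ
  have hγ0 : 0 < γ := by
    have hKpos : (0 : ℝ) < k * ((k : ℝ) - 1) / 2 := div_pos (mul_pos hk0 hk1) two_pos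
    have : ((k : ℝ) - 1) < θ' * K := by
      rw [hKr]
      have h1 : (k : ℝ) - 1 = 2 / (k : ℝ) * (k * ((k : ℝ) - 1) / 2) := by field_simp
      calc (k : ℝ) - 1 = 2 / (k : ℝ) * (k * ((k : ℝ) - 1) / 2) := h1
        _ < θ' * (k * ((k : ℝ) - 1) / 2) := mul_lt_mul_of_pos_right hθlo hKpos
    rw [hγ]; linarith
  have hαK : α * K = k := by rw [hα, hKr]; field_simp
  -- eventualities
  have h16 : ∀ᶠ n : ℕ in atTop, 16 ≤ n := eventually_ge_atTop 16
  have h2k : ∀ᶠ n : ℕ in atTop, 2 * k ≤ n := eventually_ge_atTop (2 * k)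
  have hgrow : ∀ᶠ n : ℕ in atTop, 2 * k * 4 ^ K * max L 0 ≤ (n : ℝ) ^ γ :=
    ((tendsto_rpow_atTop hγ0).comp tendsto_natCast_atTop_atTop).eventually_ge_atTop _
  filter_upwards [h16, h2k, hgrow] with n hn16 hn2k hngrow
  -- basic positivity
  have hn0 : (0 : ℝ) < n := by exact_mod_cast (show 0 < n by omega)
  have hn1 : (1 : ℝ) ≤ n := by exact_mod_cast (show 1 ≤ n by omega)
  have hN : (n : ℝ) ^ 2 / 4 ≤ ((n.choose 2 : ℕ) : ℝ) := sq_div_four_le_choose_two (by omega)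
  have hNpos : (0 : ℝ) < ((n.choose 2 : ℕ) : ℝ) := by nlinarith
  set N : ℝ := ((n.choose 2 : ℕ) : ℝ) with hNdef
  set m : ℝ := (mk n k : ℝ) with hmdef
  have hm_up : m ≤ N * (n : ℝ) ^ (-α) := by
    rw [hmdef, mk, hα, neg_div]
    exact Nat.floor_le (by positivity)
  have hm_lo : N * (n : ℝ) ^ (-α) - 1 ≤ m := by
    rw [hmdef, mk, hα, neg_div]
    have := Nat.lt_floor_add_one (((n.choose 2 : ℕ) : ℝ) * (n : ℝ) ^ (-(2 / ((k : ℝ) - 1))))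
    linarith
  have hm0 : 0 ≤ m := Nat.cast_nonneg _
  set x : ℝ := m * (n : ℝ) ^ θ' with hxdef
  have hx0 : 0 ≤ x := by positivity
  set j : ℕ := ⌊x⌋₊ with hjdef
  have hj_up : (j : ℝ) ≤ x := Nat.floor_le hx0
  have hj_lo : x - 1 ≤ j := by have := Nat.lt_floor_add_one x; linarith
  -- rpow bookkeeping
  have hpow_θα : (n : ℝ) ^ (-α) * (n : ℝ) ^ θ' = (n : ℝ) ^ (θ' - α) := by
    rw [← Real.rpow_add hn0]; ring_nf
  have hθα_neg : θ' - α < 0 := by rw [hα]; linarith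
  have hθα_gt : -1 < θ' - α := by linarith
  have hnθα_le1 : (n : ℝ) ^ (θ' - α) ≤ 1 := Real.rpow_le_one_of_one_le_of_nonpos hn1 hθα_neg.le
  have hnθ1 : 1 ≤ (n : ℝ) ^ θ' := Real.one_le_rpow hn1 hθ0.le
  -- (1) j ≤ N
  have hjN : (j : ℝ) ≤ N := by
    calc (j : ℝ) ≤ x := hj_up
      _ ≤ N * (n : ℝ) ^ (-α) * (n : ℝ) ^ θ' := mul_le_mul_of_nonneg_right hm_up (by positivity)
      _ = N * (n : ℝ) ^ (θ' - α) := by rw [mul_assoc, hpow_θα]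
      _ ≤ N * 1 := mul_le_mul_of_nonneg_left hnθα_le1 hNpos.le
      _ = N := mul_one _
  -- (2) q ≥ n^{θ'-α}/4
  have hq_lo : (n : ℝ) ^ (θ' - α) / 4 ≤ (j : ℝ) / (2 * N) := by
    -- j ≥ N n^{θ'-α} − n^{θ'} − 1 and N ≥ n²/4, n ≥ 16
    have h1 : N * (n : ℝ) ^ (θ' - α) - (n : ℝ) ^ θ' - 1 ≤ j := by
      calc N * (n : ℝ) ^ (θ' - α) - (n : ℝ) ^ θ' - 1
          = (N * (n : ℝ) ^ (-α) - 1) * (n : ℝ) ^ θ' - 1 := by rw [sub_mul, mul_assoc, hpow_θα, one_mul]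
        _ ≤ m * (n : ℝ) ^ θ' - 1 := by
            have := mul_le_mul_of_nonneg_right hm_lo (by positivity : (0 : ℝ) ≤ (n : ℝ) ^ θ')
            linarith
        _ ≤ j := hj_lo
    -- n^{θ'} + 1 ≤ N n^{θ'-α} / 2, since N n^{θ'-α} ≥ (n²/4) n^{θ'-1} = n^{1+θ'}/4 ≥ 4 n^{θ'}
    have h2 : (n : ℝ) ^ θ' + 1 ≤ N * (n : ℝ) ^ (θ' - α) / 2 := by
      have hstep : (n : ℝ) ^ (1 + θ') / 4 ≤ N * (n : ℝ) ^ (θ' - α) := by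
        have hexp : (n : ℝ) ^ (1 + θ') ≤ (n : ℝ) ^ 2 * (n : ℝ) ^ (θ' - α) := by
          rw [show (n : ℝ) ^ 2 = (n : ℝ) ^ (2 : ℝ) by norm_cast, ← Real.rpow_add hn0]
          exact Real.rpow_le_rpow_of_exponent_le hn1 (by linarith)
        calc (n : ℝ) ^ (1 + θ') / 4 ≤ (n : ℝ) ^ 2 * (n : ℝ) ^ (θ' - α) / 4 := by linarith
          _ = (n : ℝ) ^ 2 / 4 * (n : ℝ) ^ (θ' - α) := by ring
          _ ≤ N * (n : ℝ) ^ (θ' - α) := mul_le_mul_of_nonneg_right hN (by positivity)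
      have h16r : (16 : ℝ) ≤ n := by exact_mod_cast hn16
      have hpow1 : (n : ℝ) ^ (1 + θ') = n * (n : ℝ) ^ θ' := by
        rw [Real.rpow_add hn0, Real.rpow_one]
      have : 8 * ((n : ℝ) ^ θ' + 1) ≤ (n : ℝ) ^ (1 + θ') := by
        rw [hpow1]
        nlinarith
      linarith
    have key : N * (n : ℝ) ^ (θ' - α) ≤ 2 * j := by linarith [h1, h2]
    rw [div_le_div_iff₀ (by norm_num) (by positivity)]
    linarith [key]
  -- (3) j ≥ 1 (from q > 0)
  have hq_pos : 0 < (j : ℝ) / (2 * N) := lt_of_lt_of_le (by positivity) hq_lo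
  have hj1 : 1 ≤ j := by
    have : (0 : ℝ) < j := by
      have := mul_pos hq_pos (by positivity : (0 : ℝ) < 2 * N)
      rwa [div_mul_cancel₀ _ (by positivity)] at this
    exact_mod_cast this
  have hjN' : j ≤ n.choose 2 := by
    rw [hNdef] at hjN
    exact_mod_cast hjN
  refine ⟨hj1, hjN', ?_⟩
  -- (4) the growth bound
  have hT : (n : ℝ) / (2 * k) ≤ ((n / k : ℕ) : ℝ) := by
    have h1 : ((n / k : ℕ) : ℝ) * k ≥ n - k := by
      have := Nat.div_add_mod n k
      have hmod : (n % k : ℕ) < k := Nat.mod_lt n (by omega)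
      have hcast : ((n / k : ℕ) : ℝ) * k + ((n % k : ℕ) : ℝ) = n := by
        rw [mul_comm]; exact_mod_cast this
      have hmodr : ((n % k : ℕ) : ℝ) < k := by exact_mod_cast hmod
      linarith
    have h2 : (n : ℝ) - k ≥ n / 2 := by
      have : (2 * k : ℝ) ≤ n := by exact_mod_cast hn2k
      linarith
    rw [div_le_iff₀ (by positivity)]
    linarith
  have hqK : (n : ℝ) ^ (θ' * K - k) / 4 ^ K ≤ ((j : ℝ) / (2 * N)) ^ K := by
    have h := pow_le_pow_left₀ (by positivity) hq_lo K
    rw [div_pow, ← Real.rpow_natCast ((n : ℝ) ^ (θ' - α)) K, ← Real.rpow_mul hn0.le] at h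
    have hexp : (θ' - α) * (K : ℝ) = θ' * K - k := by rw [sub_mul, hαK]
    rwa [hexp] at h
  have hmain : (n : ℝ) ^ γ / (2 * k * 4 ^ K) ≤ ((n / k : ℕ) : ℝ) * ((j : ℝ) / (2 * N)) ^ K := by
    have hsplit : (n : ℝ) ^ γ = n * (n : ℝ) ^ (θ' * K - k) := by
      rw [hγ, show 1 + θ' * K - k = 1 + (θ' * K - k) by ring, Real.rpow_add hn0, Real.rpow_one]
    rw [hsplit, ← div_mul_div_comm]
    exact mul_le_mul hT hqK (by positivity) (Nat.cast_nonneg _)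
  have hL : L ≤ (n : ℝ) ^ γ / (2 * k * 4 ^ K) := by
    rw [le_div_iff₀ (by positivity)]
    calc L * (2 * k * 4 ^ K) ≤ max L 0 * (2 * k * 4 ^ K) :=
          mul_le_mul_of_nonneg_right (le_max_left _ _) (by positivity)
      _ = 2 * k * 4 ^ K * max L 0 := by ring
      _ ≤ (n : ℝ) ^ γ := hngrow
  exact hL.trans hmain

/-- **The window cannot reach the supercritical slices `j ≈ m · n^{θ}`, `θ > 2/k`** (`d ≥ 1`, every
`c`, `k ≥ 3`, every `δ > 0`): there the constant-`1` circuit (size `1`) is `δ`-accurate eventually,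
and `n ^ c < 1` fails. [folklore] -/
theorem not_innerConcHighWindow {d : ℕ} (hd : 1 ≤ d) (c : ℕ) {k : ℕ} (hk : 3 ≤ k) {δ θ : ℝ}
    (hδ : 0 < δ) (hθ : 2 / (k : ℝ) < θ) :
    ¬ (∀ᶠ n : ℕ in atTop, ∀ j : ℕ, (mk n k : ℝ) ≤ j → (j : ℝ) ≤ (mk n k : ℝ) * (n : ℝ) ^ θ →
        ∀ C : Circuit ((⊤ : SimpleGraph (Fin n)).edgeSet), C.IsOver acBasis → C.acDepth ≤ d →
          (sliceErr n j C.eval (cliqueFn n k) : ℝ) ≤ δ * sliceCard n j → n ^ c < C.size) := by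
  intro h
  -- choose θ' with 2/k < θ' < 2/(k-1), θ' ≤ θ
  have hk3 : (3 : ℝ) ≤ k := by exact_mod_cast hk
  have hkk : 2 / (k : ℝ) < 2 / ((k : ℝ) - 1) :=
    div_lt_div_of_pos_left two_pos (by linarith) (by linarith)
  set θ' : ℝ := min θ ((2 / (k : ℝ) + 2 / ((k : ℝ) - 1)) / 2) with hθ'
  have hθlo : 2 / (k : ℝ) < θ' := lt_min hθ (by linarith)
  have hθhi : θ' < 2 / ((k : ℝ) - 1) := lt_of_le_of_lt (min_le_right _ _) (by linarith)
  have hθle : θ' ≤ θ := min_le_left _ _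
  have hθ0 : 0 ≤ θ' := le_trans (by positivity) hθlo.le
  -- the target level for ⌊n/k⌋ q^K
  set L : ℝ := -Real.log (δ / 2) with hL
  obtain ⟨n, hn, hn1, hj1, hjN, hgrow⟩ :=
    (h.and ((eventually_ge_atTop 1).and (highWindow_eventually hk hθlo hθhi L))).exists
  set j : ℕ := ⌊(mk n k : ℝ) * (n : ℝ) ^ θ'⌋₊ with hjdef
  have hn1r : (1 : ℝ) ≤ n := by exact_mod_cast hn1
  have hx0 : 0 ≤ (mk n k : ℝ) * (n : ℝ) ^ θ' := by positivity
  -- j is in the window [m, m n^θ]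
  have hwin_lo : (mk n k : ℝ) ≤ j := by
    have : mk n k ≤ j := by
      refine Nat.le_floor ?_
      calc ((mk n k : ℕ) : ℝ) = (mk n k : ℝ) * 1 := (mul_one _).symm
        _ ≤ (mk n k : ℝ) * (n : ℝ) ^ θ' :=
            mul_le_mul_of_nonneg_left (Real.one_le_rpow hn1r hθ0) (Nat.cast_nonneg _)
    exact_mod_cast this
  have hwin_hi : (j : ℝ) ≤ (mk n k : ℝ) * (n : ℝ) ^ θ := by
    calc (j : ℝ) ≤ (mk n k : ℝ) * (n : ℝ) ^ θ' := Nat.floor_le hx0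
      _ ≤ (mk n k : ℝ) * (n : ℝ) ^ θ :=
          mul_le_mul_of_nonneg_left (Real.rpow_le_rpow_of_exponent_le hn1r hθle) (Nat.cast_nonneg _)
  -- the constant-1 circuit is δ-accurate on slice j
  have hN0 : (0 : ℝ) < ((n.choose 2 : ℕ) : ℝ) := by exact_mod_cast (show 0 < n.choose 2 by omega)
  set q : ℝ := (j : ℝ) / (2 * (n.choose 2 : ℕ)) with hq
  have hq0 : 0 ≤ q := by positivity
  have hq1 : q ≤ 1 := by
    rw [hq, div_le_one (by positivity)]
    have : (j : ℝ) ≤ (n.choose 2 : ℕ) := by exact_mod_cast hjN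
    linarith
  have hqK0 : 0 ≤ q ^ k.choose 2 := by positivity
  have hqK1 : q ^ k.choose 2 ≤ 1 := pow_le_one₀ hq0 hq1
  have herr : (sliceErr n j (Circuit.const _ true).eval (cliqueFn n k) : ℝ) ≤ δ * sliceCard n j := by
    rw [sliceErr_const_true]
    refine (card_slice_cliqueFree_le hj1 hjN k).trans (mul_le_mul_of_nonneg_right ?_ (Nat.cast_nonneg _))
    -- 2 (1 - q^K)^T ≤ 2 exp(-T q^K) ≤ 2 exp(-L) = δ
    have h1 := one_sub_pow_le_exp hqK1 (n / k)
    have h2 : Real.exp (-(((n / k : ℕ) : ℝ) * q ^ k.choose 2)) ≤ δ / 2 := by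
      rw [← Real.le_log_iff_exp_le (by positivity)]
      have : L ≤ ((n / k : ℕ) : ℝ) * q ^ k.choose 2 := hgrow
      rw [hL] at this
      linarith
    linarith
  have hlt := hn j hwin_lo hwin_hi (Circuit.const _ true)
    (Circuit.const_isOver_acBasis true) (by rw [Circuit.acDepth_const]; exact hd) herr
  rw [Circuit.size_const] at hlt
  exact absurd (Nat.one_le_pow c n hn1) (not_le.2 hlt)

/-- **`k ≤ c` is impossible for the widened window too** (`d ≥ 2`, every `θ ≥ 0`, every `δ ≥ 0`):
the exhaustive clique DNF is exact at the centre `j = m`, which the window `[m, m n^{θ}]` contains.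
[folklore] -/
theorem not_innerConcHighWindow_of_le {d c k : ℕ} (hd : 2 ≤ d) (hk : 2 ≤ k) (hkc : k ≤ c) {δ θ : ℝ}
    (hδ : 0 ≤ δ) (hθ : 0 ≤ θ) :
    ¬ (∀ᶠ n : ℕ in atTop, ∀ j : ℕ, (mk n k : ℝ) ≤ j → (j : ℝ) ≤ (mk n k : ℝ) * (n : ℝ) ^ θ →
        ∀ C : Circuit ((⊤ : SimpleGraph (Fin n)).edgeSet), C.IsOver acBasis → C.acDepth ≤ d →
          (sliceErr n j C.eval (cliqueFn n k) : ℝ) ≤ δ * sliceCard n j → n ^ c < C.size) := by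
  intro h
  obtain ⟨n, hn, hn2⟩ := (h.and (eventually_ge_atTop 2)).exists
  obtain ⟨C, hB, hD, hS, hE⟩ := exists_cliqueDNF n k
  have herr : (sliceErr n (mk n k) C.eval (cliqueFn n k) : ℝ) ≤ δ * sliceCard n (mk n k) := by
    rw [sliceErr_eq_zero_of_forall _ hE, Nat.cast_zero]
    exact mul_nonneg hδ (Nat.cast_nonneg _)
  have hn1r : (1 : ℝ) ≤ n := by exact_mod_cast (show 1 ≤ n by omega)
  have hhi : ((mk n k : ℕ) : ℝ) ≤ (mk n k : ℝ) * (n : ℝ) ^ θ := by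
    calc ((mk n k : ℕ) : ℝ) = (mk n k : ℝ) * 1 := (mul_one _).symm
      _ ≤ (mk n k : ℝ) * (n : ℝ) ^ θ :=
          mul_le_mul_of_nonneg_left (Real.one_le_rpow hn1r hθ) (Nat.cast_nonneg _)
  have hlt := hn (mk n k) le_rfl hhi C hB (hD.trans hd) herr
  exact absurd (hS.trans (choose_succ_le_pow hn2 hk hkc)) (not_le.2 hlt)

/-- **The global statement with the window widened up to `m · n^{θ}` is false for EVERY `θ > 0`**
(`d = 2`, `c = ⌈2/θ⌉₊ + 1`: a witness `k ≤ c` is killed by the clique DNF, a witness `k > c` has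
`2/k < θ` and is killed by the constant-`1` circuit on the slice `m · n^{θ'}`). So, together with
`not_innerConcLowWindow`, the admissible windows of `Conc` are `m · n^{±o(1)}`. [folklore] -/
theorem not_concHighWindow {θ : ℝ} (hθ : 0 < θ) :
    ¬ ∀ d c : ℕ, ∃ k : ℕ, 3 ≤ k ∧ ∃ δ : ℝ, 0 < δ ∧ (∀ᶠ n : ℕ in atTop, ∀ j : ℕ,
        (mk n k : ℝ) ≤ j → (j : ℝ) ≤ (mk n k : ℝ) * (n : ℝ) ^ θ →
        ∀ C : Circuit ((⊤ : SimpleGraph (Fin n)).edgeSet), C.IsOver acBasis → C.acDepth ≤ d →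
          (sliceErr n j C.eval (cliqueFn n k) : ℝ) ≤ δ * sliceCard n j → n ^ c < C.size) := by
  intro h
  obtain ⟨k, hk, δ, hδ, hI⟩ := h 2 (⌈2 / θ⌉₊ + 1)
  by_cases hkc : k ≤ ⌈2 / θ⌉₊ + 1
  · exact not_innerConcHighWindow_of_le le_rfl (by omega) hkc hδ.le hθ.le hI
  · have hkθ : 2 / (k : ℝ) < θ := by
      have hceil : 2 / θ ≤ (⌈2 / θ⌉₊ : ℝ) := Nat.le_ceil _
      have hlt : (⌈2 / θ⌉₊ : ℝ) + 1 < k := by exact_mod_cast (show ⌈2 / θ⌉₊ + 1 < k by omega)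
      have hk0 : (0 : ℝ) < k := by linarith [show (0:ℝ) ≤ (⌈2 / θ⌉₊ : ℝ) from Nat.cast_nonneg _]
      rw [div_lt_iff₀ hk0]
      have : 2 / θ < k := by linarith
      rw [div_lt_iff₀ hθ] at this
      linarith [mul_comm θ (k:ℝ)]
    exact not_innerConcHighWindow (d := 2) (by norm_num) _ hk hδ hkθ hI

end HighWindow


/-! ## Part VIII-D — the same for the HYPOTHESIS: the `q`-window of `Hyp` cannot reach `q·C(n,2) ≈ m · n^{θ}`

Mirror of Part VIII-C on the hypothesis side (no slice transfer needed: the `G(n,q)`-error of the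
constant-`1` circuit IS `Pr_{G(n,q)}[no k-clique] ≤ (1 − q^{C(k,2)})^{⌊n/k⌋}`, Part VIII-B). If the upper
edge of the `q`-window of `Hyp` is moved from `m + m^{3/4}` up to `m · n^{θ}`, the inner clause of `Hyp`
becomes FALSE whenever `θ > 2/k` (`d ≥ 1`, every `c`, `k ≥ 3`, every `δ > 0`; witness density
`q = m n^{θ'}/C(n,2)`), and for `k ≤ c`, `d ≥ 2` for every `θ ≥ 0` (clique DNF at the centre); so the
global hypothesis with that window is false for every `θ > 0` — i.e. such a "more generous" `Hyp` would
make the crux VACUOUSLY true (compare Part I's packaging `(Hyp → Conc-without-X) ↔ ¬Hyp`). -/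

section HighWindowHyp

variable {n : ℕ}

/-- The `G(n,q)`-error of the constant-`1` circuit against `k`-CLIQUE is `Pr[no k-clique]`. [folklore] -/
theorem gnpDisagreeProb_const_true (q : ℝ) (k : ℕ) :
    gnpDisagreeProb n q (Circuit.const _ true).eval (cliqueFn n k) =
      ∑ x ∈ univ.filter (fun x : (⊤ : SimpleGraph (Fin n)).edgeSet → Bool => cliqueFn n k x = false),
        gnpWeight n q x := by
  rw [gnpDisagreeProb]
  refine Finset.sum_congr ?_ fun _ _ => rfl
  refine Finset.filter_congr fun x _ => ?_
  rw [Circuit.eval_const]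
  constructor
  · intro h
    cases hx : cliqueFn n k x
    · rfl
    · exact absurd hx.symm h
  · intro h
    rw [h]
    decide

set_option maxHeartbeats 400000 in
/-- **Arithmetic of the supercritical density.** For `k ≥ 3`, `2/k < θ' < 2/(k-1)` and `L`, eventually in
`n`: with `N = C(n,2)`, `m = m_k(n)`, `q = m n^{θ'}/N`: `q ≤ 1` and `⌊n/k⌋ · q^{C(k,2)} ≥ L`. [folklore] -/
theorem highWindowHyp_eventually {k : ℕ} (hk : 3 ≤ k) {θ' : ℝ} (hθlo : 2 / (k : ℝ) < θ')
    (hθhi : θ' < 2 / ((k : ℝ) - 1)) (L : ℝ) :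
    ∀ᶠ n : ℕ in atTop, (mk n k : ℝ) * (n : ℝ) ^ θ' / (n.choose 2 : ℕ) ≤ 1 ∧ 0 < n.choose 2 ∧
      L ≤ ((n / k : ℕ) : ℝ) * ((mk n k : ℝ) * (n : ℝ) ^ θ' / (n.choose 2 : ℕ)) ^ k.choose 2 := by
  -- constants
  have hk3 : (3 : ℝ) ≤ k := by exact_mod_cast hk
  have hk0 : (0 : ℝ) < k := by linarith
  have hk1 : (0 : ℝ) < (k : ℝ) - 1 := by linarith
  set α : ℝ := 2 / ((k : ℝ) - 1) with hα
  have hα1 : α ≤ 1 := by rw [hα, div_le_one hk1]; linarith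
  have hθ0 : 0 < θ' := lt_trans (by positivity) hθlo
  set K : ℕ := k.choose 2 with hK
  have hKr : (K : ℝ) = k * ((k : ℝ) - 1) / 2 := by rw [hK, Nat.cast_choose_two]
  set γ : ℝ := 1 + θ' * K - k with hγ
  have hγ0 : 0 < γ := by
    have hKpos : (0 : ℝ) < k * ((k : ℝ) - 1) / 2 := div_pos (mul_pos hk0 hk1) two_pos
    have : ((k : ℝ) - 1) < θ' * K := by
      rw [hKr]
      have h1 : (k : ℝ) - 1 = 2 / (k : ℝ) * (k * ((k : ℝ) - 1) / 2) := by field_simp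
      calc (k : ℝ) - 1 = 2 / (k : ℝ) * (k * ((k : ℝ) - 1) / 2) := h1
        _ < θ' * (k * ((k : ℝ) - 1) / 2) := mul_lt_mul_of_pos_right hθlo hKpos
    rw [hγ]; linarith
  have hαK : α * K = k := by rw [hα, hKr]; field_simp
  -- eventualities
  have h8 : ∀ᶠ n : ℕ in atTop, 8 ≤ n := eventually_ge_atTop 8
  have h2k : ∀ᶠ n : ℕ in atTop, 2 * k ≤ n := eventually_ge_atTop (2 * k)
  have hgrow : ∀ᶠ n : ℕ in atTop, 2 * k * 2 ^ K * max L 0 ≤ (n : ℝ) ^ γ :=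
    ((tendsto_rpow_atTop hγ0).comp tendsto_natCast_atTop_atTop).eventually_ge_atTop _
  filter_upwards [h8, h2k, hgrow] with n hn8 hn2k hngrow
  have hn0 : (0 : ℝ) < n := by exact_mod_cast (show 0 < n by omega)
  have hn1 : (1 : ℝ) ≤ n := by exact_mod_cast (show 1 ≤ n by omega)
  have hN : (n : ℝ) ^ 2 / 4 ≤ ((n.choose 2 : ℕ) : ℝ) := sq_div_four_le_choose_two (by omega)
  have hNpos : (0 : ℝ) < ((n.choose 2 : ℕ) : ℝ) := by nlinarith
  set N : ℝ := ((n.choose 2 : ℕ) : ℝ) with hNdef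
  set m : ℝ := (mk n k : ℝ) with hmdef
  have hm_up : m ≤ N * (n : ℝ) ^ (-α) := by
    rw [hmdef, mk, hα, neg_div]
    exact Nat.floor_le (by positivity)
  have hm_lo : N * (n : ℝ) ^ (-α) - 1 ≤ m := by
    rw [hmdef, mk, hα, neg_div]
    have := Nat.lt_floor_add_one (((n.choose 2 : ℕ) : ℝ) * (n : ℝ) ^ (-(2 / ((k : ℝ) - 1))))
    linarith
  have hpow_θα : (n : ℝ) ^ (-α) * (n : ℝ) ^ θ' = (n : ℝ) ^ (θ' - α) := by
    rw [← Real.rpow_add hn0]; ring_nf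
  have hθα_neg : θ' - α < 0 := by rw [hα]; linarith
  have hnθα_le1 : (n : ℝ) ^ (θ' - α) ≤ 1 := Real.rpow_le_one_of_one_le_of_nonpos hn1 hθα_neg.le
  set q : ℝ := m * (n : ℝ) ^ θ' / N with hqdef
  -- (1) q ≤ 1
  have hq1 : q ≤ 1 := by
    rw [hqdef, div_le_one hNpos]
    calc m * (n : ℝ) ^ θ' ≤ N * (n : ℝ) ^ (-α) * (n : ℝ) ^ θ' :=
          mul_le_mul_of_nonneg_right hm_up (by positivity)
      _ = N * (n : ℝ) ^ (θ' - α) := by rw [mul_assoc, hpow_θα]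
      _ ≤ N * 1 := mul_le_mul_of_nonneg_left hnθα_le1 hNpos.le
      _ = N := mul_one _
  -- (2) q ≥ n^{θ'-α}/2
  have hq_lo : (n : ℝ) ^ (θ' - α) / 2 ≤ q := by
    have h1 : N * (n : ℝ) ^ (θ' - α) - (n : ℝ) ^ θ' ≤ m * (n : ℝ) ^ θ' := by
      calc N * (n : ℝ) ^ (θ' - α) - (n : ℝ) ^ θ'
          = (N * (n : ℝ) ^ (-α) - 1) * (n : ℝ) ^ θ' := by rw [sub_mul, mul_assoc, hpow_θα, one_mul]
        _ ≤ m * (n : ℝ) ^ θ' := mul_le_mul_of_nonneg_right hm_lo (by positivity)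
    -- n^{θ'} ≤ N n^{θ'-α}/2 since N n^{θ'-α} ≥ n^{1+θ'}/4 ≥ 2 n^{θ'}
    have h2 : (n : ℝ) ^ θ' ≤ N * (n : ℝ) ^ (θ' - α) / 2 := by
      have hexp : (n : ℝ) ^ (1 + θ') ≤ (n : ℝ) ^ 2 * (n : ℝ) ^ (θ' - α) := by
        rw [show (n : ℝ) ^ 2 = (n : ℝ) ^ (2 : ℝ) by norm_cast, ← Real.rpow_add hn0]
        exact Real.rpow_le_rpow_of_exponent_le hn1 (by linarith)
      have hpow1 : (n : ℝ) ^ (1 + θ') = n * (n : ℝ) ^ θ' := by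
        rw [Real.rpow_add hn0, Real.rpow_one]
      have h8r : (8 : ℝ) ≤ n := by exact_mod_cast hn8
      have hA : 0 ≤ (n : ℝ) ^ θ' := by positivity
      have : 8 * (n : ℝ) ^ θ' ≤ 4 * (N * (n : ℝ) ^ (θ' - α)) := by
        calc 8 * (n : ℝ) ^ θ' ≤ n * (n : ℝ) ^ θ' := mul_le_mul_of_nonneg_right h8r hA
          _ = (n : ℝ) ^ (1 + θ') := hpow1.symm
          _ ≤ (n : ℝ) ^ 2 * (n : ℝ) ^ (θ' - α) := hexp
          _ ≤ (4 * N) * (n : ℝ) ^ (θ' - α) := mul_le_mul_of_nonneg_right (by linarith) (by positivity)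
          _ = 4 * (N * (n : ℝ) ^ (θ' - α)) := by ring
      linarith
    have key : N * (n : ℝ) ^ (θ' - α) ≤ 2 * (m * (n : ℝ) ^ θ') := by linarith [h1, h2]
    rw [hqdef, div_le_div_iff₀ (by norm_num) hNpos]
    linarith [key]
  have hN0 : 0 < n.choose 2 := by
    have : (0 : ℝ) < ((n.choose 2 : ℕ) : ℝ) := by rw [← hNdef]; exact hNpos
    exact_mod_cast this
  refine ⟨hq1, hN0, ?_⟩
  -- (3) growth
  have hT : (n : ℝ) / (2 * k) ≤ ((n / k : ℕ) : ℝ) := by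
    have h1 : ((n / k : ℕ) : ℝ) * k ≥ n - k := by
      have := Nat.div_add_mod n k
      have hmod : (n % k : ℕ) < k := Nat.mod_lt n (by omega)
      have hcast : ((n / k : ℕ) : ℝ) * k + ((n % k : ℕ) : ℝ) = n := by
        rw [mul_comm]; exact_mod_cast this
      have hmodr : ((n % k : ℕ) : ℝ) < k := by exact_mod_cast hmod
      linarith
    have h2 : (n : ℝ) - k ≥ n / 2 := by
      have : (2 * k : ℝ) ≤ n := by exact_mod_cast hn2k
      linarith
    rw [div_le_iff₀ (by positivity)]
    linarith
  have hqK : (n : ℝ) ^ (θ' * K - k) / 2 ^ K ≤ q ^ K := by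
    have h := pow_le_pow_left₀ (by positivity) hq_lo K
    rw [div_pow, ← Real.rpow_natCast ((n : ℝ) ^ (θ' - α)) K, ← Real.rpow_mul hn0.le] at h
    have hexp : (θ' - α) * (K : ℝ) = θ' * K - k := by rw [sub_mul, hαK]
    rwa [hexp] at h
  have hmain : (n : ℝ) ^ γ / (2 * k * 2 ^ K) ≤ ((n / k : ℕ) : ℝ) * q ^ K := by
    have hsplit : (n : ℝ) ^ γ = n * (n : ℝ) ^ (θ' * K - k) := by
      rw [hγ, show 1 + θ' * K - k = 1 + (θ' * K - k) by ring, Real.rpow_add hn0, Real.rpow_one]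
    rw [hsplit, ← div_mul_div_comm]
    exact mul_le_mul hT hqK (by positivity) (Nat.cast_nonneg _)
  have hL : L ≤ (n : ℝ) ^ γ / (2 * k * 2 ^ K) := by
    rw [le_div_iff₀ (by positivity)]
    calc L * (2 * k * 2 ^ K) ≤ max L 0 * (2 * k * 2 ^ K) :=
          mul_le_mul_of_nonneg_right (le_max_left _ _) (by positivity)
      _ = 2 * k * 2 ^ K * max L 0 := by ring
      _ ≤ (n : ℝ) ^ γ := hngrow
  exact hL.trans hmain

/-- **The `q`-window of `Hyp` cannot reach the supercritical densities `qN ≈ m · n^{θ}`, `θ > 2/k`**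
(`d ≥ 1`, every `c`, `k ≥ 3`, every `δ > 0`): at `q = m n^{θ'}/C(n,2)` the constant-`1` circuit has
`G(n,q)`-error `Pr[no k-clique] ≤ (1 − q^{C(k,2)})^{⌊n/k⌋} ≤ δ` eventually, and `n^c < 1` fails. So
`Hyp` with that wider window is FALSE — it would make the crux vacuously true. [folklore] -/
theorem not_innerHypHighWindow {d : ℕ} (hd : 1 ≤ d) (c : ℕ) {k : ℕ} (hk : 3 ≤ k) {δ θ : ℝ}
    (hδ : 0 < δ) (hθ : 2 / (k : ℝ) < θ) :
    ¬ (∀ᶠ n : ℕ in atTop, ∀ q : ℝ, 0 ≤ q → q ≤ 1 →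
        (mk n k : ℝ) ≤ q * (n.choose 2 : ℕ) → q * (n.choose 2 : ℕ) ≤ (mk n k : ℝ) * (n : ℝ) ^ θ →
        ∀ C : Circuit ((⊤ : SimpleGraph (Fin n)).edgeSet), C.IsOver acBasis → C.acDepth ≤ d →
          gnpDisagreeProb n q C.eval (cliqueFn n k) ≤ δ → n ^ c < C.size) := by
  intro h
  have hk3 : (3 : ℝ) ≤ k := by exact_mod_cast hk
  have hkk : 2 / (k : ℝ) < 2 / ((k : ℝ) - 1) :=
    div_lt_div_of_pos_left two_pos (by linarith) (by linarith)
  set θ' : ℝ := min θ ((2 / (k : ℝ) + 2 / ((k : ℝ) - 1)) / 2) with hθ'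
  have hθlo : 2 / (k : ℝ) < θ' := lt_min hθ (by linarith)
  have hθhi : θ' < 2 / ((k : ℝ) - 1) := lt_of_le_of_lt (min_le_right _ _) (by linarith)
  have hθle : θ' ≤ θ := min_le_left _ _
  have hθ0 : 0 ≤ θ' := le_trans (by positivity) hθlo.le
  set L : ℝ := -Real.log δ with hL
  obtain ⟨n, hn, hn1, hq1, hN0, hgrow⟩ :=
    (h.and ((eventually_ge_atTop 1).and (highWindowHyp_eventually hk hθlo hθhi L))).exists
  set q : ℝ := (mk n k : ℝ) * (n : ℝ) ^ θ' / (n.choose 2 : ℕ) with hq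
  have hn1r : (1 : ℝ) ≤ n := by exact_mod_cast hn1
  have hNpos : (0 : ℝ) < ((n.choose 2 : ℕ) : ℝ) := by exact_mod_cast hN0
  have hq0 : 0 ≤ q := by positivity
  have hqN : q * (n.choose 2 : ℕ) = (mk n k : ℝ) * (n : ℝ) ^ θ' := by
    rw [hq, div_mul_cancel₀ _ hNpos.ne']
  -- window
  have hwin_lo : (mk n k : ℝ) ≤ q * (n.choose 2 : ℕ) := by
    rw [hqN]
    calc (mk n k : ℝ) = (mk n k : ℝ) * 1 := (mul_one _).symm
      _ ≤ (mk n k : ℝ) * (n : ℝ) ^ θ' :=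
          mul_le_mul_of_nonneg_left (Real.one_le_rpow hn1r hθ0) (Nat.cast_nonneg _)
  have hwin_hi : q * (n.choose 2 : ℕ) ≤ (mk n k : ℝ) * (n : ℝ) ^ θ := by
    rw [hqN]
    exact mul_le_mul_of_nonneg_left (Real.rpow_le_rpow_of_exponent_le hn1r hθle) (Nat.cast_nonneg _)
  -- the constant-1 circuit is δ-accurate at density q
  have hqK1 : q ^ k.choose 2 ≤ 1 := pow_le_one₀ hq0 hq1
  have herr : gnpDisagreeProb n q (Circuit.const _ true).eval (cliqueFn n k) ≤ δ := by
    rw [gnpDisagreeProb_const_true]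
    refine (gnpProb_cliqueFree_le_pow (n := n) k hq0 hq1).trans ?_
    have h1 := one_sub_pow_le_exp hqK1 (n / k)
    have h2 : Real.exp (-(((n / k : ℕ) : ℝ) * q ^ k.choose 2)) ≤ δ := by
      rw [← Real.le_log_iff_exp_le hδ]
      have : L ≤ ((n / k : ℕ) : ℝ) * q ^ k.choose 2 := hgrow
      rw [hL] at this
      linarith
    exact h1.trans h2
  have hlt := hn q hq0 hq1 hwin_lo hwin_hi (Circuit.const _ true)
    (Circuit.const_isOver_acBasis true) (by rw [Circuit.acDepth_const]; exact hd) herr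
  rw [Circuit.size_const] at hlt
  exact absurd (Nat.one_le_pow c n hn1) (not_le.2 hlt)

/-- **`k ≤ c` is impossible for the widened `q`-window of `Hyp` too** (`d ≥ 2`, every `θ ≥ 0`, every
`δ ≥ 0`): the clique DNF is exact at the central density `q = m/C(n,2)`. [folklore] -/
theorem not_innerHypHighWindow_of_le {d c k : ℕ} (hd : 2 ≤ d) (hk : 2 ≤ k) (hkc : k ≤ c) {δ θ : ℝ}
    (hδ : 0 ≤ δ) (hθ : 0 ≤ θ) :
    ¬ (∀ᶠ n : ℕ in atTop, ∀ q : ℝ, 0 ≤ q → q ≤ 1 →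
        (mk n k : ℝ) ≤ q * (n.choose 2 : ℕ) → q * (n.choose 2 : ℕ) ≤ (mk n k : ℝ) * (n : ℝ) ^ θ →
        ∀ C : Circuit ((⊤ : SimpleGraph (Fin n)).edgeSet), C.IsOver acBasis → C.acDepth ≤ d →
          gnpDisagreeProb n q C.eval (cliqueFn n k) ≤ δ → n ^ c < C.size) := by
  intro h
  obtain ⟨n, hn, hn2⟩ := (h.and (eventually_ge_atTop 2)).exists
  obtain ⟨C, hB, hD, hS, hE⟩ := exists_cliqueDNF n k
  obtain ⟨hq0, hq1, -⟩ := centre_density hn2 hk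
  have hNpos : (0 : ℝ) < ((n.choose 2 : ℕ) : ℝ) := by exact_mod_cast Nat.choose_pos hn2
  have hqN : (mk n k : ℝ) / (n.choose 2 : ℕ) * (n.choose 2 : ℕ) = (mk n k : ℝ) :=
    div_mul_cancel₀ _ hNpos.ne'
  have herr : gnpDisagreeProb n ((mk n k : ℝ) / (n.choose 2 : ℕ)) C.eval (cliqueFn n k) ≤ δ := by
    rw [gnpDisagreeProb_eq_zero_of_forall _ hE]
    exact hδ
  have hn1r : (1 : ℝ) ≤ n := by exact_mod_cast (show 1 ≤ n by omega)
  have hhi : (mk n k : ℝ) / (n.choose 2 : ℕ) * (n.choose 2 : ℕ) ≤ (mk n k : ℝ) * (n : ℝ) ^ θ := by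
    rw [hqN]
    calc ((mk n k : ℕ) : ℝ) = (mk n k : ℝ) * 1 := (mul_one _).symm
      _ ≤ (mk n k : ℝ) * (n : ℝ) ^ θ :=
          mul_le_mul_of_nonneg_left (Real.one_le_rpow hn1r hθ) (Nat.cast_nonneg _)
  have hlt := hn _ hq0 hq1 (by rw [hqN]) hhi C hB (hD.trans hd) herr
  exact absurd (hS.trans (choose_succ_le_pow hn2 hk hkc)) (not_le.2 hlt)

/-- **The global hypothesis with the `q`-window widened up to `m · n^{θ}` is false for EVERY `θ > 0`**
(`d = 2`, `c = ⌈2/θ⌉₊ + 1`): such a `Hyp` would make the crux vacuously true. [folklore] -/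
theorem not_hypHighWindow {θ : ℝ} (hθ : 0 < θ) :
    ¬ ∀ d c : ℕ, ∃ k : ℕ, 3 ≤ k ∧ ∃ δ : ℝ, 0 < δ ∧ (∀ᶠ n : ℕ in atTop, ∀ q : ℝ, 0 ≤ q → q ≤ 1 →
        (mk n k : ℝ) ≤ q * (n.choose 2 : ℕ) → q * (n.choose 2 : ℕ) ≤ (mk n k : ℝ) * (n : ℝ) ^ θ →
        ∀ C : Circuit ((⊤ : SimpleGraph (Fin n)).edgeSet), C.IsOver acBasis → C.acDepth ≤ d →
          gnpDisagreeProb n q C.eval (cliqueFn n k) ≤ δ → n ^ c < C.size) := by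
  intro h
  obtain ⟨k, hk, δ, hδ, hI⟩ := h 2 (⌈2 / θ⌉₊ + 1)
  by_cases hkc : k ≤ ⌈2 / θ⌉₊ + 1
  · exact not_innerHypHighWindow_of_le le_rfl (by omega) hkc hδ.le hθ.le hI
  · have hkθ : 2 / (k : ℝ) < θ := by
      have hceil : 2 / θ ≤ (⌈2 / θ⌉₊ : ℝ) := Nat.le_ceil _
      have hlt : (⌈2 / θ⌉₊ : ℝ) + 1 < k := by exact_mod_cast (show ⌈2 / θ⌉₊ + 1 < k by omega)
      have hk0 : (0 : ℝ) < k := by linarith [show (0:ℝ) ≤ (⌈2 / θ⌉₊ : ℝ) from Nat.cast_nonneg _]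
      rw [div_lt_iff₀ hk0]
      have : 2 / θ < k := by linarith
      rw [div_lt_iff₀ hθ] at this
      linarith [mul_comm θ (k:ℝ)]
    exact not_innerHypHighWindow (d := 2) (by norm_num) _ hk hδ hkθ hI

end HighWindowHyp

/-! ## Part VIII-E — the lower edges: `Hyp`'s `q`-window cannot reach `q·C(n,2) ≈ m · n^{-ε}` either,
and the global forms of both lower-edge statements

Hypothesis-side mirror of Part V (`not_innerConcLowWindow`): at the density `q = m n^{-ε}/C(n,2)` the
first moment (in tree: `gnpProb_clique_le`, `choose_mul_threshold_pow_le`) gives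
`Pr_{G(n,q)}[k-clique] ≤ (n^{-ε})^{C(k,2)} ≤ n^{-ε} → 0`, so the constant-`0` circuit is `δ`-accurate and
`n^c < 1` fails (`not_innerHypLowWindow`; `d ≥ 1`, every `c`, `k ≥ 2`, every `δ, ε > 0`). Globally:
`not_hypLowWindow`, `not_concLowWindow` (every `ε > 0`). With Parts V and VIII-A–D: the windows of BOTH
`Hyp` and `Conc` are pinned to `m · n^{±o(1)}`. -/

section LowWindowHyp

variable {n : ℕ}

/-- **The `q`-window of `Hyp` cannot reach the subcritical densities `qN ≈ m · n^{-ε}`** (`d ≥ 1`, every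
`c`, `k ≥ 2`, every `δ > 0`, `ε > 0`): there `Pr_{G(n,q)}[k-clique] ≤ n^{-ε} ≤ δ` eventually (first
moment), so the constant-`0` circuit (size `1`) is `δ`-accurate and `n ^ c < 1` fails. [folklore] -/
theorem not_innerHypLowWindow {d : ℕ} (hd : 1 ≤ d) (c : ℕ) {k : ℕ} (hk : 2 ≤ k) {δ ε : ℝ}
    (hδ : 0 < δ) (hε : 0 < ε) :
    ¬ (∀ᶠ n : ℕ in atTop, ∀ q : ℝ, 0 ≤ q → q ≤ 1 →
        (mk n k : ℝ) * (n : ℝ) ^ (-ε) ≤ q * (n.choose 2 : ℕ) → q * (n.choose 2 : ℕ) ≤ (mk n k : ℝ) →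
        ∀ C : Circuit ((⊤ : SimpleGraph (Fin n)).edgeSet), C.IsOver acBasis → C.acDepth ≤ d →
          gnpDisagreeProb n q C.eval (cliqueFn n k) ≤ δ → n ^ c < C.size) := by
  intro h
  have hsmall : ∀ᶠ n : ℕ in atTop, (n : ℝ) ^ (-ε) < δ :=
    ((tendsto_rpow_neg_atTop hε).comp tendsto_natCast_atTop_atTop).eventually (gt_mem_nhds hδ)
  obtain ⟨n, hn, hn2, hsm⟩ := (h.and ((eventually_ge_atTop 2).and hsmall)).exists
  have hn1 : 1 ≤ n := by omega
  have hn0 : (0 : ℝ) < n := by exact_mod_cast (show 0 < n by omega)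
  have hn1r : (1 : ℝ) ≤ n := by exact_mod_cast hn1
  have hNpos : (0 : ℝ) < ((n.choose 2 : ℕ) : ℝ) := by exact_mod_cast Nat.choose_pos hn2
  set α : ℝ := 2 / ((k : ℝ) - 1) with hα
  have hnε0 : 0 ≤ (n : ℝ) ^ (-ε) := Real.rpow_nonneg hn0.le _
  have hnε1 : (n : ℝ) ^ (-ε) ≤ 1 := Real.rpow_le_one_of_one_le_of_nonpos hn1r (by linarith)
  have hm0 : (0 : ℝ) ≤ (mk n k : ℝ) := Nat.cast_nonneg _
  have hm_up : (mk n k : ℝ) ≤ (n.choose 2 : ℕ) * (n : ℝ) ^ (-α) := by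
    rw [mk, hα, neg_div]
    exact Nat.floor_le (by positivity)
  have hmN : (mk n k : ℝ) ≤ (n.choose 2 : ℕ) := by exact_mod_cast mk_le_choose hn1 hk
  -- the witness density: the lower edge of the widened window
  set q : ℝ := (mk n k : ℝ) * (n : ℝ) ^ (-ε) / (n.choose 2 : ℕ) with hq
  have hq0 : 0 ≤ q := by positivity
  have hqN : q * (n.choose 2 : ℕ) = (mk n k : ℝ) * (n : ℝ) ^ (-ε) := by
    rw [hq, div_mul_cancel₀ _ hNpos.ne']
  have hq1 : q ≤ 1 := by
    rw [hq, div_le_one hNpos]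
    calc (mk n k : ℝ) * (n : ℝ) ^ (-ε) ≤ (mk n k : ℝ) * 1 := mul_le_mul_of_nonneg_left hnε1 hm0
      _ ≤ (n.choose 2 : ℕ) := by rw [mul_one]; exact hmN
  have hwin_hi : q * (n.choose 2 : ℕ) ≤ (mk n k : ℝ) := by
    rw [hqN]
    calc (mk n k : ℝ) * (n : ℝ) ^ (-ε) ≤ (mk n k : ℝ) * 1 := mul_le_mul_of_nonneg_left hnε1 hm0
      _ = (mk n k : ℝ) := mul_one _
  -- q = b · n^{-α} with b ≤ n^{-ε}
  set b : ℝ := (mk n k : ℝ) * (n : ℝ) ^ (-ε) * (n : ℝ) ^ α / (n.choose 2 : ℕ) with hb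
  have hb0 : 0 ≤ b := by positivity
  have hqb : q = b * (n : ℝ) ^ (-(2 : ℝ) / ((k : ℝ) - 1)) := by
    rw [neg_div, ← hα, hb, hq, div_mul_eq_mul_div, mul_assoc ((mk n k : ℝ) * (n : ℝ) ^ (-ε)),
      ← Real.rpow_add hn0, add_neg_cancel, Real.rpow_zero, mul_one]
  have hb_le : b ≤ (n : ℝ) ^ (-ε) := by
    rw [hb, div_le_iff₀ hNpos]
    calc (mk n k : ℝ) * (n : ℝ) ^ (-ε) * (n : ℝ) ^ α
        ≤ ((n.choose 2 : ℕ) * (n : ℝ) ^ (-α)) * (n : ℝ) ^ (-ε) * (n : ℝ) ^ α :=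
          mul_le_mul_of_nonneg_right (mul_le_mul_of_nonneg_right hm_up hnε0) (by positivity)
      _ = (n : ℝ) ^ (-ε) * (n.choose 2 : ℕ) * ((n : ℝ) ^ (-α) * (n : ℝ) ^ α) := by ring
      _ = (n : ℝ) ^ (-ε) * (n.choose 2 : ℕ) := by
          rw [← Real.rpow_add hn0, neg_add_cancel, Real.rpow_zero, mul_one]
  have hb1 : b ≤ 1 := hb_le.trans hnε1
  -- the constant-0 circuit is δ-accurate at density q
  have herr : gnpDisagreeProb n q (Circuit.const _ false).eval (cliqueFn n k) ≤ δ := by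
    rw [gnpDisagreeProb_const_false]
    refine (gnpProb_clique_le hq0 hq1 k).trans ?_
    rw [hqb]
    refine (choose_mul_threshold_pow_le hk hn1 hb0).trans ?_
    have hK1 : 1 ≤ k.choose 2 := Nat.choose_pos hk
    calc b ^ k.choose 2 ≤ b ^ 1 := pow_le_pow_of_le_one hb0 hb1 hK1
      _ = b := pow_one b
      _ ≤ (n : ℝ) ^ (-ε) := hb_le
      _ ≤ δ := hsm.le
  have hlt := hn q hq0 hq1 (by rw [hqN]) hwin_hi (Circuit.const _ false)
    (Circuit.const_isOver_acBasis false) (by rw [Circuit.acDepth_const]; exact hd) herr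
  rw [Circuit.size_const] at hlt
  exact absurd (Nat.one_le_pow c n hn1) (not_le.2 hlt)

/-- **The global hypothesis with the `q`-window widened down to `m · n^{-ε}` is false for every
`ε > 0`** (any witness `k ≥ 3` is killed by the constant-`0` circuit at `d = 1`, `c = 0`). [folklore] -/
theorem not_hypLowWindow {ε : ℝ} (hε : 0 < ε) :
    ¬ ∀ d c : ℕ, ∃ k : ℕ, 3 ≤ k ∧ ∃ δ : ℝ, 0 < δ ∧ (∀ᶠ n : ℕ in atTop, ∀ q : ℝ, 0 ≤ q → q ≤ 1 →
        (mk n k : ℝ) * (n : ℝ) ^ (-ε) ≤ q * (n.choose 2 : ℕ) → q * (n.choose 2 : ℕ) ≤ (mk n k : ℝ) →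
        ∀ C : Circuit ((⊤ : SimpleGraph (Fin n)).edgeSet), C.IsOver acBasis → C.acDepth ≤ d →
          gnpDisagreeProb n q C.eval (cliqueFn n k) ≤ δ → n ^ c < C.size) := by
  intro h
  obtain ⟨k, hk, δ, hδ, hI⟩ := h 1 0
  exact not_innerHypLowWindow le_rfl 0 (by omega) hδ hε hI

/-- **The global conclusion with the `j`-window widened down to `m · n^{-ε}` is false for every
`ε > 0`** (Part V's `not_innerConcLowWindow` at `d = 1`, `c = 0`). [folklore] -/
theorem not_concLowWindow {ε : ℝ} (hε : 0 < ε) :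
    ¬ ∀ d c : ℕ, ∃ k : ℕ, 3 ≤ k ∧ ∃ δ : ℝ, 0 < δ ∧ (∀ᶠ n : ℕ in atTop, ∀ j : ℕ,
        (mk n k : ℝ) * (n : ℝ) ^ (-ε) ≤ j → j ≤ mk n k →
        ∀ C : Circuit ((⊤ : SimpleGraph (Fin n)).edgeSet), C.IsOver acBasis → C.acDepth ≤ d →
          (sliceErr n j C.eval (cliqueFn n k) : ℝ) ≤ δ * sliceCard n j → n ^ c < C.size) := by
  intro h
  obtain ⟨k, hk, δ, hδ, hI⟩ := h 1 0
  exact not_innerConcLowWindow le_rfl 0 hk hδ hε hI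

end LowWindowHyp

/-! ## Part IX — the constraint `3 ≤ k` is not cosmetic: at `k = 2` the window collapses to the empty slice -/

/-- **`m_2(n) = 0`**: at `k = 2` the "threshold count" is `⌊C(n,2) · n^{-2}⌋₊ = 0` (density `n^{-2}`,
below one edge). [folklore] -/
theorem mk_two (n : ℕ) : mk n 2 = 0 := by
  unfold mk
  refine Nat.floor_eq_zero.2 ?_
  rcases Nat.eq_zero_or_pos n with rfl | hn
  · norm_num
  have hn0 : (0 : ℝ) < n := by exact_mod_cast hn
  have hexp : (-(2 : ℝ) / ((2 : ℕ) - 1 : ℝ)) = -2 := by norm_num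
  rw [hexp, Real.rpow_neg hn0.le, show (2 : ℝ) = ((2 : ℕ) : ℝ) by norm_num, Real.rpow_natCast,
    Nat.cast_choose_two]
  rw [← div_eq_mul_inv, div_lt_one (by positivity)]
  nlinarith

/-- **The inner clause of `Conc` at `k = 2` is false** (`d ≥ 1`, every `c`, every `δ ≥ 0`): the
window `|j − m_2(n)| ≤ m_2(n)^{3/4} = 0` is the single EMPTY slice `j = 0`, where `CLIQUE_2 = 0` and the
constant-`0` circuit (size `1`) is exact, so `n^c < 1` fails. Hence `3 ≤ k` in `Conc`/`Hyp` is the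
first value for which the threshold window is non-degenerate (`m_k(n) → ∞` iff `k ≥ 3`). [folklore] -/
theorem not_innerConc_two {d : ℕ} (hd : 1 ≤ d) (c : ℕ) {δ : ℝ} (hδ : 0 ≤ δ) :
    ¬ (∀ᶠ n : ℕ in atTop, ∀ j : ℕ, |(j : ℝ) - (mk n 2 : ℝ)| ≤ (mk n 2 : ℝ) ^ ((3 : ℝ) / 4) →
        ∀ C : Circuit ((⊤ : SimpleGraph (Fin n)).edgeSet), C.IsOver acBasis → C.acDepth ≤ d →
          (sliceErr n j C.eval (cliqueFn n 2) : ℝ) ≤ δ * sliceCard n j → n ^ c < C.size) := by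
  intro h
  obtain ⟨n, hn, hn1⟩ := (h.and (eventually_ge_atTop 1)).exists
  have hwin : |((0 : ℕ) : ℝ) - (mk n 2 : ℝ)| ≤ (mk n 2 : ℝ) ^ ((3 : ℝ) / 4) := by
    rw [mk_two]
    simp
  have herr : (sliceErr n 0 (Circuit.const _ false).eval (cliqueFn n 2) : ℝ) ≤ δ * sliceCard n 0 := by
    have h0 : sliceErr n 0 (Circuit.const _ false).eval (cliqueFn n 2) = 0 := by
      rw [sliceErr, Finset.card_eq_zero, Finset.filter_eq_empty_iff]
      rintro x - ⟨hx, hne⟩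
      rw [eq_false_of_edgeCount_eq_zero hx, Circuit.eval_const, cliqueFn_false le_rfl] at hne
      exact hne rfl
    rw [h0, Nat.cast_zero]
    exact mul_nonneg hδ (Nat.cast_nonneg _)
  have hlt := hn 0 hwin (Circuit.const _ false) (Circuit.const_isOver_acBasis false)
    (by rw [Circuit.acDepth_const]; exact hd) herr
  rw [Circuit.size_const] at hlt
  exact absurd (Nat.one_le_pow c n hn1) (not_le.2 hlt)

/-- **Allowing `k = 2` in `Conc` makes it false** (the `∃ k ≥ 3` cannot be relaxed to `∃ k ≥ 2` with a
universally quantified `k`-range starting at `2`; precisely: the variant `∀ d c, ∀ k ≥ 2, ∃ δ > 0, …`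
fails already at `k = 2`). [folklore] -/
theorem not_concFromTwo :
    ¬ ∀ d c : ℕ, ∀ k : ℕ, 2 ≤ k → ∃ δ : ℝ, 0 < δ ∧ (∀ᶠ n : ℕ in atTop, ∀ j : ℕ,
        |(j : ℝ) - (mk n k : ℝ)| ≤ (mk n k : ℝ) ^ ((3 : ℝ) / 4) →
        ∀ C : Circuit ((⊤ : SimpleGraph (Fin n)).edgeSet), C.IsOver acBasis → C.acDepth ≤ d →
          (sliceErr n j C.eval (cliqueFn n k) : ℝ) ≤ δ * sliceCard n j → n ^ c < C.size) := fun h => by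
  obtain ⟨δ, hδ, hI⟩ := h 1 0 2 le_rfl
  exact not_innerConc_two le_rfl 0 hδ.le hI


end Summit.PneNP.PneNP.Cruxes.SliceACZero.Disproof

end
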